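import Literature.Analysis.FunctionSpaces.SquaredBesselUniqueness
import Literature.Probability.Process.DoobMaximalIneq
import Literature.Probability.Process.UCPLimit
import HarnessLib

/-!
# Existence of squared Bessel processes; well-posedness of `BESQ^δ(z₀)`

Discharge of the named facts `Literature.Analysis.FunctionSpaces.exists_squaredBessel` (`SquaredBessel.lean`) and
`Literature.Analysis.FunctionSpaces.existsUnique_squaredBessel` (`ItoProcesses.lean`; Revuz–Yor, Ch. XI, §1: "for every `δ`
and `x`, this equation has a unique strong solution"): for all real `δ, z₀` the squared Bessel
SDE `dZ = δ dt + 2√|Z| dB`, `Z₀ = z₀`, driven by the canonical Brownian motion `B = Literature.brownian`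
on `(ℝ≥0 → ℝ, preWienerMeasure)`, has a strong solution adapted to the *raw* Brownian filtration
`𝓕⁰ = Literature.brownianFiltration` (`exists_squaredBessel_holds`); together with pathwise uniqueness
(`pathwiseUnique_squaredBessel_holds`, `SquaredBesselUniqueness.lean`) this gives
`existsUnique_squaredBessel_holds`.

Revuz–Yor obtain existence from the Yamada–Watanabe theorem Ch. IX, Thm (1.7) (weak existence +
pathwise uniqueness ⇒ strong existence). Here, on the canonical space with its raw filtration,
the solution is constructed directly as the limit of the **Euler–Maruyama scheme** with
truncated coefficient `σₙ = σ ∧ n` (`σ(z) = 2√|z|`, `Literature.Analysis.FunctionSpaces.besqσ`) on the dyadic grid of mesh `2⁻ⁿ`,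

  `zⁿ_{k+1} = zⁿ_k + δ 2⁻ⁿ + σₙ(zⁿ_k) (B_{(k+1)/2ⁿ} - B_{k/2ⁿ})`,  `zⁿ_0 = z₀`,

whose convergence for the Hölder-`½` coefficient `σ` follows from the Yamada–Watanabe functional
(Yamada 1978; the method of Gyöngy–Rásonyi 2011). The file has three parts.

## Part 1 — the scheme and its `L²` bookkeeping

* `Literature.Analysis.FunctionSpaces.eulerPt`, `Literature.Analysis.FunctionSpaces.eulerSP` (the integrand `σₙ(zⁿ_k)` on `(k/2ⁿ, (k+1)/2ⁿ]` as a bounded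
  simple process), `Literature.eulerZ n t = z₀ + δ t + (eulerSP n · B)_t` (the continuous-time Euler
  process; it interpolates the scheme, `eulerZ_grid`);
* measurability/adaptedness, the step formula `toProcess_of_times_eq_dyadicTimes`;
* the moment bound `1 + E[(zⁿ_k)²] ≤ (1 + z₀²) exp(L k/2ⁿ)`, `L = |δ| + 2 + δ²`
  (`one_add_integral_eulerPt_sq_le`), from the one-step identity
  `E[(y + V ΔB)²] = E[y²] + h E[V²]` (independent centred increment; cf. Gyöngy–Rásonyi 2011,
  Lemma 1.2);
* the one-cell increment bound `E[(Zⁿ_b - Zⁿ_a)²] ≤ 2⁻ⁿ (δ² + 4 M)` for `a = k/2ⁿ ≤ b ≤ a + 2⁻ⁿ`;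
* the refinement of `eulerSP n` to the grid of mesh `2⁻ᵐ`, `m ≥ n`, and the **difference
  process** `eulerDiff n m` on that grid with `(eulerDiff n m · B) = (eulerSP n · B) - (eulerSP m · B)
  = Zⁿ - Zᵐ` (the drifts cancel), to which the Itô–Taylor estimate is applied.

## Part 2 — the scheme is Cauchy (Yamada–Watanabe `L¹` estimate)

* `integral_abs_eulerZ_sub_le_of_params` / `exists_forall_integral_abs_eulerZ_sub_le` —
  the **Yamada–Watanabe `L¹` estimate**: for every `T` and `κ > 0` there is `N` with
  `E|Zⁿ_t - Zᵐ_t| ≤ κ` for `N ≤ n ≤ m`, `t ≤ T`. Proof: `Zⁿ - Zᵐ = Rₙₘ · B` is the elementary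
  integral of the difference process (`Literature.Analysis.FunctionSpaces.eulerDiff`); the Itô–Taylor estimate in expectation
  (`SimpleProcess.ito_taylor_estimate_brownian`) for the smooth Yamada–Watanabe functions `F_ε`
  (`Literature.Analysis.FunctionSpaces.ywF`, `F_ε''(x)|x| ≤ 1`) gives `E[F_ε(Zⁿ_t - Zᵐ_t)] ≤ 6t + (t/2ε) γ(n, m) + err`, where the
  cell term `E[F_ε''(D) ζ²]` is bounded through `ζ² ≤ 3(σ-σₙ)² + 12|D| + 12|ΔZⁿ| + 3(σ-σₘ)²`
  (Hölder bound `(σ(x) - σ(y))² ≤ 4|x - y|`, truncation errors `16 M/n²`, one-cell increments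
  `E|ΔZⁿ| ≤ √(2⁻ⁿ(δ² + 4M))`), and `λ|x| ≤ F_ε(x) + λ ε sinh(λ + 1)`; then `λ → ∞`, `ε → 0`,
  `η → 0`, `n → ∞` in this order (Yamada 1978; the method of Gyöngy–Rásonyi 2011, Prop. 2.2/Thm 2.1,
  applied to two approximations instead of `X - Xⁿ`);
* `exists_forall_integral_eulerZ_sub_sq_le` — the **`L²` estimate** `E[(Zⁿ_t - Zᵐ_t)²] ≤ κ`
  (Itô isometry for `Rₙₘ` and the `L¹` estimate inside the Hölder bound);
* `cauchy_ucp_eulerM` — by Doob's maximal inequality the martingale parts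
  `Mⁿ = Literature.eulerM n = eulerSP n · B` are Cauchy uniformly on compacts in probability.

## Part 3 — the limit is a squared Bessel process

The martingale parts `Mⁿ` converge u.c.p. (`Literature.Probability.Process.exists_tendstoUCP_of_cauchy`) to a strongly
adapted process with a.s. continuous paths, of which we take the progressive version `J`
(`Literature.Analysis.FunctionSpaces.dyadicReg`; jointly measurable). Then:

* `Mⁿ_t → J_t` in `L²` (Fatou along the a.s. convergent subsequence and the `L²` Cauchy
  estimate), `J_t ∈ L²`, and **`J` is a martingale** for the raw filtration (set integrals
  pass to the limit) — so the local-martingale conjunct of `IsItoIntegral` holds with the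
  constant localising sequence;
* the Euler integrands `eulerSP n = σₙ(Zⁿ(⌊·⌋ₙ))` **approximate `σ(Z)`**, `Z = z₀ + δ t + J`
  (`Literature.Analysis.FunctionSpaces.eulerLimitZ`), in `L²(ds ⊗ P)` on every `[0, t]` (truncation error, one-cell increments,
  and `E|Zⁿ_s - Z_s| → 0`), hence in the sense `SimpleProcess.IsApproxSeq` (Tonelli + Markov);
  since their elementary integrals converge u.c.p. to `J`, the "for every approximating sequence"
  clause follows from `tendstoUCP_of_isApproxSeq_brownian`. Thus `IsItoIntegral (σ ∘ Z) B J` and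
  `Z` is a strong solution (`exists_isSquaredBesselProcess`).

## References

* D. Revuz, M. Yor, *Continuous Martingales and Brownian Motion* (3rd ed., 1999), Ch. XI, §1,
  p. 439 and Def. (1.1); Ch. IX, Def. (1.2), (1.5), Thm (1.7), Thm (3.5)(ii); Ch. II, Thm (1.7)
  (Doob's inequality); Ch. IV, Def. (2.3), Thm (2.2), Thm (2.12), Prop. (2.13).
* T. Yamada, *Sur une construction des solutions d'équations différentielles stochastiques dans
  le cas non-lipschitzien*, Sém. Probab. XII, LNM 649 (1978), 114–131 (Euler–Maruyama
  approximation under the Yamada–Watanabe condition).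
* I. Gyöngy, M. Rásonyi, *A note on Euler approximations for SDEs with Hölder continuous
  diffusion coefficients*, Stoch. Proc. Appl. 121 (2011), 2189–2200, Lemma 1.2, Prop. 2.2,
  Thm 2.1.
* T. Yamada, S. Watanabe, *On the uniqueness of solutions of stochastic differential equations*,
  J. Math. Kyoto Univ. 11 (1971), 155–167, Thm 1.
-/

open MeasureTheory ProbabilityTheory Filter Finset
open scoped NNReal ENNReal Topology

noncomputable section

namespace Literature.Analysis.FunctionSpaces

/-! ## Part 1 — the Euler–Maruyama scheme and its `L²` bookkeeping -/

/-! ### Dyadic-grid simple processes: construction with in-range measurability, step formula -/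

section SimpleProcess
open Literature.Probability.Process (SimpleProcess)
open Literature.Probability.Process.SimpleProcess

variable {Ω : Type*} {m : MeasurableSpace Ω} {𝓕 : Filtration ℝ≥0 m}

/-- The bounded simple process on the dyadic grid `k/2ⁿ`, `k ≤ n 2ⁿ`, with prescribed values,
measurability being required only in range.
Revuz–Yor, *Continuous Martingales and Brownian Motion* (1999), Ch. IV, Def. (2.3). [folklore] -/
def _root_.Literature.Probability.Process.SimpleProcess.onDyadic' (n : ℕ) (v : ℕ → Ω → ℝ)
    (hv : ∀ k : ℕ, k < n * 2 ^ n + 1 → StronglyMeasurable[𝓕 ((k : ℝ≥0) / 2 ^ n)] (v k))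
    (hb : ∃ C, ∀ k ω, |v k ω| ≤ C) : SimpleProcess m 𝓕 where
  times := Literature.Probability.Process.dyadicTimes n
  sorted := Literature.Probability.Process.sortedLT_dyadicTimes n
  value := v
  measurable k hk := by
    have heq : (Literature.Probability.Process.dyadicTimes n).get ⟨k, hk⟩ = (k : ℝ≥0) / 2 ^ n := Literature.Probability.Process.getElem_dyadicTimes n hk
    rw [heq]
    exact hv k (by simpa using hk)
  bounded := hb

/-- The values of `onDyadic'`. [folklore] -/
@[simp] theorem _root_.Literature.Probability.Process.SimpleProcess.onDyadic'_value (n : ℕ) (v : ℕ → Ω → ℝ)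
    (hv : ∀ k : ℕ, k < n * 2 ^ n + 1 → StronglyMeasurable[𝓕 ((k : ℝ≥0) / 2 ^ n)] (v k))
    (hb : ∃ C, ∀ k ω, |v k ω| ≤ C) : (onDyadic' n v hv hb).value = v := rfl

/-- The partition of `onDyadic'`. [folklore] -/
@[simp] theorem _root_.Literature.Probability.Process.SimpleProcess.onDyadic'_times (n : ℕ) (v : ℕ → Ω → ℝ)
    (hv : ∀ k : ℕ, k < n * 2 ^ n + 1 → StronglyMeasurable[𝓕 ((k : ℝ≥0) / 2 ^ n)] (v k))
    (hb : ∃ C, ∀ k ω, |v k ω| ≤ C) : (onDyadic' n v hv hb).times = Literature.Probability.Process.dyadicTimes n := rfl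

/-- In range, the values of a dyadic-grid simple process are `𝓕_{k/2ⁿ}`-strongly measurable.
[folklore] -/
theorem _root_.Literature.Probability.Process.SimpleProcess.stronglyMeasurable_value_of_times_eq_dyadicTimes (H : SimpleProcess m 𝓕) {n : ℕ}
    (h : H.times = Literature.Probability.Process.dyadicTimes n) {k : ℕ} (hk : k < n * 2 ^ n + 1) :
    StronglyMeasurable[𝓕 ((k : ℝ≥0) / 2 ^ n)] (H.value k) := by
  have := H.stronglyMeasurable_value (i := k) (by rw [h]; simpa using hk)
  rwa [H.time_of_times_eq_dyadicTimes h hk] at this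

/-- **The step formula on the dyadic grid**: for `0 < s ≤ n`, a simple process on the dyadic
grid of mesh `2⁻ⁿ` takes at `s` its value of index `⌈s 2ⁿ⌉ - 1` (the cell
`(k/2ⁿ, (k+1)/2ⁿ] ∋ s`). [folklore] -/
theorem _root_.Literature.Probability.Process.SimpleProcess.toProcess_of_times_eq_dyadicTimes (H : SimpleProcess m 𝓕) {n : ℕ}
    (h : H.times = Literature.Probability.Process.dyadicTimes n) {s : ℝ≥0} (hs0 : 0 < s) (hsn : s ≤ n) (ω : Ω) :
    H.toProcess s ω = H.value (⌈(s : ℝ) * 2 ^ n⌉₊ - 1) ω := by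
  set k : ℕ := ⌈(s : ℝ) * 2 ^ n⌉₊ - 1 with hk
  have h2 : (0 : ℝ) < 2 ^ n := pow_pos two_pos n
  have hs2 : 0 < (s : ℝ) * 2 ^ n := mul_pos (by exact_mod_cast hs0) h2
  have hceil : 1 ≤ ⌈(s : ℝ) * 2 ^ n⌉₊ := Nat.one_le_iff_ne_zero.2 (Nat.ceil_pos.2 hs2).ne'
  have hk1 : k + 1 = ⌈(s : ℝ) * 2 ^ n⌉₊ := by omega
  have hkle : k + 1 ≤ n * 2 ^ n := by
    rw [hk1]
    refine Nat.ceil_le.2 ?_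
    have : (s : ℝ) ≤ n := by exact_mod_cast hsn
    push_cast
    nlinarith
  have hklen : k + 1 < H.times.length := by rw [h]; simp; omega
  refine toProcess_eq_value_of_mem_Ioc _ hklen ?_ ω
  rw [H.time_of_times_eq_dyadicTimes h (by omega), H.time_of_times_eq_dyadicTimes h (by omega)]
  constructor
  · rw [div_lt_iff₀ (pow_pos two_pos n)]
    have : (k : ℝ) < (s : ℝ) * 2 ^ n := by
      have := Nat.ceil_lt_add_one hs2.le
      rw [← hk1] at this
      push_cast at this
      linarith
    exact_mod_cast this
  · rw [le_div_iff₀ (pow_pos two_pos n)]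
    have : (s : ℝ) * 2 ^ n ≤ ((k + 1 : ℕ) : ℝ) := by
      rw [hk1]; exact Nat.le_ceil _
    exact_mod_cast this

/-- The sampling index is in range: for `0 < s ≤ n`, `⌈s 2ⁿ⌉ - 1 < n 2ⁿ`. [folklore] -/
theorem _root_.Literature.Probability.Process.SimpleProcess.ceil_sub_one_lt {n : ℕ} {s : ℝ≥0} (hs0 : 0 < s) (hsn : s ≤ n) :
    ⌈(s : ℝ) * 2 ^ n⌉₊ - 1 < n * 2 ^ n := by
  have h2 : (0 : ℝ) < 2 ^ n := pow_pos two_pos n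
  have hs2 : 0 < (s : ℝ) * 2 ^ n := mul_pos (by exact_mod_cast hs0) h2
  have hceil : 1 ≤ ⌈(s : ℝ) * 2 ^ n⌉₊ := Nat.one_le_iff_ne_zero.2 (Nat.ceil_pos.2 hs2).ne'
  have : ⌈(s : ℝ) * 2 ^ n⌉₊ ≤ n * 2 ^ n := by
    refine Nat.ceil_le.2 ?_
    have : (s : ℝ) ≤ n := by exact_mod_cast hsn
    push_cast
    nlinarith
  omega

end SimpleProcess

/-- The left end point `sampleLeft n s = (⌈s 2ⁿ⌉ - 1)/2ⁿ` of the dyadic cell of `s > 0`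
satisfies `sampleLeft n s ≤ s ≤ sampleLeft n s + 2⁻ⁿ`. [folklore] -/
theorem le_sampleLeft_add {n : ℕ} {s : ℝ≥0} (hs0 : 0 < s) :
    Literature.Probability.Process.sampleLeft n s ≤ s ∧ s ≤ Literature.Probability.Process.sampleLeft n s + 1 / 2 ^ n := by
  obtain ⟨h1, h2⟩ := Literature.Probability.Process.sampleLeft_le_and_sub_le (n := n) hs0
  refine ⟨h1, ?_⟩
  rw [← NNReal.coe_le_coe, NNReal.coe_add, NNReal.coe_div, NNReal.coe_one, NNReal.coe_pow,
    NNReal.coe_ofNat]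
  linarith

/-- **Nesting of the dyadic grids**: for `n ≤ m`, the coarse cell of the fine grid point
`(j+1)/2ᵐ` starts at or before `j/2ᵐ`: `sampleLeft n ((j+1)/2ᵐ) ≤ j/2ᵐ`. [folklore] -/
theorem sampleLeft_le_of_le {n m : ℕ} (hnm : n ≤ m) (j : ℕ) :
    Literature.Probability.Process.sampleLeft n (((j + 1 : ℕ) : ℝ≥0) / 2 ^ m) ≤ ((j : ℕ) : ℝ≥0) / 2 ^ m := by
  set u : ℝ≥0 := ((j + 1 : ℕ) : ℝ≥0) / 2 ^ m with hu
  set k : ℕ := ⌈(u : ℝ) * 2 ^ n⌉₊ - 1 with hk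
  have h2n : (0 : ℝ) < 2 ^ n := pow_pos two_pos n
  have h2m : (0 : ℝ) < 2 ^ m := pow_pos two_pos m
  have hu0 : 0 < (u : ℝ) := by
    rw [hu]
    push_cast
    positivity
  have hs2 : 0 < (u : ℝ) * 2 ^ n := mul_pos hu0 h2n
  -- `k < u 2ⁿ`, i.e. `k 2ᵐ < (j+1) 2ⁿ`, i.e. `k 2^{m-n} < j + 1`
  have hklt : (k : ℝ) < (u : ℝ) * 2 ^ n := by
    have := Nat.ceil_lt_add_one hs2.le
    have hceil : 1 ≤ ⌈(u : ℝ) * 2 ^ n⌉₊ := Nat.one_le_iff_ne_zero.2 (Nat.ceil_pos.2 hs2).ne'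
    have hk1 : ((k : ℕ) : ℝ) = (⌈(u : ℝ) * 2 ^ n⌉₊ : ℝ) - 1 := by
      rw [hk, Nat.cast_sub hceil, Nat.cast_one]
    linarith
  have hpow : (2 : ℝ) ^ m = 2 ^ n * 2 ^ (m - n) := by rw [← pow_add, Nat.add_sub_cancel' hnm]
  have hnat : k * 2 ^ (m - n) < j + 1 := by
    have hureal : (u : ℝ) = (j + 1) / 2 ^ m := by
      rw [hu]
      push_cast
      ring
    have : (k : ℝ) * 2 ^ (m - n) < j + 1 := by
      rw [hureal, hpow] at hklt
      have h2mn : (0 : ℝ) < 2 ^ (m - n) := pow_pos two_pos _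
      rw [div_mul_eq_mul_div, lt_div_iff₀ (by positivity)] at hklt
      nlinarith
    exact_mod_cast this
  have hnat' : k * 2 ^ (m - n) ≤ j := Nat.lt_succ_iff.1 hnat
  -- conclude in `ℝ≥0`
  show ((k : ℕ) : ℝ≥0) / 2 ^ n ≤ ((j : ℕ) : ℝ≥0) / 2 ^ m
  rw [← NNReal.coe_le_coe]
  simp only [NNReal.coe_div, NNReal.coe_natCast, NNReal.coe_pow, NNReal.coe_ofNat]
  rw [div_le_div_iff₀ h2n h2m, hpow]
  have : ((k * 2 ^ (m - n) : ℕ) : ℝ) ≤ j := by exact_mod_cast hnat'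
  push_cast at this
  nlinarith [pow_pos (two_pos : (0 : ℝ) < 2) n]

/-! ### The Euler–Maruyama scheme -/

section Scheme

variable (δ z₀ : ℝ)

/-- The truncated diffusion coefficient `σₙ = σ ∧ n` (`clamp n ∘ besqσ`). [folklore] -/
def besqσTrunc (n : ℕ) (z : ℝ) : ℝ := Literature.Probability.Process.clamp n (besqσ z)

/-- `|σₙ| ≤ n`. [folklore] -/
theorem abs_besqσTrunc_le (n : ℕ) (z : ℝ) : |besqσTrunc n z| ≤ n := by
  have := Literature.Probability.Process.abs_clamp_le n (besqσ z)
  rwa [Nat.abs_cast] at this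

/-- `|σₙ| ≤ σ`. [folklore] -/
theorem abs_besqσTrunc_le_besqσ (n : ℕ) (z : ℝ) : |besqσTrunc n z| ≤ besqσ z := by
  have := Literature.Probability.Process.abs_clamp_le_abs (Nat.cast_nonneg n) (besqσ z)
  rwa [abs_of_nonneg (besqσ_nonneg z)] at this

/-- `σₙ² ≤ 4 |z|`. [folklore] -/
theorem besqσTrunc_sq_le (n : ℕ) (z : ℝ) : besqσTrunc n z ^ 2 ≤ 4 * |z| := by
  have h := abs_besqσTrunc_le_besqσ n z
  have hσ : besqσ z ^ 2 = 4 * |z| := by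
    rw [besqσ, mul_pow, Real.sq_sqrt (abs_nonneg z)]; ring
  calc besqσTrunc n z ^ 2 = |besqσTrunc n z| ^ 2 := (sq_abs _).symm
    _ ≤ besqσ z ^ 2 := pow_le_pow_left₀ (abs_nonneg _) h 2
    _ = 4 * |z| := hσ

/-- `σₙ⁴ ≤ 16 z²`. [folklore] -/
theorem besqσTrunc_pow_four_le (n : ℕ) (z : ℝ) : besqσTrunc n z ^ 4 ≤ 16 * z ^ 2 := by
  have h := besqσTrunc_sq_le n z
  calc besqσTrunc n z ^ 4 = (besqσTrunc n z ^ 2) ^ 2 := by ring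
    _ ≤ (4 * |z|) ^ 2 := pow_le_pow_left₀ (sq_nonneg _) h 2
    _ = 16 * z ^ 2 := by rw [mul_pow, sq_abs]; ring

/-- **The truncation error**: `(σ(z) - σₙ(z))² ≤ 16 z²/n²` for `n ≥ 1` (it vanishes unless
`σ(z) > n`, and then `σ² ≤ σ⁴/n² = 16 z²/n²`). [folklore] -/
theorem sq_besqσ_sub_besqσTrunc_le {n : ℕ} (hn : 1 ≤ n) (z : ℝ) :
    (besqσ z - besqσTrunc n z) ^ 2 ≤ 16 * z ^ 2 / n ^ 2 := by
  have hσ0 := besqσ_nonneg z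
  have hn0 : (0 : ℝ) < n := by exact_mod_cast hn
  by_cases h : besqσ z ≤ n
  · have : besqσTrunc n z = besqσ z := Literature.Probability.Process.clamp_eq_self (by rwa [abs_of_nonneg hσ0])
    rw [this, sub_self, zero_pow two_ne_zero]
    positivity
  · push Not at h
    have ht : besqσTrunc n z = n := by
      simp only [besqσTrunc, Literature.Probability.Process.clamp]
      rw [min_eq_left h.le, max_eq_right (by linarith)]
    rw [ht]
    have hσ2 : besqσ z ^ 2 = 4 * |z| := by
      rw [besqσ, mul_pow, Real.sq_sqrt (abs_nonneg z)]; ring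
    have h1 : (besqσ z - n) ^ 2 ≤ besqσ z ^ 2 := by nlinarith
    have h2 : besqσ z ^ 2 * n ^ 2 ≤ besqσ z ^ 2 * besqσ z ^ 2 :=
      mul_le_mul_of_nonneg_left (pow_le_pow_left₀ hn0.le h.le 2) (sq_nonneg _)
    rw [le_div_iff₀ (by positivity)]
    calc (besqσ z - n) ^ 2 * n ^ 2 ≤ besqσ z ^ 2 * n ^ 2 :=
          mul_le_mul_of_nonneg_right h1 (sq_nonneg _)
      _ ≤ besqσ z ^ 2 * besqσ z ^ 2 := h2
      _ = 16 * z ^ 2 := by rw [hσ2, ← sq_abs z]; ring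

/-- `σₙ` is continuous. [folklore] -/
theorem continuous_besqσTrunc (n : ℕ) : Continuous (besqσTrunc n) :=
  (Literature.Probability.Process.continuous_clamp n).comp continuous_besqσ

/-- **The Euler–Maruyama points** `zⁿ_k` (`k`-th grid point `k/2ⁿ`):
`zⁿ_0 = z₀`, `zⁿ_{k+1} = zⁿ_k + δ 2⁻ⁿ + σₙ(zⁿ_k) (B_{(k+1)/2ⁿ} - B_{k/2ⁿ})`.
Yamada (1978); Gyöngy–Rásonyi (2011), §1 (Euler's polygonal approximation). [folklore] -/
def eulerPt (n : ℕ) : ℕ → (ℝ≥0 → ℝ) → ℝ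
  | 0 => fun _ ↦ z₀
  | k + 1 => fun ω ↦ eulerPt n k ω + δ * (1 / 2 ^ n) +
      besqσTrunc n (eulerPt n k ω) *
        (Literature.Probability.Process.brownian (((k + 1 : ℕ) : ℝ≥0) / 2 ^ n) ω - Literature.Probability.Process.brownian (((k : ℕ) : ℝ≥0) / 2 ^ n) ω)

/-- Unfolding of the Euler recursion. [folklore] -/
theorem eulerPt_succ (n k : ℕ) (ω : ℝ≥0 → ℝ) :
    eulerPt δ z₀ n (k + 1) ω = eulerPt δ z₀ n k ω + δ * (1 / 2 ^ n) +
      besqσTrunc n (eulerPt δ z₀ n k ω) *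
        (Literature.Probability.Process.brownian (((k + 1 : ℕ) : ℝ≥0) / 2 ^ n) ω - Literature.Probability.Process.brownian (((k : ℕ) : ℝ≥0) / 2 ^ n) ω) :=
  rfl

/-- The Euler points start at `z₀`. [folklore] -/
@[simp] theorem eulerPt_zero (n : ℕ) (ω : ℝ≥0 → ℝ) : eulerPt δ z₀ n 0 ω = z₀ := rfl

/-- **Adaptedness of the scheme**: `zⁿ_k` is `𝓕⁰_{k/2ⁿ}`-strongly measurable. [folklore] -/
theorem stronglyMeasurable_eulerPt (n : ℕ) :
    ∀ k : ℕ, StronglyMeasurable[Literature.Probability.RandomPlanarGeometry.brownianFiltration (((k : ℕ) : ℝ≥0) / 2 ^ n)] (eulerPt δ z₀ n k)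
  | 0 => stronglyMeasurable_const
  | k + 1 => by
    have hle : ((k : ℕ) : ℝ≥0) / 2 ^ n ≤ ((k + 1 : ℕ) : ℝ≥0) / 2 ^ n :=
      div_le_div_of_nonneg_right (by exact_mod_cast Nat.le_succ k) (pow_pos two_pos n).le
    have hk := (stronglyMeasurable_eulerPt n k).mono (Literature.Probability.RandomPlanarGeometry.brownianFiltration.mono hle)
    have hB1 := Literature.Probability.RandomPlanarGeometry.stronglyAdapted_brownian (((k + 1 : ℕ) : ℝ≥0) / 2 ^ n)
    have hB0 := (Literature.Probability.RandomPlanarGeometry.stronglyAdapted_brownian (((k : ℕ) : ℝ≥0) / 2 ^ n)).mono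
      (Literature.Probability.RandomPlanarGeometry.brownianFiltration.mono hle)
    exact (hk.add stronglyMeasurable_const).add
      (((continuous_besqσTrunc n).comp_stronglyMeasurable hk).mul (hB1.sub hB0))

/-- `zⁿ_k` is measurable. [folklore] -/
theorem measurable_eulerPt (n k : ℕ) : Measurable (eulerPt δ z₀ n k) :=
  ((stronglyMeasurable_eulerPt δ z₀ n k).mono (Literature.Probability.RandomPlanarGeometry.brownianFiltration.le _)).measurable

/-- **The Euler integrand** as a bounded simple process: value `σₙ(zⁿ_k)` on the cell
`(k/2ⁿ, (k+1)/2ⁿ]`, `k < n 2ⁿ`.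
Yamada (1978); Gyöngy–Rásonyi (2011), §1. [folklore] -/
def eulerSP (n : ℕ) : Literature.Probability.Process.SimpleProcess (inferInstance : MeasurableSpace (ℝ≥0 → ℝ)) Literature.Probability.RandomPlanarGeometry.brownianFiltration :=
  Literature.Probability.Process.SimpleProcess.onDyadic' n (fun k ω ↦ besqσTrunc n (eulerPt δ z₀ n k ω))
    (fun k _ ↦ (continuous_besqσTrunc n).comp_stronglyMeasurable (stronglyMeasurable_eulerPt δ z₀ n k))
    ⟨n, fun _ _ ↦ abs_besqσTrunc_le n _⟩

/-- The values of the Euler integrand. [folklore] -/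
@[simp] theorem eulerSP_value (n k : ℕ) (ω : ℝ≥0 → ℝ) :
    (eulerSP δ z₀ n).value k ω = besqσTrunc n (eulerPt δ z₀ n k ω) := rfl

/-- The partition of the Euler integrand. [folklore] -/
@[simp] theorem eulerSP_times (n : ℕ) : (eulerSP δ z₀ n).times = Literature.Probability.Process.dyadicTimes n := rfl

/-- **The continuous-time Euler process** `Zⁿ_t = z₀ + δ t + (eulerSP n · B)_t`.
Yamada (1978); Gyöngy–Rásonyi (2011), §1. [folklore] -/
def eulerZ (n : ℕ) : ℝ≥0 → (ℝ≥0 → ℝ) → ℝ := fun t ω ↦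
  z₀ + δ * (t : ℝ) + (eulerSP δ z₀ n).integral Literature.Probability.Process.brownian t ω

/-- The Euler process starts at `z₀`. [folklore] -/
@[simp] theorem eulerZ_zero (n : ℕ) (ω : ℝ≥0 → ℝ) : eulerZ δ z₀ n 0 ω = z₀ := by
  simp [eulerZ]

/-- **The Euler process moves by `δ (b - a) + σₙ(zⁿ_k) (B_b - B_a)` inside the cell
`[k/2ⁿ, (k+1)/2ⁿ] ∋ a ≤ b`** (`a = k/2ⁿ`). [folklore] -/
theorem eulerZ_sub_eulerZ_grid (n : ℕ) {k : ℕ} (hk : k < n * 2 ^ n) {b : ℝ≥0}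
    (hab : ((k : ℕ) : ℝ≥0) / 2 ^ n ≤ b) (hb : b ≤ ((k + 1 : ℕ) : ℝ≥0) / 2 ^ n) (ω : ℝ≥0 → ℝ) :
    eulerZ δ z₀ n b ω - eulerZ δ z₀ n (((k : ℕ) : ℝ≥0) / 2 ^ n) ω =
      δ * ((b : ℝ) - (((k : ℕ) : ℝ≥0) / 2 ^ n : ℝ≥0)) +
        besqσTrunc n (eulerPt δ z₀ n k ω) * (Literature.Probability.Process.brownian b ω - Literature.Probability.Process.brownian (((k : ℕ) : ℝ≥0) / 2 ^ n) ω) := by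
  have hlen : k + 1 < (eulerSP δ z₀ n).times.length := by simp; omega
  have h := (eulerSP δ z₀ n).integral_min_succ_sub Literature.Probability.Process.brownian hlen b ω
  rw [(eulerSP δ z₀ n).time_of_times_eq_dyadicTimes rfl (by omega),
    (eulerSP δ z₀ n).time_of_times_eq_dyadicTimes rfl (by omega), min_eq_left hb,
    min_eq_right hab] at h
  simp only [eulerZ, eulerSP_value] at h ⊢
  linarith

/-- **The Euler process interpolates the scheme**: `Zⁿ_{k/2ⁿ} = zⁿ_k` for `k ≤ n 2ⁿ`. [folklore] -/
theorem eulerZ_grid (n : ℕ) : ∀ {k : ℕ}, k ≤ n * 2 ^ n → ∀ ω,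
    eulerZ δ z₀ n (((k : ℕ) : ℝ≥0) / 2 ^ n) ω = eulerPt δ z₀ n k ω
  | 0, _, ω => by simp [eulerZ]
  | k + 1, hk, ω => by
    have hk' : k < n * 2 ^ n := by omega
    have hle : ((k : ℕ) : ℝ≥0) / 2 ^ n ≤ ((k + 1 : ℕ) : ℝ≥0) / 2 ^ n :=
      div_le_div_of_nonneg_right (by exact_mod_cast Nat.le_succ k) (pow_pos two_pos n).le
    have h := eulerZ_sub_eulerZ_grid δ z₀ n hk' hle le_rfl ω
    rw [eulerZ_grid n hk'.le ω] at h
    rw [eulerPt_succ]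
    have hdt : (((((k + 1 : ℕ) : ℝ≥0) / 2 ^ n : ℝ≥0) : ℝ) - (((k : ℕ) : ℝ≥0) / 2 ^ n : ℝ≥0)) =
        1 / 2 ^ n := by
      push_cast
      ring
    rw [hdt] at h
    linarith

/-- **The step process of the Euler integrand**: for `0 < s ≤ n`,
`(eulerSP n)(s) = σₙ(Zⁿ(sampleLeft n s))`. [folklore] -/
theorem toProcess_eulerSP (n : ℕ) {s : ℝ≥0} (hs0 : 0 < s) (hsn : s ≤ n) (ω : ℝ≥0 → ℝ) :
    (eulerSP δ z₀ n).toProcess s ω = besqσTrunc n (eulerZ δ z₀ n (Literature.Probability.Process.sampleLeft n s) ω) := by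
  rw [(eulerSP δ z₀ n).toProcess_of_times_eq_dyadicTimes rfl hs0 hsn, eulerSP_value]
  congr 1
  rw [Literature.Probability.Process.sampleLeft, eulerZ_grid δ z₀ n (Literature.Probability.Process.SimpleProcess.ceil_sub_one_lt hs0 hsn).le]

/-- The Euler process is adapted (strongly, to the raw Brownian filtration). [folklore] -/
theorem stronglyAdapted_eulerZ (n : ℕ) : StronglyAdapted Literature.Probability.RandomPlanarGeometry.brownianFiltration (eulerZ δ z₀ n) :=
  fun t ↦ (stronglyMeasurable_const.add stronglyMeasurable_const).add
    ((Literature.Probability.Process.martingale_integral_brownian _).stronglyAdapted t)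

/-- The Euler process is measurable at each time. [folklore] -/
theorem measurable_eulerZ (n : ℕ) (t : ℝ≥0) : Measurable (eulerZ δ z₀ n t) :=
  ((stronglyAdapted_eulerZ δ z₀ n t).mono (Literature.Probability.RandomPlanarGeometry.brownianFiltration.le t)).measurable

/-- The Euler process has continuous paths (everywhere). [folklore] -/
theorem continuous_eulerZ (n : ℕ) (ω : ℝ≥0 → ℝ) : Continuous (eulerZ δ z₀ n · ω) :=
  (continuous_const.add (continuous_const.mul NNReal.continuous_coe)).add
    ((eulerSP δ z₀ n).continuous_integral (Literature.Probability.Process.continuous_brownian ω))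

/-! ### Moment bounds -/

/-- **One Euler step in `L²`**: for `y, V` `𝓕⁰_a`-measurable with `y ∈ L²`, `|V| ≤ C`, and
`a ≤ b`, the step `y + V (B_b - B_a)` is in `L²` with
`E[(y + V (B_b - B_a))²] = E[y²] + (b - a) E[V²]` (independent centred increment). [folklore] -/
theorem integral_add_mul_brownian_sub_sq {a b : ℝ≥0} (hab : a ≤ b) {y V : (ℝ≥0 → ℝ) → ℝ} {C : ℝ}
    (hy : StronglyMeasurable[Literature.Probability.RandomPlanarGeometry.brownianFiltration a] y) (hy2 : MemLp y 2 Literature.Probability.Process.preWienerMeasure)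
    (hV : StronglyMeasurable[Literature.Probability.RandomPlanarGeometry.brownianFiltration a] V) (hVC : ∀ ω, |V ω| ≤ C) :
    MemLp (fun ω ↦ y ω + V ω * (Literature.Probability.Process.brownian b - Literature.Probability.Process.brownian a) ω) 2 Literature.Probability.Process.preWienerMeasure ∧
    ∫ ω, (y ω + V ω * (Literature.Probability.Process.brownian b - Literature.Probability.Process.brownian a) ω) ^ 2 ∂Literature.Probability.Process.preWienerMeasure =
      (∫ ω, y ω ^ 2 ∂Literature.Probability.Process.preWienerMeasure) + ((b : ℝ) - a) * ∫ ω, V ω ^ 2 ∂Literature.Probability.Process.preWienerMeasure := by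
  haveI := Literature.Probability.RandomPlanarGeometry.isProbabilityMeasure_preWienerMeasure'
  have hD2 : MemLp (fun ω ↦ V ω * (Literature.Probability.Process.brownian b - Literature.Probability.Process.brownian a) ω) 2 Literature.Probability.Process.preWienerMeasure :=
    Literature.Probability.Process.memLp_two_mul_brownian_sub hV hVC
  refine ⟨hy2.add hD2, ?_⟩
  have e1 : ∫ ω, y ω * (V ω * (Literature.Probability.Process.brownian b - Literature.Probability.Process.brownian a) ω) ∂Literature.Probability.Process.preWienerMeasure = 0 := by
    have : ∀ ω, y ω * (V ω * (Literature.Probability.Process.brownian b - Literature.Probability.Process.brownian a) ω) =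
        (y ω * V ω) * (Literature.Probability.Process.brownian b - Literature.Probability.Process.brownian a) ω := fun ω ↦ by ring
    simp_rw [this]
    exact Literature.Probability.Process.integral_mul_brownian_sub_eq_zero hab (hy.mul hV)
  have e2 : ∫ ω, (V ω * (Literature.Probability.Process.brownian b - Literature.Probability.Process.brownian a) ω) ^ 2 ∂Literature.Probability.Process.preWienerMeasure =
      ((b : ℝ) - a) * ∫ ω, V ω ^ 2 ∂Literature.Probability.Process.preWienerMeasure := by
    have : ∀ ω, (V ω * (Literature.Probability.Process.brownian b - Literature.Probability.Process.brownian a) ω) ^ 2 =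
        V ω ^ 2 * (Literature.Probability.Process.brownian b - Literature.Probability.Process.brownian a) ω ^ 2 := fun ω ↦ by ring
    simp_rw [this]
    exact Literature.Probability.Process.integral_mul_brownian_sub_sq hab (hV.pow 2)
  have hi1 : Integrable (fun ω ↦ y ω ^ 2) Literature.Probability.Process.preWienerMeasure := hy2.integrable_sq
  have hi2 : Integrable (fun ω ↦ y ω * (V ω * (Literature.Probability.Process.brownian b - Literature.Probability.Process.brownian a) ω)) Literature.Probability.Process.preWienerMeasure :=
    hy2.integrable_mul hD2
  have hi3 : Integrable (fun ω ↦ (V ω * (Literature.Probability.Process.brownian b - Literature.Probability.Process.brownian a) ω) ^ 2) Literature.Probability.Process.preWienerMeasure :=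
    hD2.integrable_sq
  have hexp : ∀ ω, (y ω + V ω * (Literature.Probability.Process.brownian b - Literature.Probability.Process.brownian a) ω) ^ 2 =
      y ω ^ 2 + 2 * (y ω * (V ω * (Literature.Probability.Process.brownian b - Literature.Probability.Process.brownian a) ω)) +
        (V ω * (Literature.Probability.Process.brownian b - Literature.Probability.Process.brownian a) ω) ^ 2 := fun ω ↦ by ring
  simp_rw [hexp]
  have h12 : Integrable (fun ω ↦ y ω ^ 2 + 2 * (y ω * (V ω * (Literature.Probability.Process.brownian b - Literature.Probability.Process.brownian a) ω)))
      Literature.Probability.Process.preWienerMeasure := hi1.add (hi2.const_mul 2)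
  rw [integral_add h12 hi3, integral_add hi1 (hi2.const_mul 2), integral_const_mul, e1, e2]
  ring

/-- The growth constant `L = |δ| + 2 + δ²` of the second moments of the scheme. [folklore] -/
def eulerRate (δ : ℝ) : ℝ := |δ| + 2 + δ ^ 2

/-- `L ≥ 0`. [folklore] -/
theorem eulerRate_nonneg (δ : ℝ) : 0 ≤ eulerRate δ := by unfold eulerRate; positivity

/-- **The pointwise one-step growth inequality**: for `0 ≤ h ≤ 1`,
`(z + δ h)² + h σₙ(z)² ≤ z² + L h (1 + z²)`. [folklore] -/
theorem sq_add_add_mul_sq_le (n : ℕ) {h : ℝ} (hh0 : 0 ≤ h) (hh1 : h ≤ 1) (z : ℝ) :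
    (z + δ * h) ^ 2 + h * besqσTrunc n z ^ 2 ≤ z ^ 2 + eulerRate δ * h * (1 + z ^ 2) := by
  have h1 := besqσTrunc_sq_le n z
  have h2 : |z| ≤ (1 + z ^ 2) / 2 := by nlinarith [sq_abs z, sq_nonneg (|z| - 1)]
  have hδ : δ * z ≤ |δ| * |z| := by
    rw [← abs_mul]; exact le_abs_self _
  have p1 : h * (δ * z) ≤ h * (|δ| * |z|) := mul_le_mul_of_nonneg_left hδ hh0
  have p2 : h * besqσTrunc n z ^ 2 ≤ h * (4 * |z|) := mul_le_mul_of_nonneg_left h1 hh0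
  have q1 : h * |z| ≤ h * ((1 + z ^ 2) / 2) := mul_le_mul_of_nonneg_left h2 hh0
  have q2 : h ^ 2 ≤ h * (1 + z ^ 2) := by nlinarith [sq_nonneg z]
  have hc : (0 : ℝ) ≤ 2 * |δ| + 4 := by positivity
  have q1' := mul_le_mul_of_nonneg_left q1 hc
  have q2' := mul_le_mul_of_nonneg_left q2 (sq_nonneg δ)
  calc (z + δ * h) ^ 2 + h * besqσTrunc n z ^ 2
      = z ^ 2 + 2 * (h * (δ * z)) + δ ^ 2 * h ^ 2 + h * besqσTrunc n z ^ 2 := by ring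
    _ ≤ z ^ 2 + 2 * (h * (|δ| * |z|)) + δ ^ 2 * h ^ 2 + h * (4 * |z|) := by linarith
    _ = z ^ 2 + (2 * |δ| + 4) * (h * |z|) + δ ^ 2 * h ^ 2 := by ring
    _ ≤ z ^ 2 + (2 * |δ| + 4) * (h * ((1 + z ^ 2) / 2)) + δ ^ 2 * (h * (1 + z ^ 2)) := by linarith
    _ = z ^ 2 + eulerRate δ * h * (1 + z ^ 2) := by unfold eulerRate; ring

/-- **Moments of the Euler scheme**: `zⁿ_k ∈ L²` and
`1 + E[(zⁿ_k)²] ≤ (1 + z₀²) (1 + L 2⁻ⁿ)^k`.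
Gyöngy–Rásonyi (2011), Lemma 1.2 (moment bounds for the Euler scheme); standard. [folklore] -/
theorem memLp_eulerPt_and_integral_sq_le (n : ℕ) : ∀ k : ℕ,
    MemLp (eulerPt δ z₀ n k) 2 Literature.Probability.Process.preWienerMeasure ∧
      1 + ∫ ω, eulerPt δ z₀ n k ω ^ 2 ∂Literature.Probability.Process.preWienerMeasure ≤
        (1 + z₀ ^ 2) * (1 + eulerRate δ * (1 / 2 ^ n)) ^ k
  | 0 => by
    haveI := Literature.Probability.RandomPlanarGeometry.isProbabilityMeasure_preWienerMeasure'
    refine ⟨memLp_const z₀, ?_⟩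
    simp
  | k + 1 => by
    haveI := Literature.Probability.RandomPlanarGeometry.isProbabilityMeasure_preWienerMeasure'
    obtain ⟨hk2, hkb⟩ := memLp_eulerPt_and_integral_sq_le n k
    have hle : ((k : ℕ) : ℝ≥0) / 2 ^ n ≤ ((k + 1 : ℕ) : ℝ≥0) / 2 ^ n :=
      div_le_div_of_nonneg_right (by exact_mod_cast Nat.le_succ k) (pow_pos two_pos n).le
    set h : ℝ := 1 / 2 ^ n with hh
    have hh0 : 0 ≤ h := by positivity
    have hh1 : h ≤ 1 := by
      rw [hh, div_le_one (pow_pos two_pos n)]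
      exact one_le_pow₀ one_le_two
    -- the step as `y + V ΔB`
    have hy : StronglyMeasurable[Literature.Probability.RandomPlanarGeometry.brownianFiltration (((k : ℕ) : ℝ≥0) / 2 ^ n)]
        (fun ω ↦ eulerPt δ z₀ n k ω + δ * h) :=
      (stronglyMeasurable_eulerPt δ z₀ n k).add stronglyMeasurable_const
    have hy2 : MemLp (fun ω ↦ eulerPt δ z₀ n k ω + δ * h) 2 Literature.Probability.Process.preWienerMeasure :=
      hk2.add (memLp_const _)
    have hV : StronglyMeasurable[Literature.Probability.RandomPlanarGeometry.brownianFiltration (((k : ℕ) : ℝ≥0) / 2 ^ n)]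
        (fun ω ↦ besqσTrunc n (eulerPt δ z₀ n k ω)) :=
      (continuous_besqσTrunc n).comp_stronglyMeasurable (stronglyMeasurable_eulerPt δ z₀ n k)
    obtain ⟨hmem, hint⟩ := integral_add_mul_brownian_sub_sq hle hy hy2 hV
      (fun ω ↦ abs_besqσTrunc_le n _)
    have hdt : ((((k + 1 : ℕ) : ℝ≥0) / 2 ^ n : ℝ≥0) : ℝ) - ((((k : ℕ) : ℝ≥0) / 2 ^ n : ℝ≥0) : ℝ) = h := by
      push_cast
      rw [hh]
      ring
    rw [hdt] at hint
    have heq : eulerPt δ z₀ n (k + 1) =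
        fun ω ↦ (eulerPt δ z₀ n k ω + δ * h) + besqσTrunc n (eulerPt δ z₀ n k ω) *
          (Literature.Probability.Process.brownian (((k + 1 : ℕ) : ℝ≥0) / 2 ^ n) - Literature.Probability.Process.brownian (((k : ℕ) : ℝ≥0) / 2 ^ n)) ω := by
      funext ω
      rw [eulerPt_succ, Pi.sub_apply]
    refine ⟨by rw [heq]; exact hmem, ?_⟩
    have hI : (∫ ω, eulerPt δ z₀ n (k + 1) ω ^ 2 ∂Literature.Probability.Process.preWienerMeasure) =
        ∫ ω, ((eulerPt δ z₀ n k ω + δ * h) + besqσTrunc n (eulerPt δ z₀ n k ω) *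
          (Literature.Probability.Process.brownian (((k + 1 : ℕ) : ℝ≥0) / 2 ^ n) - Literature.Probability.Process.brownian (((k : ℕ) : ℝ≥0) / 2 ^ n)) ω) ^ 2
          ∂Literature.Probability.Process.preWienerMeasure := by
      simp only [heq]
    rw [hI, hint]
    -- pointwise growth inequality, integrated
    have hpt : ∀ ω, (eulerPt δ z₀ n k ω + δ * h) ^ 2 + h * besqσTrunc n (eulerPt δ z₀ n k ω) ^ 2 ≤
        eulerPt δ z₀ n k ω ^ 2 + eulerRate δ * h * (1 + eulerPt δ z₀ n k ω ^ 2) := fun ω ↦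
      sq_add_add_mul_sq_le δ n hh0 hh1 _
    have hi1 : Integrable (fun ω ↦ (eulerPt δ z₀ n k ω + δ * h) ^ 2) Literature.Probability.Process.preWienerMeasure :=
      hy2.integrable_sq
    have hi2 : Integrable (fun ω ↦ besqσTrunc n (eulerPt δ z₀ n k ω) ^ 2) Literature.Probability.Process.preWienerMeasure := by
      refine (integrable_const ((n : ℝ) ^ 2)).mono'
        (((continuous_besqσTrunc n).measurable.comp (measurable_eulerPt δ z₀ n k)).pow_const
          2).aestronglyMeasurable (ae_of_all _ fun ω ↦ ?_)
      rw [Real.norm_eq_abs, abs_of_nonneg (sq_nonneg _), ← sq_abs]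
      exact pow_le_pow_left₀ (abs_nonneg _) (abs_besqσTrunc_le n _) 2
    have hi3 : Integrable (fun ω ↦ eulerPt δ z₀ n k ω ^ 2) Literature.Probability.Process.preWienerMeasure := hk2.integrable_sq
    have hstep : (∫ ω, (eulerPt δ z₀ n k ω + δ * h) ^ 2 ∂Literature.Probability.Process.preWienerMeasure) +
        h * ∫ ω, besqσTrunc n (eulerPt δ z₀ n k ω) ^ 2 ∂Literature.Probability.Process.preWienerMeasure ≤
        (∫ ω, eulerPt δ z₀ n k ω ^ 2 ∂Literature.Probability.Process.preWienerMeasure) +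
          eulerRate δ * h * (1 + ∫ ω, eulerPt δ z₀ n k ω ^ 2 ∂Literature.Probability.Process.preWienerMeasure) := by
      have hL : Integrable (fun ω ↦ (eulerPt δ z₀ n k ω + δ * h) ^ 2 +
          h * besqσTrunc n (eulerPt δ z₀ n k ω) ^ 2) Literature.Probability.Process.preWienerMeasure := hi1.add (hi2.const_mul h)
      have h1z : Integrable (fun ω ↦ 1 + eulerPt δ z₀ n k ω ^ 2) Literature.Probability.Process.preWienerMeasure :=
        (integrable_const _).add hi3
      have hR : Integrable (fun ω ↦ eulerPt δ z₀ n k ω ^ 2 +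
          eulerRate δ * h * (1 + eulerPt δ z₀ n k ω ^ 2)) Literature.Probability.Process.preWienerMeasure :=
        hi3.add (h1z.const_mul _)
      have hmono := integral_mono hL hR hpt
      rw [integral_add hi1 (hi2.const_mul h), integral_const_mul, integral_add hi3 (h1z.const_mul _),
        integral_const_mul, integral_add (integrable_const _) hi3] at hmono
      simpa using hmono
    have hL := eulerRate_nonneg δ
    calc 1 + ((∫ ω, (eulerPt δ z₀ n k ω + δ * h) ^ 2 ∂Literature.Probability.Process.preWienerMeasure) +
          h * ∫ ω, besqσTrunc n (eulerPt δ z₀ n k ω) ^ 2 ∂Literature.Probability.Process.preWienerMeasure)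
        ≤ (1 + ∫ ω, eulerPt δ z₀ n k ω ^ 2 ∂Literature.Probability.Process.preWienerMeasure) * (1 + eulerRate δ * h) := by
          nlinarith
      _ ≤ (1 + z₀ ^ 2) * (1 + eulerRate δ * (1 / 2 ^ n)) ^ k * (1 + eulerRate δ * h) :=
          mul_le_mul_of_nonneg_right hkb (by positivity)
      _ = (1 + z₀ ^ 2) * (1 + eulerRate δ * (1 / 2 ^ n)) ^ (k + 1) := by rw [hh]; ring

/-- `zⁿ_k ∈ L²`. [folklore] -/
theorem memLp_eulerPt (n k : ℕ) : MemLp (eulerPt δ z₀ n k) 2 Literature.Probability.Process.preWienerMeasure :=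
  (memLp_eulerPt_and_integral_sq_le δ z₀ n k).1

/-- The moment bound `M(T) = (1 + z₀²) exp(L T)`. [folklore] -/
def eulerMom (δ z₀ : ℝ) (T : ℝ) : ℝ := (1 + z₀ ^ 2) * Real.exp (eulerRate δ * T)

/-- `M(T) ≥ 1`. [folklore] -/
theorem one_le_eulerMom {T : ℝ} (hT : 0 ≤ T) : 1 ≤ eulerMom δ z₀ T := by
  unfold eulerMom
  have h1 : 1 ≤ 1 + z₀ ^ 2 := by nlinarith
  have h2 : 1 ≤ Real.exp (eulerRate δ * T) := Real.one_le_exp (mul_nonneg (eulerRate_nonneg δ) hT)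
  nlinarith

/-- **Uniform second-moment bound**: `1 + E[(zⁿ_k)²] ≤ M(T)` whenever `k/2ⁿ ≤ T`.
Gyöngy–Rásonyi (2011), Lemma 1.2. [folklore] -/
theorem one_add_integral_eulerPt_sq_le (n : ℕ) {k : ℕ} {T : ℝ} (hk : (k : ℝ) / 2 ^ n ≤ T) :
    1 + ∫ ω, eulerPt δ z₀ n k ω ^ 2 ∂Literature.Probability.Process.preWienerMeasure ≤ eulerMom δ z₀ T := by
  refine (memLp_eulerPt_and_integral_sq_le δ z₀ n k).2.trans ?_
  unfold eulerMom
  refine mul_le_mul_of_nonneg_left ?_ (by positivity)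
  have hL := eulerRate_nonneg δ
  calc (1 + eulerRate δ * (1 / 2 ^ n)) ^ k ≤ (Real.exp (eulerRate δ * (1 / 2 ^ n))) ^ k := by
        refine pow_le_pow_left₀ (by positivity) ?_ k
        have := Real.add_one_le_exp (eulerRate δ * (1 / 2 ^ n))
        linarith
    _ = Real.exp (eulerRate δ * ((k : ℝ) / 2 ^ n)) := by
        rw [← Real.exp_nat_mul]; congr 1; ring
    _ ≤ Real.exp (eulerRate δ * T) := Real.exp_le_exp.2 (mul_le_mul_of_nonneg_left hk hL)

/-- `E[(zⁿ_k)²] ≤ M(T)` for `k/2ⁿ ≤ T`. [folklore] -/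
theorem integral_eulerPt_sq_le (n : ℕ) {k : ℕ} {T : ℝ} (hk : (k : ℝ) / 2 ^ n ≤ T) :
    ∫ ω, eulerPt δ z₀ n k ω ^ 2 ∂Literature.Probability.Process.preWienerMeasure ≤ eulerMom δ z₀ T := by
  have := one_add_integral_eulerPt_sq_le δ z₀ n hk
  linarith

/-- `E|zⁿ_k| ≤ M(T)` for `k/2ⁿ ≤ T` (`|z| ≤ (1 + z²)/2`). [folklore] -/
theorem integral_abs_eulerPt_le (n : ℕ) {k : ℕ} {T : ℝ} (hk : (k : ℝ) / 2 ^ n ≤ T) :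
    ∫ ω, |eulerPt δ z₀ n k ω| ∂Literature.Probability.Process.preWienerMeasure ≤ eulerMom δ z₀ T := by
  haveI := Literature.Probability.RandomPlanarGeometry.isProbabilityMeasure_preWienerMeasure'
  have h2 := (memLp_eulerPt δ z₀ n k).integrable_sq
  calc ∫ ω, |eulerPt δ z₀ n k ω| ∂Literature.Probability.Process.preWienerMeasure
      ≤ ∫ ω, (1 + eulerPt δ z₀ n k ω ^ 2) ∂Literature.Probability.Process.preWienerMeasure :=
        integral_mono ((memLp_eulerPt δ z₀ n k).integrable one_le_two).abs
          ((integrable_const _).add h2) fun ω ↦ Literature.Probability.Process.abs_le_one_add_sq _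
    _ = 1 + ∫ ω, eulerPt δ z₀ n k ω ^ 2 ∂Literature.Probability.Process.preWienerMeasure := by
        rw [integral_add (integrable_const _) h2]; simp
    _ ≤ eulerMom δ z₀ T := one_add_integral_eulerPt_sq_le δ z₀ n hk

/-- `E[σₙ(zⁿ_k)²] ≤ 4 M(T)` for `k/2ⁿ ≤ T`. [folklore] -/
theorem integral_besqσTrunc_eulerPt_sq_le (n n' : ℕ) {k : ℕ} {T : ℝ} (hk : (k : ℝ) / 2 ^ n ≤ T) :
    ∫ ω, besqσTrunc n' (eulerPt δ z₀ n k ω) ^ 2 ∂Literature.Probability.Process.preWienerMeasure ≤ 4 * eulerMom δ z₀ T := by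
  haveI := Literature.Probability.RandomPlanarGeometry.isProbabilityMeasure_preWienerMeasure'
  calc ∫ ω, besqσTrunc n' (eulerPt δ z₀ n k ω) ^ 2 ∂Literature.Probability.Process.preWienerMeasure
      ≤ ∫ ω, 4 * |eulerPt δ z₀ n k ω| ∂Literature.Probability.Process.preWienerMeasure :=
        integral_mono_of_nonneg (ae_of_all _ fun ω ↦ sq_nonneg _)
          (((memLp_eulerPt δ z₀ n k).integrable one_le_two).abs.const_mul 4)
          (ae_of_all _ fun ω ↦ besqσTrunc_sq_le n' _)
    _ = 4 * ∫ ω, |eulerPt δ z₀ n k ω| ∂Literature.Probability.Process.preWienerMeasure := integral_const_mul _ _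
    _ ≤ 4 * eulerMom δ z₀ T := mul_le_mul_of_nonneg_left (integral_abs_eulerPt_le δ z₀ n hk) (by norm_num)

/-- `E[σₙ'(zⁿ_k)⁴] ≤ 16 M(T)` for `k/2ⁿ ≤ T`. [folklore] -/
theorem integral_besqσTrunc_eulerPt_pow_four_le (n n' : ℕ) {k : ℕ} {T : ℝ}
    (hk : (k : ℝ) / 2 ^ n ≤ T) :
    ∫ ω, besqσTrunc n' (eulerPt δ z₀ n k ω) ^ 4 ∂Literature.Probability.Process.preWienerMeasure ≤ 16 * eulerMom δ z₀ T := by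
  haveI := Literature.Probability.RandomPlanarGeometry.isProbabilityMeasure_preWienerMeasure'
  calc ∫ ω, besqσTrunc n' (eulerPt δ z₀ n k ω) ^ 4 ∂Literature.Probability.Process.preWienerMeasure
      ≤ ∫ ω, 16 * eulerPt δ z₀ n k ω ^ 2 ∂Literature.Probability.Process.preWienerMeasure :=
        integral_mono_of_nonneg (ae_of_all _ fun ω ↦ by positivity)
          ((memLp_eulerPt δ z₀ n k).integrable_sq.const_mul 16)
          (ae_of_all _ fun ω ↦ besqσTrunc_pow_four_le n' _)
    _ = 16 * ∫ ω, eulerPt δ z₀ n k ω ^ 2 ∂Literature.Probability.Process.preWienerMeasure := integral_const_mul _ _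
    _ ≤ 16 * eulerMom δ z₀ T := mul_le_mul_of_nonneg_left (integral_eulerPt_sq_le δ z₀ n hk) (by norm_num)

/-- **The truncation error in mean**: `E[(σ(zⁿ_k) - σₙ'(zⁿ_k))²] ≤ 16 M(T)/n'²` for `n' ≥ 1`,
`k/2ⁿ ≤ T`. [folklore] -/
theorem integral_sq_besqσ_sub_besqσTrunc_le (n : ℕ) {n' : ℕ} (hn' : 1 ≤ n') {k : ℕ} {T : ℝ}
    (hk : (k : ℝ) / 2 ^ n ≤ T) :
    ∫ ω, (besqσ (eulerPt δ z₀ n k ω) - besqσTrunc n' (eulerPt δ z₀ n k ω)) ^ 2 ∂Literature.Probability.Process.preWienerMeasure ≤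
      16 * eulerMom δ z₀ T / n' ^ 2 := by
  haveI := Literature.Probability.RandomPlanarGeometry.isProbabilityMeasure_preWienerMeasure'
  calc _ ≤ ∫ ω, 16 * eulerPt δ z₀ n k ω ^ 2 / n' ^ 2 ∂Literature.Probability.Process.preWienerMeasure :=
        integral_mono_of_nonneg (ae_of_all _ fun ω ↦ sq_nonneg _)
          (((memLp_eulerPt δ z₀ n k).integrable_sq.const_mul 16).div_const _)
          (ae_of_all _ fun ω ↦ sq_besqσ_sub_besqσTrunc_le hn' _)
    _ = 16 * (∫ ω, eulerPt δ z₀ n k ω ^ 2 ∂Literature.Probability.Process.preWienerMeasure) / n' ^ 2 := by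
        rw [integral_div, integral_const_mul]
    _ ≤ 16 * eulerMom δ z₀ T / n' ^ 2 := by
        gcongr
        exact integral_eulerPt_sq_le δ z₀ n hk

/-! ### Increments of the Euler process within one cell -/

/-- **Second moment of the increment within a cell**: for `a = k/2ⁿ ≤ b ≤ a + 2⁻ⁿ` with
`k/2ⁿ ≤ T`, `E[(Zⁿ_b - Zⁿ_a)²] ≤ 2⁻ⁿ (δ² + 4 M(T))`. [folklore] -/
theorem integral_eulerZ_sub_sq_le (n : ℕ) {k : ℕ} (hk : k < n * 2 ^ n) {b : ℝ≥0}
    (hab : ((k : ℕ) : ℝ≥0) / 2 ^ n ≤ b) (hb : b ≤ ((k + 1 : ℕ) : ℝ≥0) / 2 ^ n) {T : ℝ}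
    (hkT : (k : ℝ) / 2 ^ n ≤ T) :
    MemLp (fun ω ↦ eulerZ δ z₀ n b ω - eulerZ δ z₀ n (((k : ℕ) : ℝ≥0) / 2 ^ n) ω) 2 Literature.Probability.Process.preWienerMeasure ∧
    ∫ ω, (eulerZ δ z₀ n b ω - eulerZ δ z₀ n (((k : ℕ) : ℝ≥0) / 2 ^ n) ω) ^ 2 ∂Literature.Probability.Process.preWienerMeasure ≤
      (1 / 2 ^ n) * (δ ^ 2 + 4 * eulerMom δ z₀ T) := by
  haveI := Literature.Probability.RandomPlanarGeometry.isProbabilityMeasure_preWienerMeasure'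
  set a : ℝ≥0 := ((k : ℕ) : ℝ≥0) / 2 ^ n with ha
  set d : ℝ := (b : ℝ) - a with hd
  have hd0 : 0 ≤ d := by rw [hd]; exact sub_nonneg.2 (NNReal.coe_le_coe.2 hab)
  have hd1 : d ≤ 1 / 2 ^ n := by
    have : (b : ℝ) ≤ (((k + 1 : ℕ) : ℝ≥0) / 2 ^ n : ℝ≥0) := NNReal.coe_le_coe.2 hb
    rw [hd, ha]
    push_cast at this ⊢
    have e : ((k : ℝ) + 1) / 2 ^ n = k / 2 ^ n + 1 / 2 ^ n := by ring
    linarith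
  have hrepr : ∀ ω, eulerZ δ z₀ n b ω - eulerZ δ z₀ n a ω =
      δ * d + besqσTrunc n (eulerPt δ z₀ n k ω) * (Literature.Probability.Process.brownian b - Literature.Probability.Process.brownian a) ω := fun ω ↦ by
    rw [eulerZ_sub_eulerZ_grid δ z₀ n hk hab hb ω, Pi.sub_apply]
  have hy : StronglyMeasurable[Literature.Probability.RandomPlanarGeometry.brownianFiltration a] (fun _ : ℝ≥0 → ℝ ↦ δ * d) :=
    stronglyMeasurable_const
  have hV : StronglyMeasurable[Literature.Probability.RandomPlanarGeometry.brownianFiltration a] (fun ω ↦ besqσTrunc n (eulerPt δ z₀ n k ω)) :=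
    (continuous_besqσTrunc n).comp_stronglyMeasurable (stronglyMeasurable_eulerPt δ z₀ n k)
  obtain ⟨hmem, hint⟩ := integral_add_mul_brownian_sub_sq hab hy (memLp_const _) hV
    (fun ω ↦ abs_besqσTrunc_le n _)
  have heq : (fun ω ↦ eulerZ δ z₀ n b ω - eulerZ δ z₀ n a ω) =
      fun ω ↦ δ * d + besqσTrunc n (eulerPt δ z₀ n k ω) * (Literature.Probability.Process.brownian b - Literature.Probability.Process.brownian a) ω :=
    funext hrepr
  refine ⟨by rw [heq]; exact hmem, ?_⟩
  simp_rw [hrepr]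
  rw [hint]
  have hσ := integral_besqσTrunc_eulerPt_sq_le δ z₀ n n hkT
  have hM : 0 ≤ eulerMom δ z₀ T := by unfold eulerMom; positivity
  simp only [integral_const, probReal_univ, smul_eq_mul, one_mul]
  rw [← hd]
  have h1 : (δ * d) ^ 2 ≤ (1 / 2 ^ n) * δ ^ 2 := by
    have : d ^ 2 ≤ d * (1 / 2 ^ n) := by rw [sq]; exact mul_le_mul_of_nonneg_left hd1 hd0
    have : d * (1 / 2 ^ n) ≤ 1 * (1 / 2 ^ n) := mul_le_mul_of_nonneg_right
      (hd1.trans (by rw [div_le_one (pow_pos two_pos n)]; exact one_le_pow₀ one_le_two)) (by positivity)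
    nlinarith [sq_nonneg δ]
  have h2 : d * ∫ ω, besqσTrunc n (eulerPt δ z₀ n k ω) ^ 2 ∂Literature.Probability.Process.preWienerMeasure ≤
      (1 / 2 ^ n) * (4 * eulerMom δ z₀ T) :=
    mul_le_mul hd1 hσ (integral_nonneg fun ω ↦ sq_nonneg _) (by positivity)
  linarith

/-! ### Refinement to a finer dyadic grid and the difference process -/

/-- The coarse dyadic grid is contained in the fine one (`n ≤ m`). [folklore] -/
theorem dyadicTimes_subset {n m : ℕ} (hnm : n ≤ m) : Literature.Probability.Process.dyadicTimes n ⊆ Literature.Probability.Process.dyadicTimes m := by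
  intro x hx
  simp only [Literature.Probability.Process.dyadicTimes, List.mem_map, List.mem_range] at hx ⊢
  obtain ⟨k, hk, rfl⟩ := hx
  refine ⟨k * 2 ^ (m - n), ?_, ?_⟩
  · have h1 : k * 2 ^ (m - n) ≤ n * 2 ^ n * 2 ^ (m - n) := Nat.mul_le_mul_right _ (by omega)
    have h2 : n * 2 ^ n * 2 ^ (m - n) = n * 2 ^ m := by
      rw [mul_assoc, ← pow_add, Nat.add_sub_cancel' hnm]
    have h3 : n * 2 ^ m ≤ m * 2 ^ m := Nat.mul_le_mul_right _ hnm
    omega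
  · rw [← NNReal.coe_inj]
    push_cast
    rw [div_eq_div_iff (pow_ne_zero _ two_ne_zero) (pow_ne_zero _ two_ne_zero)]
    rw [show (2 : ℝ) ^ m = 2 ^ n * 2 ^ (m - n) by rw [← pow_add, Nat.add_sub_cancel' hnm]]
    ring

/-- **The Euler integrand of level `n` read on the grid of level `m ≥ n`** (`SimpleProcess.refine`).
[folklore] -/
def eulerSPRefine {n m : ℕ} (hnm : n ≤ m) :
    Literature.Probability.Process.SimpleProcess (inferInstance : MeasurableSpace (ℝ≥0 → ℝ)) Literature.Probability.RandomPlanarGeometry.brownianFiltration :=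
  (eulerSP δ z₀ n).refine (Literature.Probability.Process.dyadicTimes m) (Literature.Probability.Process.sortedLT_dyadicTimes m) (dyadicTimes_subset hnm)

/-- The refined Euler integrand has the fine dyadic grid as its partition. [folklore] -/
@[simp] theorem eulerSPRefine_times {n m : ℕ} (hnm : n ≤ m) :
    (eulerSPRefine δ z₀ hnm).times = Literature.Probability.Process.dyadicTimes m := rfl

/-- Refinement does not change the elementary integrals. [folklore] -/
theorem integral_eulerSPRefine {n m : ℕ} (hnm : n ≤ m) (t : ℝ≥0) (ω : ℝ≥0 → ℝ) :
    (eulerSPRefine δ z₀ hnm).integral Literature.Probability.Process.brownian t ω = (eulerSP δ z₀ n).integral Literature.Probability.Process.brownian t ω :=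
  Literature.Probability.Process.SimpleProcess.integral_refine _ _ _ _ Literature.Probability.Process.brownian t ω

/-- **The values of the refined integrand**: on the fine cell `(j/2ᵐ, (j+1)/2ᵐ]`, `j < m 2ᵐ`,
with `(j+1)/2ᵐ ≤ n`, the refined integrand equals `σₙ(Zⁿ(sampleLeft n ((j+1)/2ᵐ)))`. [folklore] -/
theorem eulerSPRefine_value {n m : ℕ} (hnm : n ≤ m) {j : ℕ} (hj : j < m * 2 ^ m)
    (hjn : (((j + 1 : ℕ) : ℝ≥0) / 2 ^ m) ≤ n) (ω : ℝ≥0 → ℝ) :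
    (eulerSPRefine δ z₀ hnm).value j ω =
      besqσTrunc n (eulerZ δ z₀ n (Literature.Probability.Process.sampleLeft n (((j + 1 : ℕ) : ℝ≥0) / 2 ^ m)) ω) := by
  rw [eulerSPRefine, Literature.Probability.Process.SimpleProcess.refine_value]
  have ht : ((eulerSP δ z₀ n).refine (Literature.Probability.Process.dyadicTimes m) (Literature.Probability.Process.sortedLT_dyadicTimes m)
      (dyadicTimes_subset hnm)).time (j + 1) = ((j + 1 : ℕ) : ℝ≥0) / 2 ^ m :=
    Literature.Probability.Process.SimpleProcess.time_of_times_eq_dyadicTimes _ rfl (by omega)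
  rw [ht]
  exact toProcess_eulerSP δ z₀ n (by positivity) hjn ω

/-- The values of the difference process: `(refined level-n integrand) - (level-m integrand)`.
[folklore] -/
def eulerDiffValue {n m : ℕ} (hnm : n ≤ m) (j : ℕ) (ω : ℝ≥0 → ℝ) : ℝ :=
  (eulerSPRefine δ z₀ hnm).value j ω - (eulerSP δ z₀ m).value j ω

/-- The values of the difference process are bounded by `n + m`. [folklore] -/
theorem abs_eulerDiffValue_le {n m : ℕ} (hnm : n ≤ m) (j : ℕ) (ω : ℝ≥0 → ℝ) :
    |eulerDiffValue δ z₀ hnm j ω| ≤ n + m := by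
  unfold eulerDiffValue
  have h1 : |(eulerSPRefine δ z₀ hnm).value j ω| ≤ n := by
    rw [eulerSPRefine, Literature.Probability.Process.SimpleProcess.refine_value]
    obtain h := (eulerSP δ z₀ n).abs_toProcess_le (fun k ω ↦ abs_besqσTrunc_le n (eulerPt δ z₀ n k ω))
    refine (h _ ω).trans (max_le le_rfl (Nat.cast_nonneg n))
  have h2 : |(eulerSP δ z₀ m).value j ω| ≤ m := abs_besqσTrunc_le m _
  exact (abs_sub _ _).trans (add_le_add h1 h2)

/-- **The difference process** `Rₙₘ` on the grid of mesh `2⁻ᵐ` (`n ≤ m`): value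
`σₙ(Zⁿ(sampleLeft n ((j+1)/2ᵐ))) - σₘ(zᵐ_j)` on `(j/2ᵐ, (j+1)/2ᵐ]`. Its elementary integral is
`Zⁿ - Zᵐ` (`integral_eulerDiff`).
Yamada (1978); Gyöngy–Rásonyi (2011), proof of Prop. 2.2 (there the difference `X - Xⁿ` of
the solution and its Euler approximation as a stochastic integral; here the difference of two
approximations). [folklore] -/
def eulerDiff {n m : ℕ} (hnm : n ≤ m) :
    Literature.Probability.Process.SimpleProcess (inferInstance : MeasurableSpace (ℝ≥0 → ℝ)) Literature.Probability.RandomPlanarGeometry.brownianFiltration :=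
  Literature.Probability.Process.SimpleProcess.onDyadic' m (eulerDiffValue δ z₀ hnm)
    (fun _ hj ↦ ((eulerSPRefine δ z₀ hnm).stronglyMeasurable_value_of_times_eq_dyadicTimes rfl hj).sub
      ((eulerSP δ z₀ m).stronglyMeasurable_value_of_times_eq_dyadicTimes rfl hj))
    ⟨n + m, abs_eulerDiffValue_le δ z₀ hnm⟩

/-- The values of the difference process. [folklore] -/
@[simp] theorem eulerDiff_value {n m : ℕ} (hnm : n ≤ m) :
    (eulerDiff δ z₀ hnm).value = eulerDiffValue δ z₀ hnm := rfl

/-- The partition of the difference process. [folklore] -/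
@[simp] theorem eulerDiff_times {n m : ℕ} (hnm : n ≤ m) :
    (eulerDiff δ z₀ hnm).times = Literature.Probability.Process.dyadicTimes m := rfl

/-- **The elementary integral of the difference process is the difference of the Euler
processes**: `(Rₙₘ · B)_t = (eulerSP n · B)_t - (eulerSP m · B)_t = Zⁿ_t - Zᵐ_t`. [folklore] -/
theorem integral_eulerDiff {n m : ℕ} (hnm : n ≤ m) (t : ℝ≥0) (ω : ℝ≥0 → ℝ) :
    (eulerDiff δ z₀ hnm).integral Literature.Probability.Process.brownian t ω =
      (eulerSP δ z₀ n).integral Literature.Probability.Process.brownian t ω - (eulerSP δ z₀ m).integral Literature.Probability.Process.brownian t ω := by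
  rw [← integral_eulerSPRefine δ z₀ hnm t ω]
  exact Literature.Probability.Process.SimpleProcess.integral_eq_sub_of_forall_value (P := eulerDiff δ z₀ hnm)
    (Q := eulerSPRefine δ z₀ hnm) (R := eulerSP δ z₀ m) rfl rfl Literature.Probability.Process.brownian fun i _ _ ↦ rfl

/-- `Zⁿ_t - Zᵐ_t = (Rₙₘ · B)_t` (the drifts cancel). [folklore] -/
theorem eulerZ_sub_eulerZ {n m : ℕ} (hnm : n ≤ m) (t : ℝ≥0) (ω : ℝ≥0 → ℝ) :
    eulerZ δ z₀ n t ω - eulerZ δ z₀ m t ω = (eulerDiff δ z₀ hnm).integral Literature.Probability.Process.brownian t ω := by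
  rw [integral_eulerDiff, eulerZ, eulerZ]
  ring

end Scheme

/-! ## Part 2 — convergence of the scheme (Yamada–Watanabe `L¹` estimate, `L²`, u.c.p.) -/

/-! ### Two elementary inequalities and `E|f| ≤ √(E f²)` -/

/-- `(x - y)² ≤ 2 (x² + y²)`. [folklore] -/
theorem sq_sub_le_two_mul (x y : ℝ) : (x - y) ^ 2 ≤ 2 * (x ^ 2 + y ^ 2) := by
  nlinarith [sq_nonneg (x + y)]

/-- `(x - y)⁴ ≤ 8 (x⁴ + y⁴)`. [folklore] -/
theorem pow_four_sub_le (x y : ℝ) : (x - y) ^ 4 ≤ 8 * (x ^ 4 + y ^ 4) := by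
  have h1 : (x - y) ^ 2 ≤ 2 * (x ^ 2 + y ^ 2) := sq_sub_le_two_mul x y
  have h2 : (x ^ 2 + y ^ 2) ^ 2 ≤ 2 * (x ^ 4 + y ^ 4) := by nlinarith [sq_nonneg (x ^ 2 - y ^ 2)]
  calc (x - y) ^ 4 = ((x - y) ^ 2) ^ 2 := by ring
    _ ≤ (2 * (x ^ 2 + y ^ 2)) ^ 2 := pow_le_pow_left₀ (sq_nonneg _) h1 2
    _ = 4 * (x ^ 2 + y ^ 2) ^ 2 := by ring
    _ ≤ 8 * (x ^ 4 + y ^ 4) := by linarith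

/-- **`E|f| ≤ √(E[f²])`** on a probability space, for `f ∈ L²` (the variance of `|f|` is
nonnegative). [folklore] -/
theorem integral_abs_le_sqrt_integral_sq {Ω : Type*} {m : MeasurableSpace Ω} {μ : Measure Ω}
    [IsProbabilityMeasure μ] {f : Ω → ℝ} (hf : MemLp f 2 μ) :
    ∫ ω, |f ω| ∂μ ≤ Real.sqrt (∫ ω, f ω ^ 2 ∂μ) := by
  have habs : MemLp (fun ω ↦ |f ω|) 2 μ := hf.abs
  have hv := variance_nonneg (fun ω ↦ |f ω|) μ
  rw [variance_eq_sub habs] at hv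
  have h2 : ∫ ω, ((fun ω ↦ |f ω|) ^ 2) ω ∂μ = ∫ ω, f ω ^ 2 ∂μ := by
    refine integral_congr_ae (ae_of_all _ fun ω ↦ ?_)
    simp [sq_abs]
  rw [h2] at hv
  have h0 : 0 ≤ ∫ ω, |f ω| ∂μ := integral_nonneg fun ω ↦ abs_nonneg _
  refine Real.le_sqrt_of_sq_le ?_
  have : (∫ ω, (fun ω ↦ |f ω|) ω ∂μ) = ∫ ω, |f ω| ∂μ := rfl
  rw [this] at hv
  linarith

section Convergence

variable (δ z₀ : ℝ)

/-! ### Geometry of the nested dyadic cells -/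

/-- The index of the coarse cell (mesh `2⁻ⁿ`) containing the fine grid point `(j+1)/2ᵐ`:
`⌈(j+1) 2ⁿ/2ᵐ⌉ - 1`, so that `sampleLeft n ((j+1)/2ᵐ) = coarseIdx n m j / 2ⁿ`. [folklore] -/
def coarseIdx (n m j : ℕ) : ℕ := ⌈((((j + 1 : ℕ) : ℝ≥0) / 2 ^ m : ℝ≥0) : ℝ) * 2 ^ n⌉₊ - 1

/-- `sampleLeft n ((j+1)/2ᵐ) = coarseIdx n m j / 2ⁿ`. [folklore] -/
theorem sampleLeft_eq_coarseIdx (n m j : ℕ) :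
    Literature.Probability.Process.sampleLeft n (((j + 1 : ℕ) : ℝ≥0) / 2 ^ m) = ((coarseIdx n m j : ℕ) : ℝ≥0) / 2 ^ n := rfl

/-- **Cell geometry**: for `n ≤ m` and `(j+1)/2ᵐ ≤ n`, with `k = coarseIdx n m j`,
`k < n 2ⁿ`, `k/2ⁿ ≤ j/2ᵐ ≤ (k+1)/2ⁿ`. [folklore] -/
theorem coarseIdx_spec {n m : ℕ} (hnm : n ≤ m) {j : ℕ}
    (hjn : (((j + 1 : ℕ) : ℝ≥0) / 2 ^ m) ≤ n) :
    coarseIdx n m j < n * 2 ^ n ∧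
      ((coarseIdx n m j : ℕ) : ℝ≥0) / 2 ^ n ≤ ((j : ℕ) : ℝ≥0) / 2 ^ m ∧
      ((j : ℕ) : ℝ≥0) / 2 ^ m ≤ ((coarseIdx n m j + 1 : ℕ) : ℝ≥0) / 2 ^ n := by
  have hu0 : (0 : ℝ≥0) < ((j + 1 : ℕ) : ℝ≥0) / 2 ^ m := by positivity
  refine ⟨Literature.Probability.Process.SimpleProcess.ceil_sub_one_lt hu0 hjn, ?_, ?_⟩
  · rw [← sampleLeft_eq_coarseIdx]
    exact sampleLeft_le_of_le hnm j
  · have h1 : ((j : ℕ) : ℝ≥0) / 2 ^ m ≤ ((j + 1 : ℕ) : ℝ≥0) / 2 ^ m :=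
      div_le_div_of_nonneg_right (by exact_mod_cast Nat.le_succ j) (pow_pos two_pos m).le
    have h2 := (le_sampleLeft_add (n := n) hu0).2
    rw [sampleLeft_eq_coarseIdx] at h2
    refine h1.trans (h2.trans (le_of_eq ?_))
    rw [Nat.cast_add, Nat.cast_one, add_div]

/-- **The values of the difference process**, explicitly: for `j < m 2ᵐ` with `(j+1)/2ᵐ ≤ n`,
`Rₙₘ(j) = σₙ(zⁿ_k) - σₘ(zᵐ_j)`, `k = coarseIdx n m j`. [folklore] -/
theorem eulerDiffValue_eq {n m : ℕ} (hnm : n ≤ m) {j : ℕ} (hj : j < m * 2 ^ m)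
    (hjn : (((j + 1 : ℕ) : ℝ≥0) / 2 ^ m) ≤ n) (ω : ℝ≥0 → ℝ) :
    eulerDiffValue δ z₀ hnm j ω =
      besqσTrunc n (eulerPt δ z₀ n (coarseIdx n m j) ω) - besqσTrunc m (eulerPt δ z₀ m j ω) := by
  obtain ⟨hk, -, -⟩ := coarseIdx_spec hnm hjn
  rw [eulerDiffValue, eulerSPRefine_value δ z₀ hnm hj hjn ω, sampleLeft_eq_coarseIdx,
    eulerZ_grid δ z₀ n hk.le, eulerSP_value]

/-! ### The cell term of the Yamada–Watanabe functional -/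

/-- **Pointwise bound on one cell.** With `b = j/2ᵐ`, `k = coarseIdx n m j`, `a = k/2ⁿ`,
`D = Zⁿ - Zᵐ`, `ζ = Rₙₘ(j)`:
`F_ε''(D_b) ζ² ≤ 12 + ε⁻¹ (3 (σ - σₙ)²(zⁿ_k) + 12 |Zⁿ_b - Zⁿ_a| + 3 (σ - σₘ)²(zᵐ_j))`.
Yamada–Watanabe (1971), proof of Thm 1; Gyöngy–Rásonyi (2011), proof of Prop. 2.2. [folklore] -/
theorem ywF''_mul_eulerDiffValue_sq_le {ε : ℝ} (hε : 0 < ε) {n m : ℕ} (hnm : n ≤ m) {j : ℕ}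
    (hj : j < m * 2 ^ m) (hjn : (((j + 1 : ℕ) : ℝ≥0) / 2 ^ m) ≤ n) (ω : ℝ≥0 → ℝ) :
    ywF'' ε ((eulerDiff δ z₀ hnm).integral Literature.Probability.Process.brownian (((j : ℕ) : ℝ≥0) / 2 ^ m) ω) *
        eulerDiffValue δ z₀ hnm j ω ^ 2 ≤
      12 + ε⁻¹ * (3 * (besqσ (eulerPt δ z₀ n (coarseIdx n m j) ω) -
          besqσTrunc n (eulerPt δ z₀ n (coarseIdx n m j) ω)) ^ 2 +
        12 * |eulerZ δ z₀ n (((j : ℕ) : ℝ≥0) / 2 ^ m) ω -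
          eulerZ δ z₀ n (((coarseIdx n m j : ℕ) : ℝ≥0) / 2 ^ n) ω| +
        3 * (besqσ (eulerPt δ z₀ m j ω) - besqσTrunc m (eulerPt δ z₀ m j ω)) ^ 2) := by
  obtain ⟨hk, -, -⟩ := coarseIdx_spec hnm hjn
  set k := coarseIdx n m j with hkdef
  set b : ℝ≥0 := ((j : ℕ) : ℝ≥0) / 2 ^ m with hb
  set a : ℝ≥0 := ((k : ℕ) : ℝ≥0) / 2 ^ n with ha
  set p := eulerPt δ z₀ n k ω with hp
  set q := eulerPt δ z₀ m j ω with hq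
  set Db := (eulerDiff δ z₀ hnm).integral Literature.Probability.Process.brownian b ω with hDb
  -- identifications
  have hpa : eulerZ δ z₀ n a ω = p := eulerZ_grid δ z₀ n hk.le ω
  have hqb : eulerZ δ z₀ m b ω = q := eulerZ_grid δ z₀ m hj.le ω
  have hD : Db = eulerZ δ z₀ n b ω - eulerZ δ z₀ m b ω := (eulerZ_sub_eulerZ δ z₀ hnm b ω).symm
  have hζ : eulerDiffValue δ z₀ hnm j ω = besqσTrunc n p - besqσTrunc m q :=
    eulerDiffValue_eq δ z₀ hnm hj hjn ω
  -- the decomposition of `ζ`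
  set x := besqσTrunc n p - besqσ p with hx
  set y := besqσ p - besqσ q with hy
  set w := besqσ q - besqσTrunc m q with hw
  have hζ' : eulerDiffValue δ z₀ hnm j ω = x + y + w := by rw [hζ]; ring
  have hy2 : y ^ 2 ≤ 4 * |eulerZ δ z₀ n b ω - eulerZ δ z₀ n a ω| + 4 * |Db| := by
    have h1 : y ^ 2 ≤ 4 * |p - q| := sq_besqσ_sub_le p q
    have h2 : |p - q| ≤ |eulerZ δ z₀ n b ω - eulerZ δ z₀ n a ω| + |Db| := by
      rw [hD, hqb, ← hpa]
      have := abs_sub_le (eulerZ δ z₀ n a ω) (eulerZ δ z₀ n b ω) q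
      rw [abs_sub_comm (eulerZ δ z₀ n a ω) (eulerZ δ z₀ n b ω)] at this
      linarith
    linarith
  have hF0 := ywF''_pos hε Db
  have hFle := ywF''_le hε Db
  have hkey := ywF''_mul_abs_le_one hε Db
  have hsq : eulerDiffValue δ z₀ hnm j ω ^ 2 ≤ 3 * (x ^ 2 + y ^ 2 + w ^ 2) := by
    rw [hζ']; nlinarith [sq_nonneg (x - y), sq_nonneg (y - w), sq_nonneg (x - w)]
  have hx2 : x ^ 2 = (besqσ p - besqσTrunc n p) ^ 2 := by rw [hx]; ring
  calc ywF'' ε Db * eulerDiffValue δ z₀ hnm j ω ^ 2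
      ≤ ywF'' ε Db * (3 * (x ^ 2 + (4 * |eulerZ δ z₀ n b ω - eulerZ δ z₀ n a ω| + 4 * |Db|) +
          w ^ 2)) := by
        refine mul_le_mul_of_nonneg_left (hsq.trans ?_) hF0.le
        linarith
    _ = 12 * (ywF'' ε Db * |Db|) + ywF'' ε Db *
          (3 * x ^ 2 + 12 * |eulerZ δ z₀ n b ω - eulerZ δ z₀ n a ω| + 3 * w ^ 2) := by ring
    _ ≤ 12 * 1 + ε⁻¹ * (3 * x ^ 2 + 12 * |eulerZ δ z₀ n b ω - eulerZ δ z₀ n a ω| + 3 * w ^ 2) := by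
        have hnn : 0 ≤ 3 * x ^ 2 + 12 * |eulerZ δ z₀ n b ω - eulerZ δ z₀ n a ω| + 3 * w ^ 2 := by
          positivity
        nlinarith [mul_le_mul_of_nonneg_right hFle hnn]
    _ = _ := by rw [hx2, mul_one]

/-- The truncation-error term is integrable. [folklore] -/
theorem integrable_sq_besqσ_sub_besqσTrunc (n n' k : ℕ) :
    Integrable (fun ω ↦ (besqσ (eulerPt δ z₀ n k ω) - besqσTrunc n' (eulerPt δ z₀ n k ω)) ^ 2)
      Literature.Probability.Process.preWienerMeasure := by
  haveI := Literature.Probability.RandomPlanarGeometry.isProbabilityMeasure_preWienerMeasure'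
  have hm : AEStronglyMeasurable
      (fun ω ↦ (besqσ (eulerPt δ z₀ n k ω) - besqσTrunc n' (eulerPt δ z₀ n k ω)) ^ 2)
      Literature.Probability.Process.preWienerMeasure :=
    (((continuous_besqσ.sub (continuous_besqσTrunc n')).pow 2).measurable.comp
      (measurable_eulerPt δ z₀ n k)).aestronglyMeasurable
  refine ((((memLp_eulerPt δ z₀ n k).integrable one_le_two).abs.const_mul 16).mono' hm
    (ae_of_all _ fun ω ↦ ?_))
  rw [Real.norm_eq_abs, abs_of_nonneg (sq_nonneg _)]
  -- `(σ - σₙ')² ≤ σ² = 4|z| ≤ 16 |z|` (crude)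
  have h0 := besqσ_nonneg (eulerPt δ z₀ n k ω)
  have h1 := abs_besqσTrunc_le_besqσ n' (eulerPt δ z₀ n k ω)
  have h1' := (abs_le.1 h1)
  have hσ2 : besqσ (eulerPt δ z₀ n k ω) ^ 2 = 4 * |eulerPt δ z₀ n k ω| := by
    rw [besqσ, mul_pow, Real.sq_sqrt (abs_nonneg _)]; ring
  nlinarith [abs_nonneg (eulerPt δ z₀ n k ω)]

/-- The error rate of the cell term:
`γ(n, m) = 48 M/n² + 12 √(2⁻ⁿ (δ² + 4M)) + 48 M/m²`, `M = M(T)`. [folklore] -/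
def cellErr (δ z₀ T : ℝ) (n m : ℕ) : ℝ :=
  48 * eulerMom δ z₀ T / n ^ 2 + 12 * Real.sqrt ((1 / 2 ^ n) * (δ ^ 2 + 4 * eulerMom δ z₀ T)) +
    48 * eulerMom δ z₀ T / m ^ 2

/-- `γ(n, m) ≥ 0`. [folklore] -/
theorem cellErr_nonneg (T : ℝ) (n m : ℕ) : 0 ≤ cellErr δ z₀ T n m := by
  have : 0 ≤ eulerMom δ z₀ T := by unfold eulerMom; positivity
  unfold cellErr; positivity

/-- **Expectation of the cell term**: for `1 ≤ n ≤ m`, `j < m 2ᵐ`, `(j+1)/2ᵐ ≤ n`, `j/2ᵐ ≤ T`,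
`E[F_ε''(D_{j/2ᵐ}) Rₙₘ(j)²] ≤ 12 + ε⁻¹ γ(n, m)`.
Yamada–Watanabe (1971), proof of Thm 1; Gyöngy–Rásonyi (2011), proof of Prop. 2.2. [folklore] -/
theorem integral_ywF''_mul_eulerDiffValue_sq_le {ε : ℝ} (hε : 0 < ε) {n m : ℕ} (hn : 1 ≤ n)
    (hnm : n ≤ m) {j : ℕ} (hj : j < m * 2 ^ m) (hjn : (((j + 1 : ℕ) : ℝ≥0) / 2 ^ m) ≤ n) {T : ℝ}
    (hjT : (j : ℝ) / 2 ^ m ≤ T) :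
    ∫ ω, ywF'' ε ((eulerDiff δ z₀ hnm).integral Literature.Probability.Process.brownian (((j : ℕ) : ℝ≥0) / 2 ^ m) ω) *
        eulerDiffValue δ z₀ hnm j ω ^ 2 ∂Literature.Probability.Process.preWienerMeasure ≤ 12 + ε⁻¹ * cellErr δ z₀ T n m := by
  haveI := Literature.Probability.RandomPlanarGeometry.isProbabilityMeasure_preWienerMeasure'
  obtain ⟨hk, hab, hb1⟩ := coarseIdx_spec hnm hjn
  set k := coarseIdx n m j with hkdef
  have hm1 : 1 ≤ m := hn.trans hnm
  -- the moment hypotheses in real form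
  have hkT : (k : ℝ) / 2 ^ n ≤ T := by
    have : (((k : ℕ) : ℝ≥0) / 2 ^ n : ℝ≥0) ≤ (((j : ℕ) : ℝ≥0) / 2 ^ m : ℝ≥0) := hab
    have := NNReal.coe_le_coe.2 this
    push_cast at this
    exact this.trans hjT
  -- the three expectations
  have e1 := integral_sq_besqσ_sub_besqσTrunc_le δ z₀ n hn hkT
  have e3 := integral_sq_besqσ_sub_besqσTrunc_le δ z₀ m hm1 hjT
  obtain ⟨hmem, hincr⟩ := integral_eulerZ_sub_sq_le δ z₀ n hk hab hb1 hkT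
  have e2 : ∫ ω, |eulerZ δ z₀ n (((j : ℕ) : ℝ≥0) / 2 ^ m) ω -
      eulerZ δ z₀ n (((k : ℕ) : ℝ≥0) / 2 ^ n) ω| ∂Literature.Probability.Process.preWienerMeasure ≤
      Real.sqrt ((1 / 2 ^ n) * (δ ^ 2 + 4 * eulerMom δ z₀ T)) :=
    (integral_abs_le_sqrt_integral_sq hmem).trans (Real.sqrt_le_sqrt hincr)
  -- integrate the pointwise bound
  have hi1 := integrable_sq_besqσ_sub_besqσTrunc δ z₀ n n k
  have hi2 : Integrable (fun ω ↦ |eulerZ δ z₀ n (((j : ℕ) : ℝ≥0) / 2 ^ m) ω -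
      eulerZ δ z₀ n (((k : ℕ) : ℝ≥0) / 2 ^ n) ω|) Literature.Probability.Process.preWienerMeasure :=
    (hmem.integrable one_le_two).abs
  have hi3 := integrable_sq_besqσ_sub_besqσTrunc δ z₀ m m j
  have hR : Integrable (fun ω ↦ 12 + ε⁻¹ * (3 * (besqσ (eulerPt δ z₀ n k ω) -
      besqσTrunc n (eulerPt δ z₀ n k ω)) ^ 2 +
      12 * |eulerZ δ z₀ n (((j : ℕ) : ℝ≥0) / 2 ^ m) ω - eulerZ δ z₀ n (((k : ℕ) : ℝ≥0) / 2 ^ n) ω| +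
      3 * (besqσ (eulerPt δ z₀ m j ω) - besqσTrunc m (eulerPt δ z₀ m j ω)) ^ 2)) Literature.Probability.Process.preWienerMeasure :=
    (integrable_const _).add ((((hi1.const_mul 3).add (hi2.const_mul 12)).add (hi3.const_mul 3)).const_mul _)
  calc _ ≤ ∫ ω, (12 + ε⁻¹ * (3 * (besqσ (eulerPt δ z₀ n k ω) - besqσTrunc n (eulerPt δ z₀ n k ω)) ^ 2 +
        12 * |eulerZ δ z₀ n (((j : ℕ) : ℝ≥0) / 2 ^ m) ω - eulerZ δ z₀ n (((k : ℕ) : ℝ≥0) / 2 ^ n) ω| +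
        3 * (besqσ (eulerPt δ z₀ m j ω) - besqσTrunc m (eulerPt δ z₀ m j ω)) ^ 2)) ∂Literature.Probability.Process.preWienerMeasure :=
        integral_mono_of_nonneg (ae_of_all _ fun ω ↦ mul_nonneg (ywF''_pos hε _).le (sq_nonneg _))
          hR (ae_of_all _ fun ω ↦ ywF''_mul_eulerDiffValue_sq_le δ z₀ hε hnm hj hjn ω)
    _ = 12 + ε⁻¹ * (3 * (∫ ω, (besqσ (eulerPt δ z₀ n k ω) - besqσTrunc n (eulerPt δ z₀ n k ω)) ^ 2
          ∂Literature.Probability.Process.preWienerMeasure) +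
        12 * (∫ ω, |eulerZ δ z₀ n (((j : ℕ) : ℝ≥0) / 2 ^ m) ω -
          eulerZ δ z₀ n (((k : ℕ) : ℝ≥0) / 2 ^ n) ω| ∂Literature.Probability.Process.preWienerMeasure) +
        3 * ∫ ω, (besqσ (eulerPt δ z₀ m j ω) - besqσTrunc m (eulerPt δ z₀ m j ω)) ^ 2
          ∂Literature.Probability.Process.preWienerMeasure) := by
        have h12 : Integrable (fun ω ↦ 3 * (besqσ (eulerPt δ z₀ n k ω) -
            besqσTrunc n (eulerPt δ z₀ n k ω)) ^ 2 +
            12 * |eulerZ δ z₀ n (((j : ℕ) : ℝ≥0) / 2 ^ m) ω -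
              eulerZ δ z₀ n (((k : ℕ) : ℝ≥0) / 2 ^ n) ω|) Literature.Probability.Process.preWienerMeasure :=
          (hi1.const_mul 3).add (hi2.const_mul 12)
        have h123 : Integrable (fun ω ↦ 3 * (besqσ (eulerPt δ z₀ n k ω) -
            besqσTrunc n (eulerPt δ z₀ n k ω)) ^ 2 +
            12 * |eulerZ δ z₀ n (((j : ℕ) : ℝ≥0) / 2 ^ m) ω -
              eulerZ δ z₀ n (((k : ℕ) : ℝ≥0) / 2 ^ n) ω| +
            3 * (besqσ (eulerPt δ z₀ m j ω) - besqσTrunc m (eulerPt δ z₀ m j ω)) ^ 2)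
            Literature.Probability.Process.preWienerMeasure := h12.add (hi3.const_mul 3)
        rw [integral_add (integrable_const _) (h123.const_mul _), integral_const_mul,
          integral_add h12 (hi3.const_mul 3), integral_add (hi1.const_mul 3) (hi2.const_mul 12),
          integral_const_mul, integral_const_mul, integral_const_mul]
        simp
    _ ≤ 12 + ε⁻¹ * cellErr δ z₀ T n m := by
        have hε' : 0 ≤ ε⁻¹ := by positivity
        have hX : 3 * (∫ ω, (besqσ (eulerPt δ z₀ n k ω) - besqσTrunc n (eulerPt δ z₀ n k ω)) ^ 2
            ∂Literature.Probability.Process.preWienerMeasure) +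
            12 * (∫ ω, |eulerZ δ z₀ n (((j : ℕ) : ℝ≥0) / 2 ^ m) ω -
              eulerZ δ z₀ n (((k : ℕ) : ℝ≥0) / 2 ^ n) ω| ∂Literature.Probability.Process.preWienerMeasure) +
            3 * ∫ ω, (besqσ (eulerPt δ z₀ m j ω) - besqσTrunc m (eulerPt δ z₀ m j ω)) ^ 2
              ∂Literature.Probability.Process.preWienerMeasure ≤ cellErr δ z₀ T n m := by
          have e1' : 3 * (∫ ω, (besqσ (eulerPt δ z₀ n k ω) - besqσTrunc n (eulerPt δ z₀ n k ω)) ^ 2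
              ∂Literature.Probability.Process.preWienerMeasure) ≤ 48 * eulerMom δ z₀ T / n ^ 2 :=
            calc _ ≤ 3 * (16 * eulerMom δ z₀ T / n ^ 2) := by gcongr
              _ = _ := by ring
          have e3' : 3 * (∫ ω, (besqσ (eulerPt δ z₀ m j ω) - besqσTrunc m (eulerPt δ z₀ m j ω)) ^ 2
              ∂Literature.Probability.Process.preWienerMeasure) ≤ 48 * eulerMom δ z₀ T / m ^ 2 :=
            calc _ ≤ 3 * (16 * eulerMom δ z₀ T / m ^ 2) := by gcongr
              _ = _ := by ring
          unfold cellErr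
          linarith
        have := mul_le_mul_of_nonneg_left hX hε'
        linarith

/-! ### The Itô–Taylor estimate for `F_ε(Zⁿ_t - Zᵐ_t)` -/

/-- `E[Rₙₘ(j)²] ≤ 16 M(T)` for `j/2ᵐ ≤ T` (and `(j+1)/2ᵐ ≤ n`, `j < m 2ᵐ`). [folklore] -/
theorem integral_eulerDiffValue_sq_le_const {n m : ℕ} (hnm : n ≤ m) {j : ℕ} (hj : j < m * 2 ^ m)
    (hjn : (((j + 1 : ℕ) : ℝ≥0) / 2 ^ m) ≤ n) {T : ℝ} (hjT : (j : ℝ) / 2 ^ m ≤ T) :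
    ∫ ω, eulerDiffValue δ z₀ hnm j ω ^ 2 ∂Literature.Probability.Process.preWienerMeasure ≤ 16 * eulerMom δ z₀ T := by
  haveI := Literature.Probability.RandomPlanarGeometry.isProbabilityMeasure_preWienerMeasure'
  obtain ⟨hk, hab, -⟩ := coarseIdx_spec hnm hjn
  set k := coarseIdx n m j with hkdef
  have hkT : (k : ℝ) / 2 ^ n ≤ T := by
    have := NNReal.coe_le_coe.2 hab
    push_cast at this
    exact this.trans hjT
  have h1 := integral_besqσTrunc_eulerPt_sq_le δ z₀ n n hkT
  have h2 := integral_besqσTrunc_eulerPt_sq_le δ z₀ m m hjT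
  have hi1 : Integrable (fun ω ↦ besqσTrunc n (eulerPt δ z₀ n k ω) ^ 2) Literature.Probability.Process.preWienerMeasure := by
    refine (integrable_const ((n : ℝ) ^ 2)).mono'
      (((continuous_besqσTrunc n).measurable.comp (measurable_eulerPt δ z₀ n k)).pow_const
        2).aestronglyMeasurable (ae_of_all _ fun ω ↦ ?_)
    rw [Real.norm_eq_abs, abs_of_nonneg (sq_nonneg _), ← sq_abs]
    exact pow_le_pow_left₀ (abs_nonneg _) (abs_besqσTrunc_le n _) 2
  have hi2 : Integrable (fun ω ↦ besqσTrunc m (eulerPt δ z₀ m j ω) ^ 2) Literature.Probability.Process.preWienerMeasure := by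
    refine (integrable_const ((m : ℝ) ^ 2)).mono'
      (((continuous_besqσTrunc m).measurable.comp (measurable_eulerPt δ z₀ m j)).pow_const
        2).aestronglyMeasurable (ae_of_all _ fun ω ↦ ?_)
    rw [Real.norm_eq_abs, abs_of_nonneg (sq_nonneg _), ← sq_abs]
    exact pow_le_pow_left₀ (abs_nonneg _) (abs_besqσTrunc_le m _) 2
  calc _ ≤ ∫ ω, 2 * (besqσTrunc n (eulerPt δ z₀ n k ω) ^ 2 + besqσTrunc m (eulerPt δ z₀ m j ω) ^ 2)
        ∂Literature.Probability.Process.preWienerMeasure := by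
        refine integral_mono_of_nonneg (ae_of_all _ fun ω ↦ sq_nonneg _) ((hi1.add hi2).const_mul 2)
          (ae_of_all _ fun ω ↦ ?_)
        dsimp only
        rw [eulerDiffValue_eq δ z₀ hnm hj hjn ω]
        exact sq_sub_le_two_mul _ _
    _ = 2 * ((∫ ω, besqσTrunc n (eulerPt δ z₀ n k ω) ^ 2 ∂Literature.Probability.Process.preWienerMeasure) +
          ∫ ω, besqσTrunc m (eulerPt δ z₀ m j ω) ^ 2 ∂Literature.Probability.Process.preWienerMeasure) := by
        rw [integral_const_mul, integral_add hi1 hi2]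
    _ ≤ 16 * eulerMom δ z₀ T := by linarith

/-- `E[Rₙₘ(j)⁴] ≤ 256 M(T)` for `j/2ᵐ ≤ T` (and `(j+1)/2ᵐ ≤ n`, `j < m 2ᵐ`). [folklore] -/
theorem integral_eulerDiffValue_pow_four_le {n m : ℕ} (hnm : n ≤ m) {j : ℕ} (hj : j < m * 2 ^ m)
    (hjn : (((j + 1 : ℕ) : ℝ≥0) / 2 ^ m) ≤ n) {T : ℝ} (hjT : (j : ℝ) / 2 ^ m ≤ T) :
    ∫ ω, eulerDiffValue δ z₀ hnm j ω ^ 4 ∂Literature.Probability.Process.preWienerMeasure ≤ 256 * eulerMom δ z₀ T := by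
  haveI := Literature.Probability.RandomPlanarGeometry.isProbabilityMeasure_preWienerMeasure'
  obtain ⟨hk, hab, -⟩ := coarseIdx_spec hnm hjn
  set k := coarseIdx n m j with hkdef
  have hkT : (k : ℝ) / 2 ^ n ≤ T := by
    have := NNReal.coe_le_coe.2 hab
    push_cast at this
    exact this.trans hjT
  have h1 := integral_besqσTrunc_eulerPt_pow_four_le δ z₀ n n hkT
  have h2 := integral_besqσTrunc_eulerPt_pow_four_le δ z₀ m m hjT
  have hbd : ∀ (n' : ℕ) (z : ℝ), besqσTrunc n' z ^ 4 ≤ (n' : ℝ) ^ 4 := fun n' z ↦ by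
    calc besqσTrunc n' z ^ 4 = |besqσTrunc n' z| ^ 4 := by
          rw [← abs_pow, abs_of_nonneg (by positivity)]
      _ ≤ (n' : ℝ) ^ 4 := pow_le_pow_left₀ (abs_nonneg _) (abs_besqσTrunc_le n' z) 4
  have hi1 : Integrable (fun ω ↦ besqσTrunc n (eulerPt δ z₀ n k ω) ^ 4) Literature.Probability.Process.preWienerMeasure := by
    refine (integrable_const ((n : ℝ) ^ 4)).mono'
      (((continuous_besqσTrunc n).measurable.comp (measurable_eulerPt δ z₀ n k)).pow_const
        4).aestronglyMeasurable (ae_of_all _ fun ω ↦ ?_)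
    rw [Real.norm_eq_abs, abs_of_nonneg (by positivity)]
    exact hbd n _
  have hi2 : Integrable (fun ω ↦ besqσTrunc m (eulerPt δ z₀ m j ω) ^ 4) Literature.Probability.Process.preWienerMeasure := by
    refine (integrable_const ((m : ℝ) ^ 4)).mono'
      (((continuous_besqσTrunc m).measurable.comp (measurable_eulerPt δ z₀ m j)).pow_const
        4).aestronglyMeasurable (ae_of_all _ fun ω ↦ ?_)
    rw [Real.norm_eq_abs, abs_of_nonneg (by positivity)]
    exact hbd m _
  calc _ ≤ ∫ ω, 8 * (besqσTrunc n (eulerPt δ z₀ n k ω) ^ 4 + besqσTrunc m (eulerPt δ z₀ m j ω) ^ 4)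
        ∂Literature.Probability.Process.preWienerMeasure := by
        refine integral_mono_of_nonneg (ae_of_all _ fun ω ↦ by positivity) ((hi1.add hi2).const_mul 8)
          (ae_of_all _ fun ω ↦ ?_)
        dsimp only
        rw [eulerDiffValue_eq δ z₀ hnm hj hjn ω]
        exact pow_four_sub_le _ _
    _ = 8 * ((∫ ω, besqσTrunc n (eulerPt δ z₀ n k ω) ^ 4 ∂Literature.Probability.Process.preWienerMeasure) +
          ∫ ω, besqσTrunc m (eulerPt δ z₀ m j ω) ^ 4 ∂Literature.Probability.Process.preWienerMeasure) := by
        rw [integral_const_mul, integral_add hi1 hi2]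
    _ ≤ 256 * eulerMom δ z₀ T := by linarith

/-- From `i/2ᵐ ≤ t ≤ T` with `T + 1 ≤ n`: `(i+1)/2ᵐ ≤ n` and `i/2ᵐ ≤ T` (real form). [folklore] -/
theorem cell_in_horizon {m n : ℕ} {i : ℕ} {t T : ℝ≥0} (hit : ((i : ℕ) : ℝ≥0) / 2 ^ m ≤ t)
    (ht : t ≤ T) (hTn : (T : ℝ) + 1 ≤ n) :
    (((i + 1 : ℕ) : ℝ≥0) / 2 ^ m) ≤ n ∧ (i : ℝ) / 2 ^ m ≤ T := by
  have h1 : ((i : ℝ) / 2 ^ m) ≤ T := by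
    have := NNReal.coe_le_coe.2 (hit.trans ht)
    push_cast at this
    exact this
  refine ⟨?_, h1⟩
  rw [← NNReal.coe_le_coe]
  push_cast
  have h2 : (1 : ℝ) / 2 ^ m ≤ 1 := by
    rw [div_le_one (pow_pos two_pos m)]; exact one_le_pow₀ one_le_two
  calc ((i : ℝ) + 1) / 2 ^ m = (i : ℝ) / 2 ^ m + 1 / 2 ^ m := by ring
    _ ≤ T + 1 := add_le_add h1 h2
    _ ≤ n := hTn

/-- **The Itô–Taylor estimate for the Yamada–Watanabe functional of `Zⁿ - Zᵐ`**: for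
`1 ≤ n ≤ m`, `T + 1 ≤ n`, `t ≤ T`, `ε, η > 0`,
`E[F_ε(Zⁿ_t - Zᵐ_t)] ≤ ½ t (12 + ε⁻¹ γ(n, m)) + (16 M η + 6 ε⁻¹ (η ε²)⁻² · 256 M · 2⁻ᵐ) t`.
Yamada–Watanabe (1971), Thm 1; Gyöngy–Rásonyi (2011), proof of Prop. 2.2 (expectation of the
Yamada–Watanabe functional; there for `X - Xⁿ`, here for the difference of two Euler
approximations). [folklore] -/
theorem integral_ywF_eulerZ_sub_le {ε η : ℝ} (hε : 0 < ε) (hη : 0 < η) {n m : ℕ} (hn : 1 ≤ n)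
    (hnm : n ≤ m) {T : ℝ≥0} (hTn : (T : ℝ) + 1 ≤ n) {t : ℝ≥0} (ht : t ≤ T) :
    ∫ ω, ywF ε (eulerZ δ z₀ n t ω - eulerZ δ z₀ m t ω) ∂Literature.Probability.Process.preWienerMeasure ≤
      2⁻¹ * t * (12 + ε⁻¹ * cellErr δ z₀ T n m) +
        (16 * eulerMom δ z₀ T * η + 6 * ε⁻¹ / (η * ε ^ 2) ^ 2 * (256 * eulerMom δ z₀ T) *
          (1 / 2 ^ m)) * t := by
  haveI := Literature.Probability.RandomPlanarGeometry.isProbabilityMeasure_preWienerMeasure'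
  set R := eulerDiff δ z₀ hnm with hR
  set M := eulerMom δ z₀ T with hM
  have hM0 : 0 ≤ M := by rw [hM]; unfold eulerMom; positivity
  -- `Zⁿ_t - Zᵐ_t = (R·B)_t`
  simp_rw [eulerZ_sub_eulerZ δ z₀ hnm]
  -- the Itô–Taylor estimate
  have hδF : 0 < η * ε ^ 2 := by positivity
  have hIT := R.ito_taylor_estimate_brownian (hasDerivAt_ywF hε) (hasDerivAt_ywF' hε)
    (abs_ywF''_le hε) hδF (fun x y h ↦ abs_ywF''_sub_le_of_le hε h) t
  rw [ywF_zero hε.le, sub_zero] at hIT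
  have hlen : R.times.length = m * 2 ^ m + 1 := by simp [hR]
  -- the capped increments
  set Δ : ℕ → ℝ := fun i ↦ ((min t (R.time (i + 1)) : ℝ≥0) : ℝ) - (min t (R.time i) : ℝ≥0) with hΔ
  have hΔ0 : ∀ i ∈ range (R.times.length - 1), 0 ≤ Δ i := fun i hi ↦
    R.sub_min_time_nonneg t (by have := mem_range.1 hi; omega)
  have hΔle : ∀ i ∈ range (R.times.length - 1), Δ i ≤ 1 / 2 ^ m := by
    intro i hi
    have hi' : i + 1 < R.times.length := by have := mem_range.1 hi; omega
    refine (R.sub_min_time_le t hi').trans ?_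
    rw [R.time_of_times_eq_dyadicTimes rfl (by omega), R.time_of_times_eq_dyadicTimes rfl (by omega)]
    rw [NNReal.coe_div, NNReal.coe_div]
    push_cast
    rw [← sub_div]
    ring_nf
    rfl
  have hΔsum : ∑ i ∈ range (R.times.length - 1), Δ i ≤ t := R.sum_sub_min_time_le t
  -- the main term, cell by cell
  set bnd : ℝ := 12 + ε⁻¹ * cellErr δ z₀ T n m with hbnd
  have hbnd0 : 0 ≤ bnd := by
    have := cellErr_nonneg δ z₀ T n m
    positivity
  have hmain : ∀ i ∈ range (R.times.length - 1),
      Δ i * ∫ ω, ywF'' ε (R.integral Literature.Probability.Process.brownian (min t (R.time i)) ω) * R.value i ω ^ 2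
        ∂Literature.Probability.Process.preWienerMeasure ≤ Δ i * bnd := by
    intro i hi
    have hi' : i + 1 < R.times.length := by have := mem_range.1 hi; omega
    have hilt : i < m * 2 ^ m := by omega
    have hti : R.time i = ((i : ℕ) : ℝ≥0) / 2 ^ m := R.time_of_times_eq_dyadicTimes rfl (by omega)
    by_cases hTi : R.time i ≤ t
    · rw [min_eq_right hTi]
      refine mul_le_mul_of_nonneg_left ?_ (hΔ0 i hi)
      rw [hti] at hTi ⊢
      obtain ⟨hjn, hjT⟩ := cell_in_horizon hTi ht hTn
      have := integral_ywF''_mul_eulerDiffValue_sq_le δ z₀ hε hn hnm hilt hjn hjT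
      simpa [hR] using this
    · push Not at hTi
      have : Δ i = 0 := by
        simp only [hΔ]
        rw [min_eq_left hTi.le, min_eq_left (hTi.le.trans (R.time_mono (Nat.le_succ i) hi')),
          sub_self]
      rw [this, zero_mul, zero_mul]
  have hmain' : ∑ i ∈ range (R.times.length - 1),
      Δ i * ∫ ω, ywF'' ε (R.integral Literature.Probability.Process.brownian (min t (R.time i)) ω) * R.value i ω ^ 2
        ∂Literature.Probability.Process.preWienerMeasure ≤ t * bnd :=
    calc _ ≤ ∑ i ∈ range (R.times.length - 1), Δ i * bnd := sum_le_sum hmain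
      _ = (∑ i ∈ range (R.times.length - 1), Δ i) * bnd := by rw [sum_mul]
      _ ≤ t * bnd := mul_le_mul_of_nonneg_right hΔsum hbnd0
  -- the error term, cell by cell
  set K : ℝ := 6 * ε⁻¹ / (η * ε ^ 2) ^ 2 with hK
  have hK0 : 0 ≤ K := by positivity
  have herr : ∑ i ∈ range (R.times.length - 1),
      (η * Δ i * (∫ ω, R.value i ω ^ 2 ∂Literature.Probability.Process.preWienerMeasure) +
        K * Δ i ^ 2 * ∫ ω, R.value i ω ^ 4 ∂Literature.Probability.Process.preWienerMeasure) ≤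
      (16 * M * η + K * (256 * M) * (1 / 2 ^ m)) * t := by
    have hterm : ∀ i ∈ range (R.times.length - 1),
        η * Δ i * (∫ ω, R.value i ω ^ 2 ∂Literature.Probability.Process.preWienerMeasure) +
          K * Δ i ^ 2 * ∫ ω, R.value i ω ^ 4 ∂Literature.Probability.Process.preWienerMeasure ≤
        (16 * M * η + K * (256 * M) * (1 / 2 ^ m)) * Δ i := by
      intro i hi
      have hi' : i + 1 < R.times.length := by have := mem_range.1 hi; omega
      have hilt : i < m * 2 ^ m := by omega
      have hti : R.time i = ((i : ℕ) : ℝ≥0) / 2 ^ m := R.time_of_times_eq_dyadicTimes rfl (by omega)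
      have hd := hΔ0 i hi
      have hdl := hΔle i hi
      by_cases hTi : R.time i ≤ t
      · rw [hti] at hTi
        obtain ⟨hjn, hjT⟩ := cell_in_horizon hTi ht hTn
        have h2 : ∫ ω, R.value i ω ^ 2 ∂Literature.Probability.Process.preWienerMeasure ≤ 16 * M := by
          simpa [hR] using integral_eulerDiffValue_sq_le_const δ z₀ hnm hilt hjn hjT
        have h4 : ∫ ω, R.value i ω ^ 4 ∂Literature.Probability.Process.preWienerMeasure ≤ 256 * M := by
          simpa [hR] using integral_eulerDiffValue_pow_four_le δ z₀ hnm hilt hjn hjT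
        have h4' : 0 ≤ ∫ ω, R.value i ω ^ 4 ∂Literature.Probability.Process.preWienerMeasure :=
          integral_nonneg fun ω ↦ by positivity
        have e1 : η * Δ i * (∫ ω, R.value i ω ^ 2 ∂Literature.Probability.Process.preWienerMeasure) ≤ 16 * M * η * Δ i := by
          calc _ ≤ η * Δ i * (16 * M) := mul_le_mul_of_nonneg_left h2 (by positivity)
            _ = _ := by ring
        have hΔ2 : Δ i ^ 2 ≤ Δ i * (1 / 2 ^ m) := by
          rw [sq]; exact mul_le_mul_of_nonneg_left hdl hd
        have e2 : K * Δ i ^ 2 * ∫ ω, R.value i ω ^ 4 ∂Literature.Probability.Process.preWienerMeasure ≤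
            K * (256 * M) * (1 / 2 ^ m) * Δ i := by
          calc _ ≤ K * (Δ i * (1 / 2 ^ m)) * (256 * M) :=
                mul_le_mul (mul_le_mul_of_nonneg_left hΔ2 hK0) h4 h4'
                  (mul_nonneg hK0 (mul_nonneg hd (by positivity)))
            _ = _ := by ring
        linarith
      · push Not at hTi
        have : Δ i = 0 := by
          simp only [hΔ]
          rw [min_eq_left hTi.le, min_eq_left (hTi.le.trans (R.time_mono (Nat.le_succ i) hi')),
            sub_self]
        rw [this]
        simp
    calc _ ≤ ∑ i ∈ range (R.times.length - 1), (16 * M * η + K * (256 * M) * (1 / 2 ^ m)) * Δ i :=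
          sum_le_sum hterm
      _ = (16 * M * η + K * (256 * M) * (1 / 2 ^ m)) * ∑ i ∈ range (R.times.length - 1), Δ i := by
          rw [mul_sum]
      _ ≤ _ := mul_le_mul_of_nonneg_left hΔsum (by positivity)
  -- combine
  have habs := (abs_sub_le_iff.1 (hIT.trans herr)).1
  nlinarith [hmain', habs]

/-- **The Yamada–Watanabe `L¹` estimate with free parameters**: for `1 ≤ n ≤ m`, `T + 1 ≤ n`,
`t ≤ T`, `ε, η, λ > 0`,
`E|Zⁿ_t - Zᵐ_t| ≤ (6t + ½ t ε⁻¹ γ(n,m) + (16 M η + K 2⁻ᵐ) t)/λ + ε sinh(λ + 1)`.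
Gyöngy–Rásonyi (2011), proof of Prop. 2.2 and of Thm 2.1. [folklore] -/
theorem integral_abs_eulerZ_sub_le_of_params {ε η l : ℝ} (hε : 0 < ε) (hη : 0 < η) (hl : 0 < l)
    {n m : ℕ} (hn : 1 ≤ n) (hnm : n ≤ m) {T : ℝ≥0} (hTn : (T : ℝ) + 1 ≤ n) {t : ℝ≥0} (ht : t ≤ T) :
    ∫ ω, |eulerZ δ z₀ n t ω - eulerZ δ z₀ m t ω| ∂Literature.Probability.Process.preWienerMeasure ≤
      (2⁻¹ * t * (12 + ε⁻¹ * cellErr δ z₀ T n m) +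
        (16 * eulerMom δ z₀ T * η + 6 * ε⁻¹ / (η * ε ^ 2) ^ 2 * (256 * eulerMom δ z₀ T) *
          (1 / 2 ^ m)) * t) / l + ε * Real.sinh (l + 1) := by
  haveI := Literature.Probability.RandomPlanarGeometry.isProbabilityMeasure_preWienerMeasure'
  have hF := integral_ywF_eulerZ_sub_le δ z₀ hε hη hn hnm hTn ht
  -- integrability
  have hL2 : MemLp (fun ω ↦ eulerZ δ z₀ n t ω - eulerZ δ z₀ m t ω) 2 Literature.Probability.Process.preWienerMeasure := by
    have : (fun ω ↦ eulerZ δ z₀ n t ω - eulerZ δ z₀ m t ω) =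
        (eulerDiff δ z₀ hnm).integral Literature.Probability.Process.brownian t := funext (eulerZ_sub_eulerZ δ z₀ hnm t)
    rw [this]
    exact Literature.Probability.Process.memLp_two_integral_brownian _ t
  have hiabs : Integrable (fun ω ↦ |eulerZ δ z₀ n t ω - eulerZ δ z₀ m t ω|) Literature.Probability.Process.preWienerMeasure :=
    (hL2.integrable one_le_two).abs
  have hiF : Integrable (fun ω ↦ ywF ε (eulerZ δ z₀ n t ω - eulerZ δ z₀ m t ω)) Literature.Probability.Process.preWienerMeasure :=
    Literature.Probability.Process.integrable_comp_of_abs_deriv_two_le (hasDerivAt_ywF hε) (hasDerivAt_ywF' hε) (abs_ywF''_le hε) hL2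
  -- integrate `λ|x| ≤ F_ε(x) + λ ε sinh(λ + 1)`
  have hpt : ∀ ω, l * |eulerZ δ z₀ n t ω - eulerZ δ z₀ m t ω| ≤
      ywF ε (eulerZ δ z₀ n t ω - eulerZ δ z₀ m t ω) + l * (ε * Real.sinh (l + 1)) := fun ω ↦
    mul_abs_le_ywF_add hε hl.le _
  have hsum : Integrable (fun ω ↦ ywF ε (eulerZ δ z₀ n t ω - eulerZ δ z₀ m t ω) +
      l * (ε * Real.sinh (l + 1))) Literature.Probability.Process.preWienerMeasure := hiF.add (integrable_const _)
  have hint := integral_mono (hiabs.const_mul l) hsum hpt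
  rw [integral_const_mul, integral_add hiF (integrable_const _)] at hint
  simp only [integral_const, probReal_univ, smul_eq_mul, one_mul] at hint
  rw [div_add' _ _ _ hl.ne', le_div_iff₀ hl]
  nlinarith

/-- **The Euler scheme is Cauchy in `L¹`, uniformly on compacts**: for every `T` and `κ > 0`
there is `N` with `E|Zⁿ_t - Zᵐ_t| ≤ κ` for all `N ≤ n ≤ m` and `t ≤ T`.
Yamada (1978); cf. Gyöngy–Rásonyi (2011), Thm 2.1 (`L¹` convergence of the Euler scheme for
Hölder-`½` diffusion coefficients such as `σ(z) = 2√|z|`). [folklore] -/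
theorem exists_forall_integral_abs_eulerZ_sub_le (T : ℝ≥0) {κ : ℝ} (hκ : 0 < κ) :
    ∃ N : ℕ, ∀ n m : ℕ, N ≤ n → n ≤ m → ∀ t : ℝ≥0, t ≤ T →
      ∫ ω, |eulerZ δ z₀ n t ω - eulerZ δ z₀ m t ω| ∂Literature.Probability.Process.preWienerMeasure ≤ κ := by
  set M := eulerMom δ z₀ T with hM
  have hM1 : 1 ≤ M := one_le_eulerMom δ z₀ T.coe_nonneg
  have hT : (0 : ℝ) ≤ T := T.coe_nonneg
  -- the parameters
  set l : ℝ := 24 * T / κ + 1 with hl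
  have hl0 : 0 < l := by positivity
  set ε : ℝ := κ / (4 * (Real.sinh (l + 1) + 1)) with hεd
  have hsh : 0 < Real.sinh (l + 1) := Real.sinh_pos_iff.2 (by linarith)
  have hε : 0 < ε := by positivity
  set η : ℝ := κ * l / (64 * M * T + 1) with hηd
  have hη : 0 < η := by positivity
  set K : ℝ := 6 * ε⁻¹ / (η * ε ^ 2) ^ 2 with hK
  have hK0 : 0 ≤ K := by positivity
  set C₁ : ℝ := δ ^ 2 + 4 * M with hC₁
  have hC₁0 : 0 ≤ C₁ := by positivity
  -- the `n`-dependent remainder and its limit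
  set r : ℕ → ℝ := fun n ↦ (2⁻¹ * T * (ε⁻¹ * (96 * M / n ^ 2 + 12 * Real.sqrt ((1 / 2 ^ n) * C₁))) +
    K * (256 * M) * (1 / 2 ^ n) * T) / l with hr
  have h2n : Tendsto (fun n : ℕ ↦ (1 : ℝ) / 2 ^ n) atTop (𝓝 0) :=
    tendsto_const_nhds.div_atTop (tendsto_pow_atTop_atTop_of_one_lt (one_lt_two : (1 : ℝ) < 2))
  have hn2 : Tendsto (fun n : ℕ ↦ (96 * M : ℝ) / n ^ 2) atTop (𝓝 0) := by
    have : Tendsto (fun n : ℕ ↦ ((n : ℝ)) ^ 2) atTop atTop :=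
      (tendsto_pow_atTop two_ne_zero).comp tendsto_natCast_atTop_atTop
    exact tendsto_const_nhds.div_atTop this
  have hsqrt : Tendsto (fun n : ℕ ↦ Real.sqrt ((1 / 2 ^ n) * C₁)) atTop (𝓝 0) := by
    have h := (h2n.mul_const C₁)
    rw [zero_mul] at h
    have := (Real.continuous_sqrt.tendsto 0).comp h
    rwa [Function.comp_def, Real.sqrt_zero] at this
  have hrlim : Tendsto r atTop (𝓝 0) := by
    have h1 : Tendsto (fun n : ℕ ↦ 2⁻¹ * (T : ℝ) * (ε⁻¹ * (96 * M / n ^ 2 +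
        12 * Real.sqrt ((1 / 2 ^ n) * C₁)))) atTop (𝓝 (2⁻¹ * T * (ε⁻¹ * (0 + 12 * 0)))) :=
      ((hn2.add (hsqrt.const_mul 12)).const_mul _).const_mul _
    have h2 : Tendsto (fun n : ℕ ↦ K * (256 * M) * (1 / 2 ^ n) * (T : ℝ)) atTop
        (𝓝 (K * (256 * M) * 0 * T)) := ((h2n.const_mul _).mul_const _)
    have := (h1.add h2).div_const l
    simp only [mul_zero, add_zero, zero_mul, zero_div] at this
    exact this
  obtain ⟨N₁, hN₁⟩ := eventually_atTop.1 (hrlim.eventually (gt_mem_nhds (by positivity : (0:ℝ) < κ / 4)))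
  -- `N`
  refine ⟨max N₁ (max 1 ⌈(T : ℝ) + 1⌉₊), fun n m hNn hnm t ht ↦ ?_⟩
  have hn1 : 1 ≤ n := le_trans (le_max_left _ _) ((le_max_right _ _).trans hNn)
  have hnN₁ : N₁ ≤ n := (le_max_left _ _).trans hNn
  have hTn : (T : ℝ) + 1 ≤ n := (Nat.le_ceil _).trans (by
    have : ⌈(T : ℝ) + 1⌉₊ ≤ n := le_trans (le_max_right _ _) ((le_max_right _ _).trans hNn)
    exact_mod_cast this)
  have hn0 : (0 : ℝ) < n := by exact_mod_cast hn1
  have hmn : (n : ℝ) ≤ m := by exact_mod_cast hnm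
  have hest := integral_abs_eulerZ_sub_le_of_params δ z₀ hε hη hl0 hn1 hnm hTn ht
  have htT : (t : ℝ) ≤ T := NNReal.coe_le_coe.2 ht
  have ht0 : (0 : ℝ) ≤ t := t.coe_nonneg
  -- bound each piece
  -- (1) `6 t / l ≤ κ/4`
  have p1 : 2⁻¹ * (t : ℝ) * 12 / l ≤ κ / 4 := by
    rw [div_le_iff₀ hl0]
    have : 6 * (T : ℝ) ≤ κ / 4 * l := by
      rw [hl]; field_simp; nlinarith
    nlinarith
  -- (2) `γ(n, m) ≤ 96 M/n² + 12 √(2⁻ⁿ C₁)` and the remainder `≤ r n < κ/4`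
  have hγ : cellErr δ z₀ T n m ≤ 96 * M / n ^ 2 + 12 * Real.sqrt ((1 / 2 ^ n) * C₁) := by
    unfold cellErr
    have : 48 * M / (m : ℝ) ^ 2 ≤ 48 * M / n ^ 2 := by
      apply div_le_div_of_nonneg_left (by positivity) (by positivity)
      exact pow_le_pow_left₀ hn0.le hmn 2
    have e : (96 : ℝ) * M / n ^ 2 = 48 * M / n ^ 2 + 48 * M / n ^ 2 := by ring
    rw [← hM, ← hC₁, e]
    linarith
  have h2m : (1 : ℝ) / 2 ^ m ≤ 1 / 2 ^ n :=
    div_le_div_of_nonneg_left zero_le_one (pow_pos two_pos n) (pow_le_pow_right₀ one_le_two hnm)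
  have p2 : (2⁻¹ * (t : ℝ) * (ε⁻¹ * cellErr δ z₀ T n m) + K * (256 * M) * (1 / 2 ^ m) * t) / l ≤
      r n := by
    rw [hr]
    refine div_le_div_of_nonneg_right ?_ hl0.le
    have hε' : 0 ≤ ε⁻¹ := by positivity
    have q1 : 2⁻¹ * (t : ℝ) * (ε⁻¹ * cellErr δ z₀ T n m) ≤
        2⁻¹ * T * (ε⁻¹ * (96 * M / n ^ 2 + 12 * Real.sqrt ((1 / 2 ^ n) * C₁))) := by
      have hc := cellErr_nonneg δ z₀ T n m
      gcongr
    have q2 : K * (256 * M) * (1 / 2 ^ m) * (t : ℝ) ≤ K * (256 * M) * (1 / 2 ^ n) * T := by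
      gcongr
    linarith
  have p2' : r n < κ / 4 := hN₁ n hnN₁
  -- (3) `16 M η t / l ≤ κ/4`
  have p3 : 16 * M * η * (t : ℝ) / l ≤ κ / 4 := by
    rw [div_le_iff₀ hl0, hηd]
    have hden : (0 : ℝ) < 64 * M * T + 1 := by positivity
    rw [show 16 * M * (κ * l / (64 * M * T + 1)) * (t : ℝ) = (16 * M * t) * (κ * l) / (64 * M * T + 1)
      by ring, div_le_iff₀ hden]
    nlinarith [mul_nonneg (by positivity : (0 : ℝ) ≤ κ * l) (by nlinarith : (0:ℝ) ≤ 16 * M * (T - t)),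
      mul_pos hκ hl0]
  -- (4) `ε sinh(l + 1) ≤ κ/4`
  have p4 : ε * Real.sinh (l + 1) ≤ κ / 4 := by
    rw [hεd, div_mul_eq_mul_div, div_le_iff₀ (by positivity)]
    nlinarith [hsh]
  -- assemble
  have hsplit : (2⁻¹ * (t : ℝ) * (12 + ε⁻¹ * cellErr δ z₀ T n m) +
      (16 * M * η + K * (256 * M) * (1 / 2 ^ m)) * t) / l =
      2⁻¹ * t * 12 / l + (2⁻¹ * t * (ε⁻¹ * cellErr δ z₀ T n m) + K * (256 * M) * (1 / 2 ^ m) * t) / l +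
        16 * M * η * t / l := by
    field_simp
    ring
  rw [hsplit] at hest
  linarith

/-! ### The `L²` estimate -/

/-- **Pointwise bound on `Rₙₘ(j)²`**: with `b = j/2ᵐ`, `k = coarseIdx n m j`, `a = k/2ⁿ`,
`Rₙₘ(j)² ≤ 3 (σ - σₙ)²(zⁿ_k) + 12 |Zⁿ_b - Zⁿ_a| + 12 |Zⁿ_b - Zᵐ_b| + 3 (σ - σₘ)²(zᵐ_j)`.
[folklore] -/
theorem eulerDiffValue_sq_le {n m : ℕ} (hnm : n ≤ m) {j : ℕ} (hj : j < m * 2 ^ m)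
    (hjn : (((j + 1 : ℕ) : ℝ≥0) / 2 ^ m) ≤ n) (ω : ℝ≥0 → ℝ) :
    eulerDiffValue δ z₀ hnm j ω ^ 2 ≤
      3 * (besqσ (eulerPt δ z₀ n (coarseIdx n m j) ω) -
          besqσTrunc n (eulerPt δ z₀ n (coarseIdx n m j) ω)) ^ 2 +
        12 * |eulerZ δ z₀ n (((j : ℕ) : ℝ≥0) / 2 ^ m) ω -
          eulerZ δ z₀ n (((coarseIdx n m j : ℕ) : ℝ≥0) / 2 ^ n) ω| +
        12 * |eulerZ δ z₀ n (((j : ℕ) : ℝ≥0) / 2 ^ m) ω - eulerZ δ z₀ m (((j : ℕ) : ℝ≥0) / 2 ^ m) ω| +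
        3 * (besqσ (eulerPt δ z₀ m j ω) - besqσTrunc m (eulerPt δ z₀ m j ω)) ^ 2 := by
  obtain ⟨hk, -, -⟩ := coarseIdx_spec hnm hjn
  set k := coarseIdx n m j with hkdef
  set b : ℝ≥0 := ((j : ℕ) : ℝ≥0) / 2 ^ m with hb
  set a : ℝ≥0 := ((k : ℕ) : ℝ≥0) / 2 ^ n with ha
  set p := eulerPt δ z₀ n k ω with hp
  set q := eulerPt δ z₀ m j ω with hq
  have hpa : eulerZ δ z₀ n a ω = p := eulerZ_grid δ z₀ n hk.le ω
  have hqb : eulerZ δ z₀ m b ω = q := eulerZ_grid δ z₀ m hj.le ω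
  have hζ : eulerDiffValue δ z₀ hnm j ω = besqσTrunc n p - besqσTrunc m q :=
    eulerDiffValue_eq δ z₀ hnm hj hjn ω
  set x := besqσTrunc n p - besqσ p with hx
  set y := besqσ p - besqσ q with hy
  set w := besqσ q - besqσTrunc m q with hw
  have hζ' : eulerDiffValue δ z₀ hnm j ω = x + y + w := by rw [hζ]; ring
  have hy2 : y ^ 2 ≤ 4 * |eulerZ δ z₀ n b ω - eulerZ δ z₀ n a ω| +
      4 * |eulerZ δ z₀ n b ω - eulerZ δ z₀ m b ω| := by
    have h1 : y ^ 2 ≤ 4 * |p - q| := sq_besqσ_sub_le p q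
    have h2 : |p - q| ≤ |eulerZ δ z₀ n b ω - eulerZ δ z₀ n a ω| +
        |eulerZ δ z₀ n b ω - eulerZ δ z₀ m b ω| := by
      rw [← hqb, ← hpa]
      have := abs_sub_le (eulerZ δ z₀ n a ω) (eulerZ δ z₀ n b ω) (eulerZ δ z₀ m b ω)
      rw [abs_sub_comm (eulerZ δ z₀ n a ω) (eulerZ δ z₀ n b ω)] at this
      linarith
    linarith
  have hsq : eulerDiffValue δ z₀ hnm j ω ^ 2 ≤ 3 * (x ^ 2 + y ^ 2 + w ^ 2) := by
    rw [hζ']; nlinarith [sq_nonneg (x - y), sq_nonneg (y - w), sq_nonneg (x - w)]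
  have hx2 : x ^ 2 = (besqσ p - besqσTrunc n p) ^ 2 := by rw [hx]; ring
  linarith

/-- **Second moment of `Rₙₘ(j)`**: for `1 ≤ n ≤ m`, `j < m 2ᵐ`, `(j+1)/2ᵐ ≤ n`, `j/2ᵐ ≤ T`,
`E[Rₙₘ(j)²] ≤ γ(n, m) + 12 E|Zⁿ_{j/2ᵐ} - Zᵐ_{j/2ᵐ}|`. [folklore] -/
theorem integral_eulerDiffValue_sq_le {n m : ℕ} (hn : 1 ≤ n) (hnm : n ≤ m) {j : ℕ}
    (hj : j < m * 2 ^ m) (hjn : (((j + 1 : ℕ) : ℝ≥0) / 2 ^ m) ≤ n) {T : ℝ}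
    (hjT : (j : ℝ) / 2 ^ m ≤ T) :
    ∫ ω, eulerDiffValue δ z₀ hnm j ω ^ 2 ∂Literature.Probability.Process.preWienerMeasure ≤
      cellErr δ z₀ T n m + 12 * ∫ ω, |eulerZ δ z₀ n (((j : ℕ) : ℝ≥0) / 2 ^ m) ω -
        eulerZ δ z₀ m (((j : ℕ) : ℝ≥0) / 2 ^ m) ω| ∂Literature.Probability.Process.preWienerMeasure := by
  haveI := Literature.Probability.RandomPlanarGeometry.isProbabilityMeasure_preWienerMeasure'
  obtain ⟨hk, hab, hb1⟩ := coarseIdx_spec hnm hjn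
  set k := coarseIdx n m j with hkdef
  have hm1 : 1 ≤ m := hn.trans hnm
  have hkT : (k : ℝ) / 2 ^ n ≤ T := by
    have := NNReal.coe_le_coe.2 hab
    push_cast at this
    exact this.trans hjT
  have e1 := integral_sq_besqσ_sub_besqσTrunc_le δ z₀ n hn hkT
  have e3 := integral_sq_besqσ_sub_besqσTrunc_le δ z₀ m hm1 hjT
  obtain ⟨hmem, hincr⟩ := integral_eulerZ_sub_sq_le δ z₀ n hk hab hb1 hkT
  have e2 : ∫ ω, |eulerZ δ z₀ n (((j : ℕ) : ℝ≥0) / 2 ^ m) ω -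
      eulerZ δ z₀ n (((k : ℕ) : ℝ≥0) / 2 ^ n) ω| ∂Literature.Probability.Process.preWienerMeasure ≤
      Real.sqrt ((1 / 2 ^ n) * (δ ^ 2 + 4 * eulerMom δ z₀ T)) :=
    (integral_abs_le_sqrt_integral_sq hmem).trans (Real.sqrt_le_sqrt hincr)
  have hi1 := integrable_sq_besqσ_sub_besqσTrunc δ z₀ n n k
  have hi2 : Integrable (fun ω ↦ |eulerZ δ z₀ n (((j : ℕ) : ℝ≥0) / 2 ^ m) ω -
      eulerZ δ z₀ n (((k : ℕ) : ℝ≥0) / 2 ^ n) ω|) Literature.Probability.Process.preWienerMeasure :=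
    (hmem.integrable one_le_two).abs
  have hL2d : MemLp (fun ω ↦ eulerZ δ z₀ n (((j : ℕ) : ℝ≥0) / 2 ^ m) ω -
      eulerZ δ z₀ m (((j : ℕ) : ℝ≥0) / 2 ^ m) ω) 2 Literature.Probability.Process.preWienerMeasure := by
    have : (fun ω ↦ eulerZ δ z₀ n (((j : ℕ) : ℝ≥0) / 2 ^ m) ω -
        eulerZ δ z₀ m (((j : ℕ) : ℝ≥0) / 2 ^ m) ω) =
        (eulerDiff δ z₀ hnm).integral Literature.Probability.Process.brownian (((j : ℕ) : ℝ≥0) / 2 ^ m) :=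
      funext (eulerZ_sub_eulerZ δ z₀ hnm _)
    rw [this]; exact Literature.Probability.Process.memLp_two_integral_brownian _ _
  have hi3 : Integrable (fun ω ↦ |eulerZ δ z₀ n (((j : ℕ) : ℝ≥0) / 2 ^ m) ω -
      eulerZ δ z₀ m (((j : ℕ) : ℝ≥0) / 2 ^ m) ω|) Literature.Probability.Process.preWienerMeasure := (hL2d.integrable one_le_two).abs
  have hi4 := integrable_sq_besqσ_sub_besqσTrunc δ z₀ m m j
  have h12 : Integrable (fun ω ↦ 3 * (besqσ (eulerPt δ z₀ n k ω) - besqσTrunc n (eulerPt δ z₀ n k ω)) ^ 2 +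
      12 * |eulerZ δ z₀ n (((j : ℕ) : ℝ≥0) / 2 ^ m) ω - eulerZ δ z₀ n (((k : ℕ) : ℝ≥0) / 2 ^ n) ω|)
      Literature.Probability.Process.preWienerMeasure := (hi1.const_mul 3).add (hi2.const_mul 12)
  have h123 : Integrable (fun ω ↦ 3 * (besqσ (eulerPt δ z₀ n k ω) - besqσTrunc n (eulerPt δ z₀ n k ω)) ^ 2 +
      12 * |eulerZ δ z₀ n (((j : ℕ) : ℝ≥0) / 2 ^ m) ω - eulerZ δ z₀ n (((k : ℕ) : ℝ≥0) / 2 ^ n) ω| +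
      12 * |eulerZ δ z₀ n (((j : ℕ) : ℝ≥0) / 2 ^ m) ω - eulerZ δ z₀ m (((j : ℕ) : ℝ≥0) / 2 ^ m) ω|)
      Literature.Probability.Process.preWienerMeasure := h12.add (hi3.const_mul 12)
  have h1234 : Integrable (fun ω ↦ 3 * (besqσ (eulerPt δ z₀ n k ω) - besqσTrunc n (eulerPt δ z₀ n k ω)) ^ 2 +
      12 * |eulerZ δ z₀ n (((j : ℕ) : ℝ≥0) / 2 ^ m) ω - eulerZ δ z₀ n (((k : ℕ) : ℝ≥0) / 2 ^ n) ω| +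
      12 * |eulerZ δ z₀ n (((j : ℕ) : ℝ≥0) / 2 ^ m) ω - eulerZ δ z₀ m (((j : ℕ) : ℝ≥0) / 2 ^ m) ω| +
      3 * (besqσ (eulerPt δ z₀ m j ω) - besqσTrunc m (eulerPt δ z₀ m j ω)) ^ 2)
      Literature.Probability.Process.preWienerMeasure := h123.add (hi4.const_mul 3)
  calc _ ≤ ∫ ω, (3 * (besqσ (eulerPt δ z₀ n k ω) - besqσTrunc n (eulerPt δ z₀ n k ω)) ^ 2 +
        12 * |eulerZ δ z₀ n (((j : ℕ) : ℝ≥0) / 2 ^ m) ω - eulerZ δ z₀ n (((k : ℕ) : ℝ≥0) / 2 ^ n) ω| +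
        12 * |eulerZ δ z₀ n (((j : ℕ) : ℝ≥0) / 2 ^ m) ω - eulerZ δ z₀ m (((j : ℕ) : ℝ≥0) / 2 ^ m) ω| +
        3 * (besqσ (eulerPt δ z₀ m j ω) - besqσTrunc m (eulerPt δ z₀ m j ω)) ^ 2) ∂Literature.Probability.Process.preWienerMeasure :=
        integral_mono_of_nonneg (ae_of_all _ fun ω ↦ sq_nonneg _) h1234
          (ae_of_all _ fun ω ↦ eulerDiffValue_sq_le δ z₀ hnm hj hjn ω)
    _ = 3 * (∫ ω, (besqσ (eulerPt δ z₀ n k ω) - besqσTrunc n (eulerPt δ z₀ n k ω)) ^ 2 ∂Literature.Probability.Process.preWienerMeasure) +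
        12 * (∫ ω, |eulerZ δ z₀ n (((j : ℕ) : ℝ≥0) / 2 ^ m) ω -
          eulerZ δ z₀ n (((k : ℕ) : ℝ≥0) / 2 ^ n) ω| ∂Literature.Probability.Process.preWienerMeasure) +
        12 * (∫ ω, |eulerZ δ z₀ n (((j : ℕ) : ℝ≥0) / 2 ^ m) ω -
          eulerZ δ z₀ m (((j : ℕ) : ℝ≥0) / 2 ^ m) ω| ∂Literature.Probability.Process.preWienerMeasure) +
        3 * ∫ ω, (besqσ (eulerPt δ z₀ m j ω) - besqσTrunc m (eulerPt δ z₀ m j ω)) ^ 2 ∂Literature.Probability.Process.preWienerMeasure := by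
        rw [integral_add h123 (hi4.const_mul 3), integral_add h12 (hi3.const_mul 12),
          integral_add (hi1.const_mul 3) (hi2.const_mul 12), integral_const_mul, integral_const_mul,
          integral_const_mul, integral_const_mul]
    _ ≤ _ := by
        have e1' : 3 * (∫ ω, (besqσ (eulerPt δ z₀ n k ω) - besqσTrunc n (eulerPt δ z₀ n k ω)) ^ 2
            ∂Literature.Probability.Process.preWienerMeasure) ≤ 48 * eulerMom δ z₀ T / n ^ 2 :=
          calc _ ≤ 3 * (16 * eulerMom δ z₀ T / n ^ 2) := by gcongr
            _ = _ := by ring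
        have e3' : 3 * (∫ ω, (besqσ (eulerPt δ z₀ m j ω) - besqσTrunc m (eulerPt δ z₀ m j ω)) ^ 2
            ∂Literature.Probability.Process.preWienerMeasure) ≤ 48 * eulerMom δ z₀ T / m ^ 2 :=
          calc _ ≤ 3 * (16 * eulerMom δ z₀ T / m ^ 2) := by gcongr
            _ = _ := by ring
        unfold cellErr
        linarith [e1', e2, e3']

/-- **The `L²` estimate**: for `1 ≤ n ≤ m`, `T + 1 ≤ n`, `t ≤ T`, if `E|Zⁿ_b - Zᵐ_b| ≤ κ₁` at all
grid points `b = j/2ᵐ ≤ T`, then `E[(Zⁿ_t - Zᵐ_t)²] ≤ t (γ(n, m) + 12 κ₁)` (Itô's isometry for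
`Rₙₘ`). Revuz–Yor, *Continuous Martingales and Brownian Motion* (1999), Ch. IV, Thm (2.2).
[folklore] -/
theorem integral_eulerZ_sub_sq_le_of_L1 {n m : ℕ} (hn : 1 ≤ n) (hnm : n ≤ m) {T : ℝ≥0}
    (hTn : (T : ℝ) + 1 ≤ n) {t : ℝ≥0} (ht : t ≤ T) {κ₁ : ℝ} (hκ₁ : 0 ≤ κ₁)
    (hL1 : ∀ j : ℕ, (((j : ℕ) : ℝ≥0) / 2 ^ m) ≤ T →
      ∫ ω, |eulerZ δ z₀ n (((j : ℕ) : ℝ≥0) / 2 ^ m) ω - eulerZ δ z₀ m (((j : ℕ) : ℝ≥0) / 2 ^ m) ω|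
        ∂Literature.Probability.Process.preWienerMeasure ≤ κ₁) :
    ∫ ω, (eulerZ δ z₀ n t ω - eulerZ δ z₀ m t ω) ^ 2 ∂Literature.Probability.Process.preWienerMeasure ≤
      t * (cellErr δ z₀ T n m + 12 * κ₁) := by
  haveI := Literature.Probability.RandomPlanarGeometry.isProbabilityMeasure_preWienerMeasure'
  set R := eulerDiff δ z₀ hnm with hR
  simp_rw [eulerZ_sub_eulerZ δ z₀ hnm]
  rw [Literature.Probability.Process.integral_integral_sq_brownian R t]
  have hlen : R.times.length = m * 2 ^ m + 1 := by simp [hR]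
  set Δ : ℕ → ℝ := fun i ↦ ((min t (R.time (i + 1)) : ℝ≥0) : ℝ) - (min t (R.time i) : ℝ≥0) with hΔ
  have hΔ0 : ∀ i ∈ range (R.times.length - 1), 0 ≤ Δ i := fun i hi ↦
    R.sub_min_time_nonneg t (by have := mem_range.1 hi; omega)
  have hΔsum : ∑ i ∈ range (R.times.length - 1), Δ i ≤ t := R.sum_sub_min_time_le t
  set bnd := cellErr δ z₀ T n m + 12 * κ₁ with hbnd
  have hbnd0 : 0 ≤ bnd := by have := cellErr_nonneg δ z₀ T n m; positivity
  have hterm : ∀ i ∈ range (R.times.length - 1),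
      (∫ ω, R.value i ω ^ 2 ∂Literature.Probability.Process.preWienerMeasure) * Δ i ≤ bnd * Δ i := by
    intro i hi
    have hi' : i + 1 < R.times.length := by have := mem_range.1 hi; omega
    have hilt : i < m * 2 ^ m := by omega
    have hti : R.time i = ((i : ℕ) : ℝ≥0) / 2 ^ m := R.time_of_times_eq_dyadicTimes rfl (by omega)
    by_cases hTi : R.time i ≤ t
    · refine mul_le_mul_of_nonneg_right ?_ (hΔ0 i hi)
      rw [hti] at hTi
      obtain ⟨hjn, hjT⟩ := cell_in_horizon hTi ht hTn
      have h := integral_eulerDiffValue_sq_le δ z₀ hn hnm hilt hjn hjT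
      have hb := hL1 i (hTi.trans ht)
      simp only [hR, eulerDiff_value]
      linarith
    · push Not at hTi
      have : Δ i = 0 := by
        simp only [hΔ]
        rw [min_eq_left hTi.le, min_eq_left (hTi.le.trans (R.time_mono (Nat.le_succ i) hi')),
          sub_self]
      rw [this, mul_zero, mul_zero]
  calc _ ≤ ∑ i ∈ range (R.times.length - 1), bnd * Δ i := sum_le_sum hterm
    _ = bnd * ∑ i ∈ range (R.times.length - 1), Δ i := by rw [mul_sum]
    _ ≤ bnd * t := mul_le_mul_of_nonneg_left hΔsum hbnd0
    _ = t * bnd := mul_comm _ _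

/-- **The Euler scheme is Cauchy in `L²`, uniformly on compacts**: for every `T` and `κ > 0`
there is `N` with `E[(Zⁿ_t - Zᵐ_t)²] ≤ κ` for all `N ≤ n ≤ m`, `t ≤ T`.
Gyöngy–Rásonyi (2011), Thm 2.1 with Revuz–Yor (1999), Ch. IV, Thm (2.2). [folklore] -/
theorem exists_forall_integral_eulerZ_sub_sq_le (T : ℝ≥0) {κ : ℝ} (hκ : 0 < κ) :
    ∃ N : ℕ, ∀ n m : ℕ, N ≤ n → n ≤ m → ∀ t : ℝ≥0, t ≤ T →
      ∫ ω, (eulerZ δ z₀ n t ω - eulerZ δ z₀ m t ω) ^ 2 ∂Literature.Probability.Process.preWienerMeasure ≤ κ := by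
  set M := eulerMom δ z₀ T with hM
  have hM1 : 1 ≤ M := one_le_eulerMom δ z₀ T.coe_nonneg
  have hT : (0 : ℝ) ≤ T := T.coe_nonneg
  set κ₁ : ℝ := κ / (24 * T + 1) with hκ₁
  have hκ₁0 : 0 < κ₁ := by positivity
  obtain ⟨N₁, hN₁⟩ := exists_forall_integral_abs_eulerZ_sub_le δ z₀ T hκ₁0
  set C₁ : ℝ := δ ^ 2 + 4 * M with hC₁
  -- the remainder `T (96 M/n² + 12 √(2⁻ⁿ C₁)) → 0`
  set r : ℕ → ℝ := fun n ↦ (T : ℝ) * (96 * M / n ^ 2 + 12 * Real.sqrt ((1 / 2 ^ n) * C₁)) with hr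
  have h2n : Tendsto (fun n : ℕ ↦ (1 : ℝ) / 2 ^ n) atTop (𝓝 0) :=
    tendsto_const_nhds.div_atTop (tendsto_pow_atTop_atTop_of_one_lt (one_lt_two : (1 : ℝ) < 2))
  have hn2 : Tendsto (fun n : ℕ ↦ (96 * M : ℝ) / n ^ 2) atTop (𝓝 0) := by
    have : Tendsto (fun n : ℕ ↦ ((n : ℝ)) ^ 2) atTop atTop :=
      (tendsto_pow_atTop two_ne_zero).comp tendsto_natCast_atTop_atTop
    exact tendsto_const_nhds.div_atTop this
  have hsqrt : Tendsto (fun n : ℕ ↦ Real.sqrt ((1 / 2 ^ n) * C₁)) atTop (𝓝 0) := by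
    have h := (h2n.mul_const C₁)
    rw [zero_mul] at h
    have := (Real.continuous_sqrt.tendsto 0).comp h
    rwa [Function.comp_def, Real.sqrt_zero] at this
  have hrlim : Tendsto r atTop (𝓝 0) := by
    have := (hn2.add (hsqrt.const_mul 12)).const_mul (T : ℝ)
    simp only [mul_zero, add_zero] at this
    exact this
  obtain ⟨N₂, hN₂⟩ := eventually_atTop.1 (hrlim.eventually (gt_mem_nhds (by positivity : (0:ℝ) < κ / 2)))
  refine ⟨max N₁ (max N₂ (max 1 ⌈(T : ℝ) + 1⌉₊)), fun n m hNn hnm t ht ↦ ?_⟩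
  have hnN₁ : N₁ ≤ n := (le_max_left _ _).trans hNn
  have hnN₂ : N₂ ≤ n := (le_max_left _ _).trans ((le_max_right _ _).trans hNn)
  have hn1 : 1 ≤ n := (le_max_left _ _).trans ((le_max_right _ _).trans ((le_max_right _ _).trans hNn))
  have hTn : (T : ℝ) + 1 ≤ n := (Nat.le_ceil _).trans (by
    have : ⌈(T : ℝ) + 1⌉₊ ≤ n :=
      (le_max_right _ _).trans ((le_max_right _ _).trans ((le_max_right _ _).trans hNn))
    exact_mod_cast this)
  have hn0 : (0 : ℝ) < n := by exact_mod_cast hn1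
  have hmn : (n : ℝ) ≤ m := by exact_mod_cast hnm
  have hL2 := integral_eulerZ_sub_sq_le_of_L1 δ z₀ hn1 hnm hTn ht hκ₁0.le
    (fun j hj ↦ hN₁ n m hnN₁ hnm _ hj)
  have htT : (t : ℝ) ≤ T := NNReal.coe_le_coe.2 ht
  have ht0 : (0 : ℝ) ≤ t := t.coe_nonneg
  have hγ : cellErr δ z₀ T n m ≤ 96 * M / n ^ 2 + 12 * Real.sqrt ((1 / 2 ^ n) * C₁) := by
    unfold cellErr
    have : 48 * M / (m : ℝ) ^ 2 ≤ 48 * M / n ^ 2 := by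
      apply div_le_div_of_nonneg_left (by positivity) (by positivity)
      exact pow_le_pow_left₀ hn0.le hmn 2
    have e : (96 : ℝ) * M / n ^ 2 = 48 * M / n ^ 2 + 48 * M / n ^ 2 := by ring
    rw [← hM, ← hC₁, e]
    linarith
  have hc0 := cellErr_nonneg δ z₀ T n m
  have p1 : (t : ℝ) * cellErr δ z₀ T n m ≤ r n := by
    rw [hr]
    exact mul_le_mul htT hγ hc0 hT
  have p2 : (t : ℝ) * (12 * κ₁) ≤ κ / 2 := by
    rw [hκ₁]
    have hden : (0 : ℝ) < 24 * T + 1 := by positivity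
    rw [show (t : ℝ) * (12 * (κ / (24 * T + 1))) = 12 * t * κ / (24 * T + 1) by ring,
      div_le_iff₀ hden]
    nlinarith [mul_nonneg hκ.le (by linarith : (0 : ℝ) ≤ T - t)]
  have := hN₂ n hnN₂
  nlinarith

/-! ### u.c.p. Cauchy via Doob's inequality -/

/-- The martingale parts `Mⁿ = eulerSP n · B` of the Euler processes. [folklore] -/
def eulerM (n : ℕ) : ℝ≥0 → (ℝ≥0 → ℝ) → ℝ := (eulerSP δ z₀ n).integral Literature.Probability.Process.brownian

/-- `Zⁿ_t - Zᵐ_t = Mⁿ_t - Mᵐ_t`. [folklore] -/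
theorem eulerZ_sub_eulerZ_eq_eulerM (n m : ℕ) (t : ℝ≥0) (ω : ℝ≥0 → ℝ) :
    eulerZ δ z₀ n t ω - eulerZ δ z₀ m t ω = eulerM δ z₀ n t ω - eulerM δ z₀ m t ω := by
  simp only [eulerZ, eulerM]; ring

/-- **The martingale parts of the Euler processes are Cauchy uniformly on compacts in
probability** (Doob's `L²` maximal inequality applied to `Rₙₘ · B = Mⁿ - Mᵐ` and the `L²`
estimate). Revuz–Yor, *Continuous Martingales and Brownian Motion* (1999), Ch. II, Thm (1.7);
Gyöngy–Rásonyi (2011), Thm 2.1. [folklore] -/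
theorem cauchy_ucp_eulerM (t : ℝ≥0) (e : ℝ) (he : 0 < e) (θ : ℝ≥0∞) (hθ : 0 < θ) :
    ∃ N, ∀ n ≥ N, ∀ n' ≥ N, Literature.Probability.Process.preWienerMeasure {ω | ∃ s ≤ t,
      e ≤ |eulerM δ z₀ n s ω - eulerM δ z₀ n' s ω|} ≤ θ := by
  haveI := Literature.Probability.RandomPlanarGeometry.isProbabilityMeasure_preWienerMeasure'
  -- reduce to a real target
  by_cases hθtop : θ = ⊤
  · exact ⟨0, fun n _ n' _ ↦ hθtop ▸ le_top⟩
  have hθr : 0 < θ.toReal := ENNReal.toReal_pos hθ.ne' hθtop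
  obtain ⟨N, hN⟩ := exists_forall_integral_eulerZ_sub_sq_le δ z₀ t (κ := θ.toReal * e ^ 2)
    (by positivity)
  -- the ordered case
  have hord : ∀ n m, N ≤ n → n ≤ m → Literature.Probability.Process.preWienerMeasure {ω | ∃ s ≤ t,
      e ≤ |eulerM δ z₀ n s ω - eulerM δ z₀ m s ω|} ≤ θ := by
    intro n m hNn hnm
    set R := eulerDiff δ z₀ hnm with hR
    have hMR : ∀ s ω, eulerM δ z₀ n s ω - eulerM δ z₀ m s ω = R.integral Literature.Probability.Process.brownian s ω := by
      intro s ω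
      rw [← eulerZ_sub_eulerZ_eq_eulerM, eulerZ_sub_eulerZ δ z₀ hnm]
    have hset : {ω | ∃ s ≤ t, e ≤ |eulerM δ z₀ n s ω - eulerM δ z₀ m s ω|} =
        {ω | ∃ s ≤ t, e ≤ |R.integral Literature.Probability.Process.brownian s ω|} := by
      ext ω; simp only [Set.mem_setOf_eq, hMR]
    rw [hset]
    have hdoob := Literature.Probability.Process.doob_sq_maximal_ineq_of_continuous (μ := Literature.Probability.Process.preWienerMeasure)
      (Literature.Probability.Process.martingale_integral_brownian R) (fun s ↦ Literature.Probability.Process.memLp_two_integral_brownian R s)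
      (ae_of_all _ fun ω ↦ R.continuous_integral (Literature.Probability.Process.continuous_brownian ω)) he t
    refine hdoob.trans ?_
    have hL2 : ∫ ω, R.integral Literature.Probability.Process.brownian t ω ^ 2 ∂Literature.Probability.Process.preWienerMeasure ≤ θ.toReal * e ^ 2 := by
      have := hN n m hNn hnm t le_rfl
      simp_rw [eulerZ_sub_eulerZ δ z₀ hnm] at this
      exact this
    calc ENNReal.ofReal ((∫ ω, R.integral Literature.Probability.Process.brownian t ω ^ 2 ∂Literature.Probability.Process.preWienerMeasure) / e ^ 2)
        ≤ ENNReal.ofReal (θ.toReal * e ^ 2 / e ^ 2) :=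
          ENNReal.ofReal_le_ofReal (div_le_div_of_nonneg_right hL2 (by positivity))
      _ = θ := by rw [mul_div_assoc, div_self (by positivity), mul_one, ENNReal.ofReal_toReal hθtop]
  refine ⟨N, fun n hn n' hn' ↦ ?_⟩
  rcases le_total n n' with h | h
  · exact hord n n' hn h
  · have hset : {ω | ∃ s ≤ t, e ≤ |eulerM δ z₀ n s ω - eulerM δ z₀ n' s ω|} =
        {ω | ∃ s ≤ t, e ≤ |eulerM δ z₀ n' s ω - eulerM δ z₀ n s ω|} := by
      ext ω; simp only [Set.mem_setOf_eq, abs_sub_comm]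
    rw [hset]
    exact hord n' n hn' h

end Convergence

/-! ## Part 3 — the limit; existence and well-posedness -/

section Existence

variable (δ z₀ : ℝ)

/-! ### The u.c.p. limit of the martingale parts, progressive version -/

/-- **The limit of the martingale parts of the Euler scheme**: a strongly adapted, jointly
measurable process `J` with a.s. continuous paths, `J 0 = 0`, such that `Mⁿ = eulerSP n · B → J`
u.c.p. and, almost surely, locally uniformly along a subsequence.
Revuz–Yor, *Continuous Martingales and Brownian Motion* (1999), Ch. IV, Thm (2.12) and proof of
Thm (1.8) (u.c.p. completeness); the progressive version is `Literature.Analysis.FunctionSpaces.dyadicReg`. [folklore] -/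
theorem exists_limit_eulerM :
    ∃ J : ℝ≥0 → (ℝ≥0 → ℝ) → ℝ, StronglyAdapted Literature.Probability.RandomPlanarGeometry.brownianFiltration J ∧
      (∀ᵐ ω ∂Literature.Probability.Process.preWienerMeasure, Continuous (J · ω)) ∧ (∀ ω, J 0 ω = 0) ∧
      Literature.Probability.Process.TendstoUCP (fun n ↦ eulerM δ z₀ n) J Literature.Probability.Process.preWienerMeasure ∧
      Measurable (Function.uncurry J) ∧
      ∃ φ : ℕ → ℕ, StrictMono φ ∧ ∀ᵐ ω ∂Literature.Probability.Process.preWienerMeasure, ∀ t : ℝ≥0,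
        TendstoUniformlyOn (fun k s ↦ eulerM δ z₀ (φ k) s ω) (J · ω) atTop (Set.Iic t) := by
  haveI := Literature.Probability.RandomPlanarGeometry.isProbabilityMeasure_preWienerMeasure'
  obtain ⟨J₀, hJ₀a, hJ₀c, hJ₀0, hJ₀ucp, φ, hφ, hJ₀φ⟩ := Literature.Probability.Process.exists_tendstoUCP_of_cauchy
    (Y := fun n ↦ eulerM δ z₀ n) (𝓕 := Literature.Probability.RandomPlanarGeometry.brownianFiltration) (P := Literature.Probability.Process.preWienerMeasure)
    (fun n ↦ (Literature.Probability.Process.martingale_integral_brownian _).stronglyAdapted)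
    (fun n ω ↦ (eulerSP δ z₀ n).continuous_integral (Literature.Probability.Process.continuous_brownian ω))
    (cauchy_ucp_eulerM δ z₀)
  have hJ₀ad : Adapted Literature.Probability.RandomPlanarGeometry.brownianFiltration J₀ := fun t ↦ (hJ₀a t).measurable
  set J := dyadicReg J₀ with hJ
  have hJJ₀ : ∀ᵐ ω ∂Literature.Probability.Process.preWienerMeasure, ∀ t, J t ω = J₀ t ω := by
    filter_upwards [hJ₀c] with ω hω t
    exact dyadicReg_apply_of_continuous hω t
  refine ⟨J, (isStronglyProgressive_dyadicReg hJ₀ad).stronglyAdapted, ?_, fun ω ↦ ?_,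
    hJ₀ucp.congr_right hJJ₀,
    IsStronglyProgressive.measurable_uncurry (isStronglyProgressive_dyadicReg hJ₀ad), φ, hφ, ?_⟩
  · filter_upwards [hJ₀c, hJJ₀] with ω hω hωJ
    have : (J · ω) = (J₀ · ω) := funext hωJ
    rw [this]; exact hω
  · rw [hJ, dyadicReg_apply_zero]
    exact hJ₀0 ω fun n ↦ Literature.Probability.Process.SimpleProcess.integral_zero _ _ ω
  · filter_upwards [hJ₀φ, hJJ₀] with ω hω hωJ t
    have : (J · ω) = (J₀ · ω) := funext hωJ
    rw [this]; exact hω t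

/-! ### `L²` convergence at fixed times and the martingale property of the limit -/

variable {δ z₀}

/-- **`Mⁿ_t → J_t` in `L²`, uniformly in `t ≤ T`** (Fatou along the a.s. convergent subsequence
and the `L²` Cauchy estimate): for every `T` and `κ > 0` there is `N` with
`∫⁻ (Mⁿ_t - J_t)² ≤ κ` for `n ≥ N`, `t ≤ T`.
Revuz–Yor, *Continuous Martingales and Brownian Motion* (1999), Ch. IV, Thm (2.2). [folklore] -/
theorem exists_forall_lintegral_eulerM_sub_sq_le {J : ℝ≥0 → (ℝ≥0 → ℝ) → ℝ}
    {φ : ℕ → ℕ} (hφ : StrictMono φ)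
    (hJφ : ∀ᵐ ω ∂Literature.Probability.Process.preWienerMeasure, ∀ t : ℝ≥0,
      TendstoUniformlyOn (fun k s ↦ eulerM δ z₀ (φ k) s ω) (J · ω) atTop (Set.Iic t))
    (T : ℝ≥0) {κ : ℝ} (hκ : 0 < κ) :
    ∃ N, ∀ n ≥ N, ∀ t ≤ T, ∫⁻ ω, ENNReal.ofReal ((eulerM δ z₀ n t ω - J t ω) ^ 2) ∂Literature.Probability.Process.preWienerMeasure ≤
      ENNReal.ofReal κ := by
  haveI := Literature.Probability.RandomPlanarGeometry.isProbabilityMeasure_preWienerMeasure'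
  obtain ⟨N, hN⟩ := exists_forall_integral_eulerZ_sub_sq_le δ z₀ T hκ
  refine ⟨N, fun n hn t ht ↦ ?_⟩
  have hYL2 : ∀ n t, MemLp (eulerM δ z₀ n t) 2 Literature.Probability.Process.preWienerMeasure := fun n t ↦
    Literature.Probability.Process.memLp_two_integral_brownian _ t
  have hpt : ∀ᵐ ω ∂Literature.Probability.Process.preWienerMeasure, Tendsto (fun k ↦ eulerM δ z₀ (φ k) t ω) atTop (𝓝 (J t ω)) := by
    filter_upwards [hJφ] with ω hω
    exact (hω t).tendsto_at (Set.mem_Iic.2 le_rfl)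
  have hlim : ∀ᵐ ω ∂Literature.Probability.Process.preWienerMeasure,
      liminf (fun k ↦ ENNReal.ofReal ((eulerM δ z₀ n t ω - eulerM δ z₀ (φ k) t ω) ^ 2)) atTop =
        ENNReal.ofReal ((eulerM δ z₀ n t ω - J t ω) ^ 2) := by
    filter_upwards [hpt] with ω hω
    refine Tendsto.liminf_eq ?_
    exact (ENNReal.continuous_ofReal.tendsto _).comp
      (((continuous_const.sub continuous_id).pow 2).tendsto _ |>.comp hω)
  calc ∫⁻ ω, ENNReal.ofReal ((eulerM δ z₀ n t ω - J t ω) ^ 2) ∂Literature.Probability.Process.preWienerMeasure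
      = ∫⁻ ω, liminf (fun k ↦ ENNReal.ofReal ((eulerM δ z₀ n t ω - eulerM δ z₀ (φ k) t ω) ^ 2)) atTop
          ∂Literature.Probability.Process.preWienerMeasure := lintegral_congr_ae (hlim.mono fun ω hω ↦ hω.symm)
    _ ≤ liminf (fun k ↦ ∫⁻ ω, ENNReal.ofReal ((eulerM δ z₀ n t ω - eulerM δ z₀ (φ k) t ω) ^ 2)
          ∂Literature.Probability.Process.preWienerMeasure) atTop :=
        lintegral_liminf_le' fun k ↦ (AEMeasurable.pow_const
          (f := fun ω ↦ eulerM δ z₀ n t ω - eulerM δ z₀ (φ k) t ω)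
          ((hYL2 n t).1.aemeasurable.sub (hYL2 (φ k) t).1.aemeasurable) 2).ennreal_ofReal
    _ ≤ ENNReal.ofReal κ := by
        refine liminf_le_of_frequently_le' (Eventually.frequently ?_)
        refine eventually_atTop.2 ⟨n, fun k hk ↦ ?_⟩
        have hnk : n ≤ φ k := hk.trans (hφ.id_le k)
        have hint : Integrable (fun ω ↦ (eulerM δ z₀ n t ω - eulerM δ z₀ (φ k) t ω) ^ 2)
            Literature.Probability.Process.preWienerMeasure := ((hYL2 n t).sub (hYL2 (φ k) t)).integrable_sq
        rw [← ofReal_integral_eq_lintegral_ofReal hint (ae_of_all _ fun ω ↦ sq_nonneg _)]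
        refine ENNReal.ofReal_le_ofReal ?_
        have := hN n (φ k) hn hnk t ht
        simp_rw [eulerZ_sub_eulerZ_eq_eulerM] at this
        exact this

/-- **The limit is a square-integrable martingale** for the raw Brownian filtration:
`J_t ∈ L²`, `∫⁻ |Mⁿ_t - J_t| → 0`, and the martingale property of the elementary integrals `Mⁿ`
passes to the limit in the set integrals.
Revuz–Yor, *Continuous Martingales and Brownian Motion* (1999), Ch. IV, Thm (2.2) (`K·M ∈ H²₀`
extends to the closure). [folklore] -/
theorem martingale_limit_eulerM {J : ℝ≥0 → (ℝ≥0 → ℝ) → ℝ}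
    (hJa : StronglyAdapted Literature.Probability.RandomPlanarGeometry.brownianFiltration J) {φ : ℕ → ℕ} (hφ : StrictMono φ)
    (hJφ : ∀ᵐ ω ∂Literature.Probability.Process.preWienerMeasure, ∀ t : ℝ≥0,
      TendstoUniformlyOn (fun k s ↦ eulerM δ z₀ (φ k) s ω) (J · ω) atTop (Set.Iic t)) :
    (∀ t, MemLp (J t) 2 Literature.Probability.Process.preWienerMeasure) ∧
      (∀ t, Tendsto (fun n ↦ ∫⁻ ω, ‖eulerM δ z₀ n t ω - J t ω‖ₑ ∂Literature.Probability.Process.preWienerMeasure) atTop (𝓝 0)) ∧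
      Martingale J Literature.Probability.RandomPlanarGeometry.brownianFiltration Literature.Probability.Process.preWienerMeasure := by
  haveI := Literature.Probability.RandomPlanarGeometry.isProbabilityMeasure_preWienerMeasure'
  set Y := fun n ↦ eulerM δ z₀ n with hY
  have hYL2 : ∀ n t, MemLp (Y n t) 2 Literature.Probability.Process.preWienerMeasure := fun n t ↦ Literature.Probability.Process.memLp_two_integral_brownian _ t
  have hfatou : ∀ (t : ℝ≥0) (e : ℝ), 0 < e → ∃ N, ∀ n ≥ N,
      ∫⁻ ω, ENNReal.ofReal ((Y n t ω - J t ω) ^ 2) ∂Literature.Probability.Process.preWienerMeasure ≤ ENNReal.ofReal e := by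
    intro t e he
    obtain ⟨N, hN⟩ := exists_forall_lintegral_eulerM_sub_sq_le hφ hJφ t he
    exact ⟨N, fun n hn ↦ hN n hn t le_rfl⟩
  have hJm : ∀ t, AEStronglyMeasurable (J t) Literature.Probability.Process.preWienerMeasure := fun t ↦
    ((hJa t).mono (Literature.Probability.RandomPlanarGeometry.brownianFiltration.le t)).aestronglyMeasurable
  have hDm : ∀ n t, AEMeasurable (fun ω ↦ Y n t ω - J t ω) Literature.Probability.Process.preWienerMeasure := fun n t ↦
    (hYL2 n t).1.aemeasurable.sub (hJm t).aemeasurable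
  have hDsm : ∀ n t, AEStronglyMeasurable (fun ω ↦ Y n t ω - J t ω) Literature.Probability.Process.preWienerMeasure := fun n t ↦
    (hYL2 n t).1.sub (hJm t)
  have hDL2 : ∀ t, ∃ N, ∀ n ≥ N, MemLp (fun ω ↦ Y n t ω - J t ω) 2 Literature.Probability.Process.preWienerMeasure := by
    intro t
    obtain ⟨N, hN⟩ := hfatou t 1 one_pos
    refine ⟨N, fun n hn ↦ ?_⟩
    rw [memLp_two_iff_integrable_sq (hDsm n t)]
    refine ⟨((hDm n t).pow_const 2).aestronglyMeasurable, ?_⟩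
    rw [hasFiniteIntegral_iff_ofReal (ae_of_all _ fun ω ↦ sq_nonneg _)]
    exact (hN n hn).trans_lt ENNReal.ofReal_lt_top
  have hJL2 : ∀ t, MemLp (J t) 2 Literature.Probability.Process.preWienerMeasure := by
    intro t
    obtain ⟨N, hN⟩ := hDL2 t
    have h := (hYL2 N t).sub (hN N le_rfl)
    have heq : (Y N t - fun ω ↦ Y N t ω - J t ω) = J t := by ext ω; simp
    rwa [heq] at h
  have hL1 : ∀ t, Tendsto (fun n ↦ ∫⁻ ω, ‖Y n t ω - J t ω‖ₑ ∂Literature.Probability.Process.preWienerMeasure) atTop (𝓝 0) := by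
    intro t
    rw [ENNReal.tendsto_nhds_zero]
    intro ε' hε'
    obtain ⟨e, he, heε⟩ := Literature.Probability.Process.exists_pos_ofReal_sqrt_le hε'
    obtain ⟨N, hN⟩ := hfatou t e he
    refine eventually_atTop.2 ⟨N, fun n hn ↦ ?_⟩
    have ha : 0 < Real.sqrt e := Real.sqrt_pos.2 he
    calc ∫⁻ ω, ‖Y n t ω - J t ω‖ₑ ∂Literature.Probability.Process.preWienerMeasure
        = ∫⁻ ω, ENNReal.ofReal |Y n t ω - J t ω| ∂Literature.Probability.Process.preWienerMeasure := by
          simp_rw [Real.enorm_eq_ofReal_abs]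
      _ ≤ ∫⁻ ω, (ENNReal.ofReal (Real.sqrt e / 2) + ENNReal.ofReal (1 / (2 * Real.sqrt e)) *
            ENNReal.ofReal ((Y n t ω - J t ω) ^ 2)) ∂Literature.Probability.Process.preWienerMeasure :=
          lintegral_mono fun ω ↦ Literature.Probability.Process.ofReal_abs_le_add_sq ha _
      _ = ENNReal.ofReal (Real.sqrt e / 2) + ENNReal.ofReal (1 / (2 * Real.sqrt e)) *
            ∫⁻ ω, ENNReal.ofReal ((Y n t ω - J t ω) ^ 2) ∂Literature.Probability.Process.preWienerMeasure := by
          rw [lintegral_add_left measurable_const, lintegral_const, measure_univ, mul_one,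
            lintegral_const_mul'' _ ((hDm n t).pow_const 2).ennreal_ofReal]
      _ ≤ ENNReal.ofReal (Real.sqrt e / 2) + ENNReal.ofReal (1 / (2 * Real.sqrt e)) *
            ENNReal.ofReal e := by gcongr; exact hN n hn
      _ = ENNReal.ofReal (Real.sqrt e) := by
          rw [← ENNReal.ofReal_mul (by positivity), ← ENNReal.ofReal_add (by positivity)
            (by positivity)]
          congr 1
          have hs : Real.sqrt e * Real.sqrt e = e := Real.mul_self_sqrt he.le
          have : 1 / (2 * Real.sqrt e) * e = Real.sqrt e / 2 := by
            calc 1 / (2 * Real.sqrt e) * e = (Real.sqrt e * Real.sqrt e) / (2 * Real.sqrt e) := by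
                  rw [hs]; ring
              _ = Real.sqrt e / 2 := by rw [mul_div_mul_right _ _ ha.ne']
          rw [this]; ring
      _ ≤ ε' := heε
  have hJint : ∀ t, Integrable (J t) Literature.Probability.Process.preWienerMeasure := fun t ↦ (hJL2 t).integrable one_le_two
  have hmart : Martingale J Literature.Probability.RandomPlanarGeometry.brownianFiltration Literature.Probability.Process.preWienerMeasure := by
    refine ⟨hJa, fun s t hst ↦ ?_⟩
    refine (ae_eq_condExp_of_forall_setIntegral_eq (Literature.Probability.RandomPlanarGeometry.brownianFiltration.le s) (hJint t)
      (fun A _ _ ↦ (hJint s).integrableOn) (fun A hA _ ↦ ?_) (hJa s).aestronglyMeasurable).symm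
    have h1 : Tendsto (fun n ↦ ∫ ω in A, Y n t ω ∂Literature.Probability.Process.preWienerMeasure) atTop
        (𝓝 (∫ ω in A, J t ω ∂Literature.Probability.Process.preWienerMeasure)) :=
      tendsto_setIntegral_of_L1 (J t) (hJm t)
        (Eventually.of_forall fun n ↦ (hYL2 n t).integrable one_le_two) (hL1 t) A
    have h2 : Tendsto (fun n ↦ ∫ ω in A, Y n s ω ∂Literature.Probability.Process.preWienerMeasure) atTop
        (𝓝 (∫ ω in A, J s ω ∂Literature.Probability.Process.preWienerMeasure)) :=
      tendsto_setIntegral_of_L1 (J s) (hJm s)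
        (Eventually.of_forall fun n ↦ (hYL2 n s).integrable one_le_two) (hL1 s) A
    have h3 : ∀ n, ∫ ω in A, Y n s ω ∂Literature.Probability.Process.preWienerMeasure = ∫ ω in A, Y n t ω ∂Literature.Probability.Process.preWienerMeasure :=
      fun n ↦ (Literature.Probability.Process.martingale_integral_brownian _).setIntegral_eq hst hA
    simp_rw [h3] at h2
    exact tendsto_nhds_unique h2 h1
  exact ⟨hJL2, hL1, hmart⟩

/-! ### The candidate solution and the approximation property of the Euler integrands -/

variable (δ z₀)

/-- **The candidate solution** `Z_t = z₀ + ∫₀ᵗ δ ds + J_t` built on a limit `J` of the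
martingale parts of the Euler scheme (written with the interval integral of the constant drift,
exactly as in `IsItoProcess`). [folklore] -/
def eulerLimitZ (J : ℝ≥0 → (ℝ≥0 → ℝ) → ℝ) : ℝ≥0 → (ℝ≥0 → ℝ) → ℝ := fun t ω ↦
  z₀ + (∫ _ in (0 : ℝ)..t, δ) + J t ω

/-- `Z_t = z₀ + δ t + J_t`. [folklore] -/
theorem eulerLimitZ_eq (J : ℝ≥0 → (ℝ≥0 → ℝ) → ℝ) (t : ℝ≥0) (ω : ℝ≥0 → ℝ) :
    eulerLimitZ δ z₀ J t ω = z₀ + δ * (t : ℝ) + J t ω := by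
  simp only [eulerLimitZ, intervalIntegral.integral_const, sub_zero, smul_eq_mul]
  ring

/-- `Zⁿ_t - Z_t = Mⁿ_t - J_t`. [folklore] -/
theorem eulerZ_sub_eulerLimitZ (J : ℝ≥0 → (ℝ≥0 → ℝ) → ℝ) (n : ℕ) (t : ℝ≥0) (ω : ℝ≥0 → ℝ) :
    eulerZ δ z₀ n t ω - eulerLimitZ δ z₀ J t ω = eulerM δ z₀ n t ω - J t ω := by
  rw [eulerLimitZ_eq, eulerZ, eulerM]
  ring

/-- `Z` is jointly measurable when `J` is. [folklore] -/
theorem measurable_uncurry_eulerLimitZ {J : ℝ≥0 → (ℝ≥0 → ℝ) → ℝ}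
    (hJm : Measurable (Function.uncurry J)) :
    Measurable (Function.uncurry (eulerLimitZ δ z₀ J)) := by
  have : Function.uncurry (eulerLimitZ δ z₀ J) =
      fun p : ℝ≥0 × (ℝ≥0 → ℝ) ↦ z₀ + δ * ((p.1 : ℝ≥0) : ℝ) + Function.uncurry J p := by
    funext p
    exact eulerLimitZ_eq δ z₀ J p.1 p.2
  rw [this]
  exact (measurable_const.add (measurable_const.mul (measurable_coe_nnreal_real.comp
    measurable_fst))).add hJm

/-- **One-time `L¹`-type bound of the sampling error of the Euler integrand against `σ(Z)`**:
for `0 < s ≤ t ≤ n`, `1 ≤ n`, with `Z = eulerLimitZ J`,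
`∫⁻ (σₙ(Zⁿ(⌊s⌋ₙ)) - σ(Z_s))² ≤ ofReal(32 M/n² + 8 √(2⁻ⁿ (δ² + 4M))) + 8 ∫⁻ |Mⁿ_s - J_s|`
(`M = M(t)`). [folklore] -/
theorem lintegral_sq_toProcess_eulerSP_sub_le {J : ℝ≥0 → (ℝ≥0 → ℝ) → ℝ}
    (hJm : ∀ t, Measurable (J t)) {n : ℕ} (hn : 1 ≤ n) {t s : ℝ≥0} (hs0 : 0 < s) (hst : s ≤ t)
    (htn : (t : ℝ) ≤ n) :
    ∫⁻ ω, ENNReal.ofReal (((eulerSP δ z₀ n).toProcess s ω -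
        besqσ (eulerLimitZ δ z₀ J s ω)) ^ 2) ∂Literature.Probability.Process.preWienerMeasure ≤
      ENNReal.ofReal (32 * eulerMom δ z₀ t / n ^ 2 +
        8 * Real.sqrt ((1 / 2 ^ n) * (δ ^ 2 + 4 * eulerMom δ z₀ t))) +
      8 * ∫⁻ ω, ENNReal.ofReal |eulerM δ z₀ n s ω - J s ω| ∂Literature.Probability.Process.preWienerMeasure := by
  haveI := Literature.Probability.RandomPlanarGeometry.isProbabilityMeasure_preWienerMeasure'
  have hsn : s ≤ n := by
    have : (s : ℝ) ≤ n := (NNReal.coe_le_coe.2 hst).trans htn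
    exact_mod_cast this
  -- the coarse grid point `a = k/2ⁿ` of `s`
  set k : ℕ := ⌈(s : ℝ) * 2 ^ n⌉₊ - 1 with hk
  have hklt : k < n * 2 ^ n := Literature.Probability.Process.SimpleProcess.ceil_sub_one_lt hs0 hsn
  have hak : Literature.Probability.Process.sampleLeft n s = ((k : ℕ) : ℝ≥0) / 2 ^ n := rfl
  obtain ⟨ha1, ha2⟩ := le_sampleLeft_add (n := n) hs0
  rw [hak] at ha1 ha2
  have hb : s ≤ ((k + 1 : ℕ) : ℝ≥0) / 2 ^ n := by
    refine ha2.trans (le_of_eq ?_)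
    rw [Nat.cast_add, Nat.cast_one, add_div]
  have hkT : (k : ℝ) / 2 ^ n ≤ t := by
    have := NNReal.coe_le_coe.2 (ha1.trans hst)
    push_cast at this
    exact this
  -- the step value and the decomposition
  have hstep : ∀ ω, (eulerSP δ z₀ n).toProcess s ω = besqσTrunc n (eulerPt δ z₀ n k ω) := fun ω ↦ by
    rw [toProcess_eulerSP δ z₀ n hs0 hsn ω, hak, eulerZ_grid δ z₀ n hklt.le ω]
  have hpt : ∀ ω, ((eulerSP δ z₀ n).toProcess s ω - besqσ (eulerLimitZ δ z₀ J s ω)) ^ 2 ≤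
      2 * (besqσ (eulerPt δ z₀ n k ω) - besqσTrunc n (eulerPt δ z₀ n k ω)) ^ 2 +
        8 * |eulerZ δ z₀ n s ω - eulerZ δ z₀ n (((k : ℕ) : ℝ≥0) / 2 ^ n) ω| +
        8 * |eulerM δ z₀ n s ω - J s ω| := by
    intro ω
    rw [hstep ω]
    set p := eulerPt δ z₀ n k ω with hp
    have hpa : eulerZ δ z₀ n (((k : ℕ) : ℝ≥0) / 2 ^ n) ω = p := eulerZ_grid δ z₀ n hklt.le ω
    have h1 : (besqσTrunc n p - besqσ (eulerLimitZ δ z₀ J s ω)) ^ 2 ≤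
        2 * ((besqσTrunc n p - besqσ p) ^ 2 + (besqσ p - besqσ (eulerLimitZ δ z₀ J s ω)) ^ 2) := by
      have := sq_sub_le_two_mul (besqσTrunc n p - besqσ p) (besqσ (eulerLimitZ δ z₀ J s ω) - besqσ p)
      calc (besqσTrunc n p - besqσ (eulerLimitZ δ z₀ J s ω)) ^ 2
          = ((besqσTrunc n p - besqσ p) - (besqσ (eulerLimitZ δ z₀ J s ω) - besqσ p)) ^ 2 := by ring
        _ ≤ _ := this
        _ = _ := by ring
    have h2 : (besqσ p - besqσ (eulerLimitZ δ z₀ J s ω)) ^ 2 ≤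
        4 * |eulerZ δ z₀ n s ω - eulerZ δ z₀ n (((k : ℕ) : ℝ≥0) / 2 ^ n) ω| +
          4 * |eulerM δ z₀ n s ω - J s ω| := by
      have h := sq_besqσ_sub_le p (eulerLimitZ δ z₀ J s ω)
      have htri : |p - eulerLimitZ δ z₀ J s ω| ≤
          |eulerZ δ z₀ n s ω - eulerZ δ z₀ n (((k : ℕ) : ℝ≥0) / 2 ^ n) ω| +
            |eulerM δ z₀ n s ω - J s ω| := by
        rw [← hpa, ← eulerZ_sub_eulerLimitZ δ z₀ J n s ω]
        have := abs_sub_le (eulerZ δ z₀ n (((k : ℕ) : ℝ≥0) / 2 ^ n) ω) (eulerZ δ z₀ n s ω)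
          (eulerLimitZ δ z₀ J s ω)
        rw [abs_sub_comm (eulerZ δ z₀ n (((k : ℕ) : ℝ≥0) / 2 ^ n) ω) (eulerZ δ z₀ n s ω)] at this
        exact this
      linarith
    have h3 : (besqσTrunc n p - besqσ p) ^ 2 = (besqσ p - besqσTrunc n p) ^ 2 := by ring
    linarith
  -- the three expectations
  have e1 := integral_sq_besqσ_sub_besqσTrunc_le δ z₀ n hn hkT
  obtain ⟨hmem, hincr⟩ := integral_eulerZ_sub_sq_le δ z₀ n hklt ha1 hb hkT
  have e2 : ∫ ω, |eulerZ δ z₀ n s ω - eulerZ δ z₀ n (((k : ℕ) : ℝ≥0) / 2 ^ n) ω| ∂Literature.Probability.Process.preWienerMeasure ≤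
      Real.sqrt ((1 / 2 ^ n) * (δ ^ 2 + 4 * eulerMom δ z₀ t)) :=
    (integral_abs_le_sqrt_integral_sq hmem).trans (Real.sqrt_le_sqrt hincr)
  have hi1 := integrable_sq_besqσ_sub_besqσTrunc δ z₀ n n k
  have hi2 : Integrable (fun ω ↦ |eulerZ δ z₀ n s ω - eulerZ δ z₀ n (((k : ℕ) : ℝ≥0) / 2 ^ n) ω|)
      Literature.Probability.Process.preWienerMeasure := (hmem.integrable one_le_two).abs
  -- pass to `lintegral`s
  have hmD : Measurable fun ω ↦ eulerM δ z₀ n s ω - J s ω :=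
    (((Literature.Probability.Process.martingale_integral_brownian _).stronglyAdapted s).measurable.mono (Literature.Probability.RandomPlanarGeometry.brownianFiltration.le s)
      le_rfl).sub (hJm s)
  calc ∫⁻ ω, ENNReal.ofReal (((eulerSP δ z₀ n).toProcess s ω - besqσ (eulerLimitZ δ z₀ J s ω)) ^ 2)
        ∂Literature.Probability.Process.preWienerMeasure
      ≤ ∫⁻ ω, (ENNReal.ofReal (2 * (besqσ (eulerPt δ z₀ n k ω) - besqσTrunc n (eulerPt δ z₀ n k ω)) ^ 2 +
          8 * |eulerZ δ z₀ n s ω - eulerZ δ z₀ n (((k : ℕ) : ℝ≥0) / 2 ^ n) ω|) +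
          8 * ENNReal.ofReal |eulerM δ z₀ n s ω - J s ω|) ∂Literature.Probability.Process.preWienerMeasure := by
        refine lintegral_mono fun ω ↦ ?_
        refine (ENNReal.ofReal_le_ofReal (hpt ω)).trans ?_
        rw [ENNReal.ofReal_add (by positivity) (by positivity),
          ENNReal.ofReal_mul (by norm_num : (0:ℝ) ≤ 8), ENNReal.ofReal_ofNat]
    _ = ∫⁻ ω, ENNReal.ofReal (2 * (besqσ (eulerPt δ z₀ n k ω) - besqσTrunc n (eulerPt δ z₀ n k ω)) ^ 2 +
          8 * |eulerZ δ z₀ n s ω - eulerZ δ z₀ n (((k : ℕ) : ℝ≥0) / 2 ^ n) ω|) ∂Literature.Probability.Process.preWienerMeasure +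
        8 * ∫⁻ ω, ENNReal.ofReal |eulerM δ z₀ n s ω - J s ω| ∂Literature.Probability.Process.preWienerMeasure := by
        rw [lintegral_add_right _ ((hmD.abs.ennreal_ofReal).const_mul _),
          lintegral_const_mul _ hmD.abs.ennreal_ofReal]
    _ ≤ _ := by
        gcongr
        have hint : Integrable (fun ω ↦ 2 * (besqσ (eulerPt δ z₀ n k ω) -
            besqσTrunc n (eulerPt δ z₀ n k ω)) ^ 2 +
            8 * |eulerZ δ z₀ n s ω - eulerZ δ z₀ n (((k : ℕ) : ℝ≥0) / 2 ^ n) ω|) Literature.Probability.Process.preWienerMeasure :=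
          (hi1.const_mul 2).add (hi2.const_mul 8)
        rw [← ofReal_integral_eq_lintegral_ofReal hint (ae_of_all _ fun ω ↦ by positivity)]
        refine ENNReal.ofReal_le_ofReal ?_
        rw [integral_add (hi1.const_mul 2) (hi2.const_mul 8), integral_const_mul, integral_const_mul]
        have e1' : 2 * (∫ ω, (besqσ (eulerPt δ z₀ n k ω) - besqσTrunc n (eulerPt δ z₀ n k ω)) ^ 2
            ∂Literature.Probability.Process.preWienerMeasure) ≤ 32 * eulerMom δ z₀ t / n ^ 2 :=
          calc _ ≤ 2 * (16 * eulerMom δ z₀ t / n ^ 2) := by gcongr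
            _ = _ := by ring
        linarith

/-- **`∫⁻ |Mⁿ_s - J_s| ≤ √κ` from `∫⁻ (Mⁿ_s - J_s)² ≤ κ`** (Cauchy–Schwarz in the elementary form
`|x| ≤ a/2 + x²/(2a)`, `a = √κ`). [folklore] -/
theorem lintegral_abs_le_sqrt_of_lintegral_sq_le {f : (ℝ≥0 → ℝ) → ℝ} (hf : Measurable f) {κ : ℝ}
    (hκ : 0 < κ) (h : ∫⁻ ω, ENNReal.ofReal (f ω ^ 2) ∂Literature.Probability.Process.preWienerMeasure ≤ ENNReal.ofReal κ) :
    ∫⁻ ω, ENNReal.ofReal |f ω| ∂Literature.Probability.Process.preWienerMeasure ≤ ENNReal.ofReal (Real.sqrt κ) := by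
  haveI := Literature.Probability.RandomPlanarGeometry.isProbabilityMeasure_preWienerMeasure'
  have ha : 0 < Real.sqrt κ := Real.sqrt_pos.2 hκ
  calc ∫⁻ ω, ENNReal.ofReal |f ω| ∂Literature.Probability.Process.preWienerMeasure
      ≤ ∫⁻ ω, (ENNReal.ofReal (Real.sqrt κ / 2) + ENNReal.ofReal (1 / (2 * Real.sqrt κ)) *
          ENNReal.ofReal (f ω ^ 2)) ∂Literature.Probability.Process.preWienerMeasure :=
        lintegral_mono fun ω ↦ Literature.Probability.Process.ofReal_abs_le_add_sq ha _
    _ = ENNReal.ofReal (Real.sqrt κ / 2) + ENNReal.ofReal (1 / (2 * Real.sqrt κ)) *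
          ∫⁻ ω, ENNReal.ofReal (f ω ^ 2) ∂Literature.Probability.Process.preWienerMeasure := by
        rw [lintegral_add_left measurable_const, lintegral_const, measure_univ, mul_one,
          lintegral_const_mul _ (hf.pow_const 2).ennreal_ofReal]
    _ ≤ ENNReal.ofReal (Real.sqrt κ / 2) + ENNReal.ofReal (1 / (2 * Real.sqrt κ)) *
          ENNReal.ofReal κ := by gcongr
    _ = ENNReal.ofReal (Real.sqrt κ) := by
        rw [← ENNReal.ofReal_mul (by positivity), ← ENNReal.ofReal_add (by positivity)
          (by positivity)]
        congr 1
        have hs : Real.sqrt κ * Real.sqrt κ = κ := Real.mul_self_sqrt hκ.le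
        have : 1 / (2 * Real.sqrt κ) * κ = Real.sqrt κ / 2 := by
          calc 1 / (2 * Real.sqrt κ) * κ = (Real.sqrt κ * Real.sqrt κ) / (2 * Real.sqrt κ) := by
                rw [hs]; ring
            _ = Real.sqrt κ / 2 := by rw [mul_div_mul_right _ _ ha.ne']
        rw [this]; ring

/-- **The Euler integrands approximate `σ(Z)`** (`SimpleProcess.IsApproxSeq`): for the
candidate solution `Z = eulerLimitZ J` built on a jointly measurable `J` with
`∫⁻ (Mⁿ_s - J_s)² → 0` uniformly on compacts, the step processes `σₙ(Zⁿ(⌊s⌋ₙ))` converge to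
`σ(Z_s)` in `L²_loc(ds)` in probability (in fact in `L²(ds ⊗ P)`: Tonelli and Markov).
Revuz–Yor, *Continuous Martingales and Brownian Motion* (1999), Ch. IV, Prop. (2.13) and
Def. (2.9). [folklore] -/
theorem isApproxSeq_eulerSP {J : ℝ≥0 → (ℝ≥0 → ℝ) → ℝ} (hJm : Measurable (Function.uncurry J))
    (hL2 : ∀ (T : ℝ≥0) (κ : ℝ), 0 < κ → ∃ N, ∀ n ≥ N, ∀ t ≤ T,
      ∫⁻ ω, ENNReal.ofReal ((eulerM δ z₀ n t ω - J t ω) ^ 2) ∂Literature.Probability.Process.preWienerMeasure ≤ ENNReal.ofReal κ) :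
    Literature.Probability.Process.SimpleProcess.IsApproxSeq (fun n ↦ eulerSP δ z₀ n)
      (fun t ω ↦ besqσ (eulerLimitZ δ z₀ J t ω)) Literature.Probability.Process.preWienerMeasure := by
  haveI := Literature.Probability.RandomPlanarGeometry.isProbabilityMeasure_preWienerMeasure'
  have hJt : ∀ t, Measurable (J t) := fun t ↦ hJm.comp (measurable_const.prodMk measurable_id)
  have hZm : Measurable (Function.uncurry (eulerLimitZ δ z₀ J)) := measurable_uncurry_eulerLimitZ δ z₀ hJm
  intro t ε hε
  -- the integrand on `Ω × ℝ` and its measurability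
  set G : ℕ → (ℝ≥0 → ℝ) × ℝ → ℝ≥0∞ := fun n p ↦ ENNReal.ofReal
    (((eulerSP δ z₀ n).toProcess p.2.toNNReal p.1 - besqσ (eulerLimitZ δ z₀ J p.2.toNNReal p.1)) ^ 2)
    with hG
  have hGm : ∀ n, Measurable (G n) := fun n ↦
    (((eulerSP δ z₀ n).measurable_toProcess_prod.sub (continuous_besqσ.measurable.comp
      (hZm.comp ((measurable_real_toNNReal.comp measurable_snd).prodMk measurable_fst)))).pow_const
        2).ennreal_ofReal
  have hXm : ∀ n, Measurable fun ω ↦ ∫⁻ s in Set.Icc (0 : ℝ) t, G n (ω, s) := fun n ↦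
    (hGm n).lintegral_prod_right'
  -- reduction to a real target
  rw [ENNReal.tendsto_nhds_zero]
  intro θ hθ
  by_cases hθtop : θ = ⊤
  · exact Eventually.of_forall fun n ↦ hθtop ▸ le_top
  set r := θ.toReal with hr
  have hr0 : 0 < r := ENNReal.toReal_pos hθ.ne' hθtop
  -- parameters: `κ` with `8 √κ t ≤ r ε / 2`, then `N`
  set M := eulerMom δ z₀ t with hM
  have hM0 : 0 ≤ M := by rw [hM]; unfold eulerMom; positivity
  set C₁ := δ ^ 2 + 4 * M with hC₁
  set κ : ℝ := (r * ε / (16 * t + 1)) ^ 2 with hκ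
  have hκ0 : 0 < κ := by positivity
  have hsqκ : Real.sqrt κ = r * ε / (16 * t + 1) := by
    rw [hκ, Real.sqrt_sq (by positivity)]
  obtain ⟨N₁, hN₁⟩ := hL2 t κ hκ0
  -- the remainder `t (32 M/n² + 8 √(2⁻ⁿ C₁)) → 0`
  set ρ : ℕ → ℝ := fun n ↦ (t : ℝ) * (32 * M / n ^ 2 + 8 * Real.sqrt ((1 / 2 ^ n) * C₁)) with hρ
  have h2n : Tendsto (fun n : ℕ ↦ (1 : ℝ) / 2 ^ n) atTop (𝓝 0) :=
    tendsto_const_nhds.div_atTop (tendsto_pow_atTop_atTop_of_one_lt (one_lt_two : (1 : ℝ) < 2))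
  have hn2 : Tendsto (fun n : ℕ ↦ (32 * M : ℝ) / n ^ 2) atTop (𝓝 0) := by
    have : Tendsto (fun n : ℕ ↦ ((n : ℝ)) ^ 2) atTop atTop :=
      (tendsto_pow_atTop two_ne_zero).comp tendsto_natCast_atTop_atTop
    exact tendsto_const_nhds.div_atTop this
  have hsqrt : Tendsto (fun n : ℕ ↦ Real.sqrt ((1 / 2 ^ n) * C₁)) atTop (𝓝 0) := by
    have h := (h2n.mul_const C₁)
    rw [zero_mul] at h
    have := (Real.continuous_sqrt.tendsto 0).comp h
    rwa [Function.comp_def, Real.sqrt_zero] at this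
  have hρlim : Tendsto ρ atTop (𝓝 0) := by
    have := (hn2.add (hsqrt.const_mul 8)).const_mul (t : ℝ)
    simp only [mul_zero, add_zero] at this
    exact this
  obtain ⟨N₂, hN₂⟩ := eventually_atTop.1 (hρlim.eventually
    (gt_mem_nhds (by positivity : (0:ℝ) < r * ε / 2)))
  refine eventually_atTop.2 ⟨max N₁ (max N₂ (max 1 ⌈(t : ℝ)⌉₊)), fun n hn ↦ ?_⟩
  have hnN₁ : N₁ ≤ n := (le_max_left _ _).trans hn
  have hnN₂ : N₂ ≤ n := (le_max_left _ _).trans ((le_max_right _ _).trans hn)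
  have hn1 : 1 ≤ n := (le_max_left _ _).trans ((le_max_right _ _).trans ((le_max_right _ _).trans hn))
  have htn : (t : ℝ) ≤ n := (Nat.le_ceil _).trans (by
    have : ⌈(t : ℝ)⌉₊ ≤ n := (le_max_right _ _).trans ((le_max_right _ _).trans ((le_max_right _ _).trans hn))
    exact_mod_cast this)
  -- the uniform bound on `∫⁻_Ω G n (·, s)` for `s ∈ (0, t]`
  set c : ℝ := 32 * M / n ^ 2 + 8 * Real.sqrt ((1 / 2 ^ n) * C₁) + 8 * Real.sqrt κ with hc
  have hc0 : 0 ≤ c := by positivity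
  have hslice : ∀ s ∈ Set.Ioc (0 : ℝ) t, ∫⁻ ω, G n (ω, s) ∂Literature.Probability.Process.preWienerMeasure ≤ ENNReal.ofReal c := by
    intro s hs
    have hs0 : (0 : ℝ≥0) < s.toNNReal := Real.toNNReal_pos.2 hs.1
    have hst : s.toNNReal ≤ t := Real.toNNReal_le_iff_le_coe.2 hs.2
    have h1 := lintegral_sq_toProcess_eulerSP_sub_le δ z₀ hJt hn1 hs0 hst htn
    have hmD : Measurable fun ω ↦ eulerM δ z₀ n s.toNNReal ω - J s.toNNReal ω :=
      (((Literature.Probability.Process.martingale_integral_brownian _).stronglyAdapted _).measurable.mono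
        (Literature.Probability.RandomPlanarGeometry.brownianFiltration.le _) le_rfl).sub (hJt _)
    have h2 := lintegral_abs_le_sqrt_of_lintegral_sq_le hmD hκ0 (hN₁ n hnN₁ _ hst)
    simp only [hG]
    refine h1.trans ?_
    calc _ ≤ ENNReal.ofReal (32 * M / n ^ 2 + 8 * Real.sqrt ((1 / 2 ^ n) * C₁)) +
          8 * ENNReal.ofReal (Real.sqrt κ) := by rw [← hM, ← hC₁]; gcongr
      _ = ENNReal.ofReal c := by
          rw [hc, ← ENNReal.ofReal_ofNat 8, ← ENNReal.ofReal_mul (by norm_num),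
            ← ENNReal.ofReal_add (by positivity) (by positivity)]
  -- Tonelli and the time integral
  have hX : ∫⁻ ω, (∫⁻ s in Set.Icc (0 : ℝ) t, G n (ω, s)) ∂Literature.Probability.Process.preWienerMeasure ≤
      ENNReal.ofReal (c * t) := by
    rw [lintegral_lintegral_swap (f := fun ω s ↦ G n (ω, s)) (hGm n).aemeasurable]
    have hIcc : (volume.restrict (Set.Icc (0 : ℝ) t)) = volume.restrict (Set.Ioc (0 : ℝ) t) :=
      Measure.restrict_congr_set Ioc_ae_eq_Icc.symm
    rw [hIcc]
    calc ∫⁻ s in Set.Ioc (0 : ℝ) t, ∫⁻ ω, G n (ω, s) ∂Literature.Probability.Process.preWienerMeasure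
        ≤ ∫⁻ _ in Set.Ioc (0 : ℝ) t, ENNReal.ofReal c := setLIntegral_mono measurable_const hslice
      _ = ENNReal.ofReal c * volume (Set.Ioc (0 : ℝ) t) := setLIntegral_const _ _
      _ = ENNReal.ofReal (c * t) := by
          rw [Real.volume_Ioc, sub_zero, ← ENNReal.ofReal_mul hc0]
  -- Markov
  have hmarkov := meas_ge_le_lintegral_div (hXm n).aemeasurable
    (ENNReal.ofReal_pos.2 hε).ne' ENNReal.ofReal_ne_top (μ := Literature.Probability.Process.preWienerMeasure)
  refine hmarkov.trans ?_
  have hct : c * t ≤ r * ε := by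
    have hρn : ρ n < r * ε / 2 := hN₂ n hnN₂
    have h8 : 8 * Real.sqrt κ * (t : ℝ) ≤ r * ε / 2 := by
      rw [hsqκ]
      have hden : (0 : ℝ) < 16 * t + 1 := by positivity
      rw [show 8 * (r * ε / (16 * t + 1)) * (t : ℝ) = 8 * r * ε * t / (16 * t + 1) by ring,
        div_le_iff₀ hden]
      nlinarith [mul_pos hr0 hε, t.coe_nonneg]
    have : c * t = ρ n + 8 * Real.sqrt κ * t := by rw [hc, hρ]; ring
    linarith
  calc (∫⁻ ω, (∫⁻ s in Set.Icc (0 : ℝ) t, G n (ω, s)) ∂Literature.Probability.Process.preWienerMeasure) / ENNReal.ofReal ε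
      ≤ ENNReal.ofReal (r * ε) / ENNReal.ofReal ε := by
        gcongr
        exact hX.trans (ENNReal.ofReal_le_ofReal hct)
    _ = ENNReal.ofReal r := by
        rw [← ENNReal.ofReal_div_of_pos hε, mul_div_assoc, div_self hε.ne', mul_one]
    _ = θ := ENNReal.ofReal_toReal hθtop

/-! ### Assembly -/

/-- **Existence of the squared Bessel process `BESQ^δ(z₀)` for all real `δ, z₀`** (strong
solution of `dZ = δ dt + 2√|Z| dB`, `Z₀ = z₀`, driven by the canonical Brownian motion, adapted
to its raw natural filtration), as the limit of the Euler–Maruyama scheme.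
Revuz–Yor, *Continuous Martingales and Brownian Motion* (1999), Ch. XI, §1 (p. 439) and
Def. (1.1); the construction follows Yamada (1978) / Gyöngy–Rásonyi (2011) instead of the
Yamada–Watanabe theorem Ch. IX, Thm (1.7) used by Revuz–Yor. [folklore] -/
theorem exists_isSquaredBesselProcess :
    ∃ Z : ℝ≥0 → (ℝ≥0 → ℝ) → ℝ,
      IsSquaredBesselProcess δ z₀ Z Literature.Probability.Process.brownian Literature.Probability.RandomPlanarGeometry.brownianFiltration Literature.Probability.Process.preWienerMeasure := by
  haveI := Literature.Probability.RandomPlanarGeometry.isProbabilityMeasure_preWienerMeasure'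
  obtain ⟨J, hJa, hJc, hJ0, hJucp, hJm, φ, hφ, hJφ⟩ := exists_limit_eulerM δ z₀
  obtain ⟨hJL2, hL1, hmart⟩ := martingale_limit_eulerM hJa hφ hJφ
  have hL2 : ∀ (T : ℝ≥0) (κ : ℝ), 0 < κ → ∃ N, ∀ n ≥ N, ∀ t ≤ T,
      ∫⁻ ω, ENNReal.ofReal ((eulerM δ z₀ n t ω - J t ω) ^ 2) ∂Literature.Probability.Process.preWienerMeasure ≤ ENNReal.ofReal κ :=
    fun T κ hκ ↦ exists_forall_lintegral_eulerM_sub_sq_le hφ hJφ T hκ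
  set Z := eulerLimitZ δ z₀ J with hZ
  have hZm : Measurable (Function.uncurry Z) := measurable_uncurry_eulerLimitZ δ z₀ hJm
  have happrox := isApproxSeq_eulerSP δ z₀ hJm hL2
  -- the Itô-integral characterisation of `J`
  have hσ' : ∀ᵐ ω ∂Literature.Probability.Process.preWienerMeasure, Measurable fun s : ℝ ↦ besqσ (Z s.toNNReal ω) :=
    ae_of_all _ fun ω ↦ continuous_besqσ.measurable.comp (Literature.Probability.Process.measurable_section_toNNReal hZm ω)
  have hIto : Literature.Probability.Process.IsItoIntegral (fun s ω ↦ besqσ (Z s ω)) Literature.Probability.Process.brownian J Literature.Probability.RandomPlanarGeometry.brownianFiltration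
      Literature.Probability.Process.preWienerMeasure :=
    ⟨hJ0, hJc, hmart.isLocalMartingale, ⟨fun n ↦ eulerSP δ z₀ n, happrox⟩,
      fun Hn hHn ↦ Literature.Probability.Process.tendstoUCP_of_isApproxSeq_brownian hσ' happrox hHn hJucp⟩
  refine ⟨Z, fun ω ↦ ?_, fun t ↦ ?_, ⟨ae_of_all _ fun ω t ↦ ?_, J, hIto, ae_of_all _ fun ω t ↦ ?_⟩⟩
  · -- `Z 0 = z₀`
    simp [hZ, eulerLimitZ, hJ0 ω]
  · -- adapted
    exact (measurable_const.add (hJa t).measurable :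
      Measurable[Literature.Probability.RandomPlanarGeometry.brownianFiltration t] fun ω ↦ (z₀ + ∫ _ in (0 : ℝ)..t, δ) + J t ω)
  · -- the drift is locally integrable
    exact integrableOn_const (measure_Icc_lt_top (a := (0 : ℝ)) (b := (t : ℝ))).ne
  · -- the integral identity (literal)
    have h0 : Z 0 ω = z₀ := by simp [hZ, eulerLimitZ, hJ0 ω]
    rw [h0]
    rfl

/-- **Existence of squared Bessel processes**: discharge of the named fact
`Literature.Analysis.FunctionSpaces.exists_squaredBessel`.
Revuz–Yor, *Continuous Martingales and Brownian Motion* (1999), Ch. XI, §1 (p. 439) and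
Def. (1.1); Ch. IX, Thm (1.7). [cite: RevuzYor1999, Ch. XI §1 Def. (1.1) and Ch. IX Thm (1.7)] -/
theorem exists_squaredBessel_holds : exists_squaredBessel :=
  fun δ z₀ _ _ ↦ exists_isSquaredBesselProcess δ z₀

/-- **Well-posedness of squared Bessel processes**: discharge of the named fact
`Literature.Analysis.FunctionSpaces.existsUnique_squaredBessel` — for `δ ≥ 0`, `z₀ ≥ 0` (indeed for all real `δ, z₀`) the
squared Bessel SDE `dZ = δ dt + 2√|Z| dB`, `Z₀ = z₀` driven by the canonical Brownian motion has
a strong solution adapted to the raw Brownian filtration, unique up to indistinguishability.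
Revuz–Yor, *Continuous Martingales and Brownian Motion* (1999), Ch. XI, §1 (p. 439: "for every
`δ` and `x`, this equation has a unique strong solution") and Def. (1.1); Ch. IX, Thm (1.7),
Thm (3.5)(ii). [cite: RevuzYor1999, Ch. XI §1 Def. (1.1) and Ch. IX Thm (3.5)] -/
theorem existsUnique_squaredBessel_holds : existsUnique_squaredBessel :=
  existsUnique_squaredBessel_of_besq exists_squaredBessel_holds pathwiseUnique_squaredBessel_holds

end Existence

end Literature.Analysis.FunctionSpaces
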